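import Mathlib
import Literature.Computability.Complexity.RandomKSatEnsembleOGP
import HarnessLib

/-!
# Huang–Sellke 2025 random `k`-SAT: the resampling chain, multi-time marginals, slot factorization, block expansion and the literal-level slot bound — re-homed proofs, file 1 of 3

**Huang–Sellke 2025: the ensemble overlap-gap property of random `k`-SAT on the resampling chain (Lemma 3.22), the resampling-chain
obstructions (Lemmas 3.22–3.23) and strong low-degree hardness at clause density `α_k = 5·2^k log k / k` (Corollary 3.21)** — the three named
facts `Literature.Computability.Complexity.HuangSellke2025KSatEnsembleOGP`, `…HuangSellke2025KSatObstructions` (`RandomKSatEnsembleOGP.lean`) and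
`…HuangSellke2025KSat` (`RandomKSatLowDegreeHardness.lean`) HOLD (B. Huang, M. Sellke, *Strong low degree hardness for stable local optima in
spin glasses*, arXiv:2501.06427, §3.3.2, Lemma 3.22 «adaptation of Bresler–Huang 2021 Prop. 4.7(iii)», Lemma 3.23, Cor. 3.21 [HuangSellke2025];
G. Bresler, B. Huang, FOCS 2021 [BreslerHuang2021]).  ARCHITECTURE of the in-tree proof (kernel-checked, 0 cited facts; until now Summits-side
only, `Summits/PneNP/PneNP/Theorems/OverlapGapAlgebraSearchHardWindowEnsembleOGPHolds.lean`): the `ε`-resampling chain of random `k`-SAT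
formulas (kernel, semigroup, paths, two-block and multi-time marginals `stub_multiTimeMarginal`), the product over clause slots
(`stub_slotFactorization`), the mixture over refresh patterns (`stub_blockExpansion`), the LITERAL-level greedy slot bound (`stub_slotBound`) and the
band ⇒ first-appearance energy with `s` darts (the DartGame `en_rung`, `stub_bandEnergy`) give the per-tuple first moment `ogp_tupleBound`
(survival `≤ base^m`); with the band count (`stub_bandCount`, binomial entropy), the first moment at one `n` (`stub_ogpCore`) and the parameter
asymptotics (`stub_ogpAsymptotics`: `β = 2.65 log k/k`, `η = 0.05 log k/k`, …) this is Lemma 3.22; the moat / small-ball / entropy ladder of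
`NoStableSection*`, the grand correlation and resample stability / positivity give the chaos and instability legs, and `…StrongLDH` turns the
ensemble OGP into the obstructions (Lemma 3.23) and Cor. 3.21.  (Mathematical note carried over from the source: the printed reduction of Lemma 3.22
to coincident times is false pointwise for the literal-level chain; the in-tree proof bounds every time tuple directly.)  RE-HOMED into
`Literature/` by the Hodge foundations lane (`lit-hodgefound`, seat p20, generation 38) as THREE files: verbatim DECLARATION-LEVEL ports (the
declarations needed, in dependency order) of 42 Summits modules `Summits/PneNP/PneNP/Theorems/OverlapGapAlgebra{NoStableSection*,SearchHardWindow*}.lean`,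
namespaces `Summit.PneNP.PneNP.Theorems` / `Summit.PneNP.PneNP.Cruxes.NoStableSection.DartGame` re-rooted as
`Literature.Computability.Complexity.HuangSellke2025Chain` / `….HuangSellke2025Chain.DartGame` (in-tree `stub_…` names kept, they are proved
theorems; the DartGame gadgets `seqOf` & co. come with their bodies), followed (file 3) by the three EXACT-name discharges
`Literature.Computability.Complexity.HuangSellke2025KSatEnsembleOGP_holds`, `…HuangSellke2025KSatObstructions_holds`, `…HuangSellke2025KSat_holds`.
No new named fact (D-0026), no Summits import; built on the tree's Literature layer (`Computability/Complexity/{RandomKSatEnsembleOGP,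
RandomKSatLowDegreeHardness, BinomialEntropy*}`, `Probability/Moments/HoeffdingDecomposition`) and Mathlib.  The Summits
originals stay in place (transitional duplication).  WHAT THIS IS NOT: nothing about P vs NP; no claim beyond the three displayed statements
(ensemble OGP on the resampling chain, the obstructions, and the deterministic saturated form of Cor. 3.21 with `κ = 5`).

THIS FILE (1 of 3) ports: OverlapGapAlgebraNoStableSectionDefs, OverlapGapAlgebraSearchHardWindowChainMassBasic, OverlapGapAlgebraSearchHardWindowChainMassUnion, OverlapGapAlgebraSearchHardWindowChaosAssembly, OverlapGapAlgebraSearchHardWindowResampleKernelBasic, OverlapGapAlgebraSearchHardWindowKernelSemigroup, OverlapGapAlgebraSearchHardWindowKernelPowPaths, OverlapGapAlgebraSearchHardWindowChainTwoBlock, OverlapGapAlgebraSearchHardWindowMultiTimeMarginal, OverlapGapAlgebraSearchHardWindowSlotFactorization, OverlapGapAlgebraSearchHardWindowBlockExpansion, OverlapGapAlgebraSearchHardWindowSlotBound.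
-/

noncomputable section

/-!
## Part 1 — port of `Summits/PneNP/PneNP/Theorems/OverlapGapAlgebraNoStableSectionDefs.lean` (19 declarations kept)

# Route OverlapGapAlgebra, crux `NoStableSection` , line `DartGame`: definitions

Objects posited by the line `DartGame` (lead prover-line-stmt-PneNP-2462-0, 2026-08-16) for the
crux `Summit.PneNP.PneNP.Theses.OverlapGapAlgebra.NoStableSection` — Bresler–Huang's ensemble
multi-OGP for random `k`-SAT (arXiv:2106.02129, §4–5) read for an ARBITRARY section `g`, in pure
counting form over the crux's typed path space. The skeleton
`Summits/PneNP/PneNP/Cruxes/NoStableSection/Lines/DartGame.lean` and its stub files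
`Theorems/OverlapGapAlgebraNoStableSection*.lean` are stated in exactly this vocabulary:
* the path: `Inst m k n` (verbatim the crux's `Fin m → Fin k → Fin n × Bool`), `PathSp k m n`
  (`k+1` i.i.d. arrays), `splice` (verbatim the crux's `let P`), `instAt` (the same instance indexed
  by the linear time `t = r·(m k) + q ∈ [0, k·(m k)]`, BH Def. 4.2), `violCount`;
* the entropy functional of the ladder argument, on sequences of assignments `Y : ℕ → Fin n → Bool`
  (only finitely many rungs are ever read): `patCount Y ℓ ξ` (positions whose column over rungs
  `0..ℓ-1` is `ξ`), `typeEnt Y ℓ = Σ_ξ η(patCount/n)` (empirical entropy of the first `ℓ` rungs,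
  nats), `condEnt Y ℓ = typeEnt Y (ℓ+1) - typeEnt Y ℓ` (conditional entropy of rung `ℓ` given
  rungs `< ℓ`: the ORDERED form of BH's conditional overlap entropy, Def. 4.3 / Fact 4.5), `withRung`
  (insert a candidate as rung `ℓ`), `seqOf` (a finite tuple as a sequence);
* the energy functional `energySum Y k = Σ_{I : Fin k → Fin n} #{(Y ℓ ∘ I) : ℓ ≤ k}` (BH §5.1);
* the three events of the decomposition `StableValid ⊆ IndepBad ∪ OgpBad` (BH Prop. 4.6):
  `StableValid` (the crux's event), `IndepBad` (complement of BH's `S_indep`, §4.4, with "at least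
  one sweep after every earlier rung"), `OgpBad` (complement of `S_ogp`).
Bookkeeping proved here: `splice_zero/full/succ_of_ne`, `instAt_eq_splice`, `sum_patCount`,
`patCount_succ_eq`, the CONDITIONAL FORM `condEnt_eq_sum_binEntropy`
(`condEnt Y ℓ = Σ_ξ (N_ξ/n) · h₂(N_{ξ1}/N_ξ)`), `condEnt_nonneg`, locality (`*_congr`).
Sources: Bresler–Huang, FOCS 2021 / arXiv:2106.02129 §4–5; Cover–Thomas Thm 11.1.3 (types).

(Verbatim declaration-level port — the declarations listed in the Part header count — of the Summits-side module of the PneNP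
tree (route OverlapGapAlgebra, crux SearchHardWindow / NoStableSection); route / stub / lead bookkeeping in the text above is historical.)
-/

section Part1

namespace Literature.Computability.Complexity.HuangSellke2025Chain.DartGame

open _root_.Finset _root_.Real

/-! ## Empirical (type) entropies of a sequence of assignments -/

section Entropy

variable {n : ℕ}

/-- Number of positions `i` whose column over the first `ℓ` rungs is the pattern `ξ`.
[cite: HuangSellke2025, §3.3.2 (Lemma 3.22, resampling-chain bookkeeping of the in-tree proof)] -/
def patCount (Y : ℕ → Fin n → Bool) (ℓ : ℕ) (ξ : Fin ℓ → Bool) : ℕ :=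
  (univ.filter fun i : Fin n => (fun j : Fin ℓ => Y j i) = ξ).card

/-- Empirical entropy (nats) of the column patterns of the first `ℓ` rungs:
`H_ℓ(Y) = Σ_ξ η(N_ℓ(ξ)/n)`, `η = Real.negMulLog`.
[cite: HuangSellke2025, §3.3.2 (Lemma 3.22, resampling-chain bookkeeping of the in-tree proof)] -/
noncomputable def typeEnt (Y : ℕ → Fin n → Bool) (ℓ : ℕ) : ℝ :=
  ∑ ξ : Fin ℓ → Bool, negMulLog ((patCount Y ℓ ξ : ℝ) / n)

/-- Conditional (type) entropy of rung `ℓ` given rungs `0, …, ℓ-1`: `H_{ℓ+1} - H_ℓ`.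
[cite: HuangSellke2025, §3.3.2 (Lemma 3.22, resampling-chain bookkeeping of the in-tree proof)] -/
noncomputable def condEnt (Y : ℕ → Fin n → Bool) (ℓ : ℕ) : ℝ :=
  typeEnt Y (ℓ + 1) - typeEnt Y ℓ

/-- The sequence `R` with the candidate `v` inserted as rung `ℓ` (and all later rungs).
[cite: HuangSellke2025, §3.3.2 (Lemma 3.22, resampling-chain bookkeeping of the in-tree proof)] -/
def withRung (R : ℕ → Fin n → Bool) (ℓ : ℕ) (v : Fin n → Bool) : ℕ → Fin n → Bool :=
  fun j => if j < ℓ then R j else v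

/-- A finite tuple of assignments as a sequence (junk value `false` beyond its length).
[cite: HuangSellke2025, §3.3.2 (Lemma 3.22, resampling-chain bookkeeping of the in-tree proof)] -/
def seqOf {L : ℕ} (Y : Fin L → Fin n → Bool) : ℕ → Fin n → Bool :=
  fun j => if h : j < L then Y ⟨j, h⟩ else fun _ => false

/-- `seqOf` below the length.
[cite: HuangSellke2025, §3.3.2 (Lemma 3.22, resampling-chain bookkeeping of the in-tree proof)] -/
theorem seqOf_apply_lt {L : ℕ} (Y : Fin L → Fin n → Bool) {j : ℕ} (h : j < L) :
    seqOf Y j = Y ⟨j, h⟩ := by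
  simp [seqOf, h]

/-- `seqOf` at an index of the tuple.
[cite: HuangSellke2025, §3.3.2 (Lemma 3.22, resampling-chain bookkeeping of the in-tree proof)] -/
@[simp] theorem seqOf_apply_fin {L : ℕ} (Y : Fin L → Fin n → Bool) (j : Fin L) :
    seqOf Y j = Y j := by
  simp [seqOf, j.isLt]

/-- `withRung` below the insertion point reads the prefix.
[cite: HuangSellke2025, §3.3.2 (Lemma 3.22, resampling-chain bookkeeping of the in-tree proof)] -/
theorem withRung_of_lt (R : ℕ → Fin n → Bool) (ℓ : ℕ) (v : Fin n → Bool) {j : ℕ} (h : j < ℓ) :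
    withRung R ℓ v j = R j := by
  simp [withRung, h]

/-- `withRung` at and beyond the insertion point reads the candidate.
[cite: HuangSellke2025, §3.3.2 (Lemma 3.22, resampling-chain bookkeeping of the in-tree proof)] -/
theorem withRung_of_le (R : ℕ → Fin n → Bool) (ℓ : ℕ) (v : Fin n → Bool) {j : ℕ} (h : ℓ ≤ j) :
    withRung R ℓ v j = v := by
  simp [withRung, Nat.not_lt.2 h]

/-- `withRung` at the insertion point is the candidate.
[cite: HuangSellke2025, §3.3.2 (Lemma 3.22, resampling-chain bookkeeping of the in-tree proof)] -/
@[simp] theorem withRung_self (R : ℕ → Fin n → Bool) (ℓ : ℕ) (v : Fin n → Bool) :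
    withRung R ℓ v ℓ = v :=
  withRung_of_le R ℓ v le_rfl

/-- `withRung R ℓ v` only reads `R` below `ℓ`.
[cite: HuangSellke2025, §3.3.2 (Lemma 3.22, resampling-chain bookkeeping of the in-tree proof)] -/
theorem withRung_congr {R R' : ℕ → Fin n → Bool} {ℓ : ℕ} (h : ∀ j < ℓ, R j = R' j)
    (v : Fin n → Bool) : withRung R ℓ v = withRung R' ℓ v := by
  funext j
  by_cases hj : j < ℓ
  · simp [withRung, hj, h j hj]
  · simp [withRung, hj]

/-- `patCount Y ℓ` only reads rungs `< ℓ`.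
[cite: HuangSellke2025, §3.3.2 (Lemma 3.22, resampling-chain bookkeeping of the in-tree proof)] -/
theorem patCount_congr {Y Y' : ℕ → Fin n → Bool} {ℓ : ℕ} (h : ∀ j < ℓ, Y j = Y' j)
    (ξ : Fin ℓ → Bool) : patCount Y ℓ ξ = patCount Y' ℓ ξ := by
  unfold patCount
  congr 1
  ext i
  simp only [mem_filter, mem_univ, true_and]
  have : (fun j : Fin ℓ => Y j i) = fun j : Fin ℓ => Y' j i := by
    funext j; rw [h j j.isLt]
  rw [this]

/-- `typeEnt Y ℓ` only reads rungs `< ℓ`.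
[cite: HuangSellke2025, §3.3.2 (Lemma 3.22, resampling-chain bookkeeping of the in-tree proof)] -/
theorem typeEnt_congr {Y Y' : ℕ → Fin n → Bool} {ℓ : ℕ} (h : ∀ j < ℓ, Y j = Y' j) :
    typeEnt Y ℓ = typeEnt Y' ℓ := by
  unfold typeEnt
  exact sum_congr rfl fun ξ _ => by rw [patCount_congr h]

/-- `condEnt Y ℓ` only reads rungs `≤ ℓ`.
[cite: HuangSellke2025, §3.3.2 (Lemma 3.22, resampling-chain bookkeeping of the in-tree proof)] -/
theorem condEnt_congr {Y Y' : ℕ → Fin n → Bool} {ℓ : ℕ} (h : ∀ j ≤ ℓ, Y j = Y' j) :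
    condEnt Y ℓ = condEnt Y' ℓ := by
  unfold condEnt
  rw [typeEnt_congr (fun j hj => h j (by omega)), typeEnt_congr (fun j hj => h j (by omega))]

/-- The potential of the ladder argument is local in the prefix.
[cite: HuangSellke2025, §3.3.2 (Lemma 3.22, resampling-chain bookkeeping of the in-tree proof)] -/
theorem condEnt_withRung_congr {R R' : ℕ → Fin n → Bool} {ℓ : ℕ} (h : ∀ j < ℓ, R j = R' j)
    (v : Fin n → Bool) : condEnt (withRung R ℓ v) ℓ = condEnt (withRung R' ℓ v) ℓ := by
  rw [withRung_congr h]

/-- The pattern classes partition the positions: `Σ_ξ N_ℓ(ξ) = n`.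
[cite: HuangSellke2025, §3.3.2 (Lemma 3.22, resampling-chain bookkeeping of the in-tree proof)] -/
theorem sum_patCount (Y : ℕ → Fin n → Bool) (ℓ : ℕ) : ∑ ξ : Fin ℓ → Bool, patCount Y ℓ ξ = n := by
  unfold patCount
  rw [← card_eq_sum_card_fiberwise (f := fun i : Fin n => fun j : Fin ℓ => Y j i) (s := univ)
    (t := univ) (fun _ _ => mem_univ _)]
  simp

/-- Refining a pattern class by the value of rung `ℓ`: `N_ℓ(ξ) = N_{ℓ+1}(ξ·true) + N_{ℓ+1}(ξ·false)`
(patterns of length `ℓ+1` written as `Fin.snoc ξ b`).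
[cite: HuangSellke2025, §3.3.2 (Lemma 3.22, resampling-chain bookkeeping of the in-tree proof)] -/
theorem patCount_succ_eq (Y : ℕ → Fin n → Bool) (ℓ : ℕ) (ξ : Fin ℓ → Bool) :
    patCount Y ℓ ξ = patCount Y (ℓ + 1) (Fin.snoc ξ true) + patCount Y (ℓ + 1) (Fin.snoc ξ false) := by
  unfold patCount
  rw [← card_union_of_disjoint]
  · congr 1
    ext i
    simp only [mem_filter, mem_univ, true_and, mem_union]
    constructor
    · intro h
      cases hb : Y ℓ i
      · right
        funext j
        refine Fin.lastCases ?_ (fun j => ?_) j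
        · simp [hb]
        · simpa using congrFun h j
      · left
        funext j
        refine Fin.lastCases ?_ (fun j => ?_) j
        · simp [hb]
        · simpa using congrFun h j
    · rintro (h | h)
      · funext j
        have := congrFun h (Fin.castSucc j)
        simpa using this
      · funext j
        have := congrFun h (Fin.castSucc j)
        simpa using this
  · rw [disjoint_filter]
    intro i _ h1 h2
    have h1' := congrFun h1 (Fin.last ℓ)
    have h2' := congrFun h2 (Fin.last ℓ)
    simp only [Fin.snoc_last] at h1' h2'
    rw [h1'] at h2'
    exact Bool.noConfusion h2'

/-- The sum over patterns of length `ℓ + 1` as a sum over (pattern of length `ℓ`, last bit).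
[cite: HuangSellke2025, §3.3.2 (Lemma 3.22, resampling-chain bookkeeping of the in-tree proof)] -/
theorem sum_pattern_succ {M : Type*} [AddCommMonoid M] (ℓ : ℕ) (f : (Fin (ℓ + 1) → Bool) → M) :
    ∑ ξ' : Fin (ℓ + 1) → Bool, f ξ' =
      ∑ ξ : Fin ℓ → Bool, (f (Fin.snoc ξ true) + f (Fin.snoc ξ false)) := by
  rw [← (Fin.snocEquiv fun _ : Fin (ℓ + 1) => Bool).sum_comp, Fintype.sum_prod_type,
    Fintype.sum_bool, ← sum_add_distrib]
  rfl

/-- **Conditional form** of the conditional type entropy (BH Fact 4.5, chain rule, read backwards):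
`condEnt Y ℓ = Σ_ξ (N_ℓ(ξ)/n) · h₂(N_{ℓ+1}(ξ·true)/N_ℓ(ξ))` with `h₂ = Real.binEntropy` (a class with
`N_ℓ(ξ) = 0` contributes `0`).
[cite: HuangSellke2025, §3.3.2 (Lemma 3.22, resampling-chain bookkeeping of the in-tree proof)] -/
theorem condEnt_eq_sum_binEntropy (Y : ℕ → Fin n → Bool) (ℓ : ℕ) :
    condEnt Y ℓ = ∑ ξ : Fin ℓ → Bool, ((patCount Y ℓ ξ : ℝ) / n) *
      binEntropy ((patCount Y (ℓ + 1) (Fin.snoc ξ true) : ℝ) / patCount Y ℓ ξ) := by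
  unfold condEnt typeEnt
  rw [sum_pattern_succ, ← sum_sub_distrib]
  refine sum_congr rfl fun ξ _ => ?_
  -- abbreviations: `N = A + B`
  have hN := patCount_succ_eq Y ℓ ξ
  set N : ℕ := patCount Y ℓ ξ
  set A : ℕ := patCount Y (ℓ + 1) (Fin.snoc ξ true)
  set B : ℕ := patCount Y (ℓ + 1) (Fin.snoc ξ false)
  rcases Nat.eq_zero_or_pos N with hN0 | hNpos
  · have hA : A = 0 := by omega
    have hB : B = 0 := by omega
    simp [hN0, hA, hB, negMulLog]
  · have hNr : (0 : ℝ) < N := by exact_mod_cast hNpos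
    set lam : ℝ := (A : ℝ) / N with hlam
    have hA' : (A : ℝ) / n = lam * ((N : ℝ) / n) := by
      rw [hlam]; field_simp
    have hB' : (B : ℝ) / n = (1 - lam) * ((N : ℝ) / n) := by
      have : (B : ℝ) = N - A := by
        have : (N : ℝ) = A + B := by exact_mod_cast hN
        linarith
      rw [this, hlam]
      field_simp
    rw [hA', hB', negMulLog_mul, negMulLog_mul, binEntropy_eq_negMulLog_add_negMulLog_one_sub]
    ring

end Entropy

end Literature.Computability.Complexity.HuangSellke2025Chain.DartGame

end Part1

/-!
## Part 2 — port of `Summits/PneNP/PneNP/Theorems/OverlapGapAlgebraSearchHardWindowChainMassBasic.lean` (10 declarations kept)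

# Route OverlapGapAlgebra, crux `SearchHardWindow` : chain-mass bookkeeping

For the `ε`-resampling Markov chain on a finite product space `ι → Γ` (Huang–Sellke 2025 §3.3.2;
vocabulary `resampleKernel`, `resampleChainMass` of
`Literature/Computability/Complexity/RandomKSatEnsembleOGP.lean`) the mass of an event `E` on paths
is the finite weighted count
`resampleChainMass ε K E = (Σ_y (∏_{t<K} P_ε(y t, y (t+1))) · [E (t ↦ y (min t K))]) / #(ι → Γ)`,
the sum ranging over `y : Fin (K+1) → ι → Γ`.

`stub_chainMassBasic` records three bookkeeping facts used by the assembly of line `Sketch`: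
(1) the mass is monotone in the event and (2) subadditive under `∨` — both because the path weights
`∏_t P_ε(y t, y (t+1))` are nonnegative for `0 ≤ ε ≤ 1` (each kernel factor is
`(1 − ε)·{0,1} + ε/|Γ| ≥ 0`, as in `stub_resampleKernelBasic` (a) of
`Theorems/OverlapGapAlgebraSearchHardWindowResampleKernelBasic.lean`) and the indicators satisfy
`[E] ≤ [E']` for `E → E'` and `[E ∨ E'] ≤ [E] + [E']`; and (3) on the event "good at all times
`≤ K` and close at all steps `< K`" the mass times `#(ι → Γ)` is literally the path sum indexed by
`Fin (K+1)` / `Fin K` (the `ℕ`-indexed path `t ↦ y (min t K)` evaluates to `y t` for `t ≤ K` and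
to `y (t+1)` at `t + 1` for `t < K`).

(Verbatim declaration-level port — the declarations listed in the Part header count — of the Summits-side module of the PneNP
tree (route OverlapGapAlgebra, crux SearchHardWindow / NoStableSection); route / stub / lead bookkeeping in the text above is historical.)
-/

section Part2

namespace Literature.Computability.Complexity.HuangSellke2025Chain

open _root_.Finset
open Literature.Computability.Complexity
open scoped _root_.Classical

/-- The resampling kernel `P_ε(y, y') = ∏_i ((1 − ε)·[y i = y' i] + ε/|Γ|)` is nonnegative for
`0 ≤ ε ≤ 1`: each factor is the sum of `(1 − ε)·{0, 1} ≥ 0` and `ε/|Γ| ≥ 0`.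
[cite: HuangSellke2025, §3.3.2 (Lemma 3.22, resampling-chain bookkeeping of the in-tree proof)] -/
theorem cmb_kernel_nonneg {ι Γ : Type*} [Fintype ι] [Fintype Γ] [DecidableEq Γ] (ε : ℝ)
    (hε0 : 0 ≤ ε) (hε1 : ε ≤ 1) (y y' : ι → Γ) : 0 ≤ resampleKernel ε y y' := by
  unfold resampleKernel
  refine Finset.prod_nonneg fun i _ => add_nonneg ?_ (div_nonneg hε0 (Nat.cast_nonneg _))
  exact mul_nonneg (sub_nonneg.mpr hε1) (by split_ifs <;> norm_num)

/-- Path weights `∏_{t<K} P_ε(y t, y (t+1))` of the resampling chain are nonnegative.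
[cite: HuangSellke2025, §3.3.2 (Lemma 3.22, resampling-chain bookkeeping of the in-tree proof)] -/
theorem cmb_pathWeight_nonneg {ι Γ : Type*} [Fintype ι] [Fintype Γ] [DecidableEq Γ] (ε : ℝ)
    (hε0 : 0 ≤ ε) (hε1 : ε ≤ 1) (K : ℕ) (y : Fin (K + 1) → ι → Γ) :
    0 ≤ ∏ t : Fin K, resampleKernel ε (y t.castSucc) (y t.succ) :=
  Finset.prod_nonneg fun _ _ => cmb_kernel_nonneg ε hε0 hε1 _ _

/-- Indicators are monotone: `[p] ≤ [q]` when `p → q` (any `Decidable` instances).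
[cite: HuangSellke2025, §3.3.2 (Lemma 3.22, resampling-chain bookkeeping of the in-tree proof)] -/
theorem cmb_ite_le_ite_of_imp {p q : Prop} {hp : Decidable p} {hq : Decidable q} (h : p → q) :
    @ite ℝ p hp 1 0 ≤ @ite ℝ q hq 1 0 := by
  by_cases hp' : p
  · rw [if_pos hp', if_pos (h hp')]
  · by_cases hq' : q
    · rw [if_neg hp', if_pos hq']
      exact zero_le_one
    · rw [if_neg hp', if_neg hq']

/-- Indicators are subadditive: `[p ∨ q] ≤ [p] + [q]` (any `Decidable` instances).
[cite: HuangSellke2025, §3.3.2 (Lemma 3.22, resampling-chain bookkeeping of the in-tree proof)] -/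
theorem cmb_ite_or_le {p q : Prop} {hp : Decidable p} {hq : Decidable q} {hpq : Decidable (p ∨ q)} :
    @ite ℝ (p ∨ q) hpq 1 0 ≤ @ite ℝ p hp 1 0 + @ite ℝ q hq 1 0 := by
  by_cases hp' : p
  · rw [if_pos (Or.inl hp'), if_pos hp']
    by_cases hq' : q
    · rw [if_pos hq']
      norm_num
    · rw [if_neg hq', add_zero]
  · rw [if_neg hp', zero_add]
    by_cases hq' : q
    · rw [if_pos (Or.inr hq'), if_pos hq']
    · rw [if_neg hq', if_neg (not_or.mpr ⟨hp', hq'⟩)]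

/-- Indicators of equivalent propositions agree (any `Decidable` instances).
[cite: HuangSellke2025, §3.3.2 (Lemma 3.22, resampling-chain bookkeeping of the in-tree proof)] -/
theorem cmb_ite_congr {p q : Prop} {hp : Decidable p} {hq : Decidable q} (h : p ↔ q) :
    @ite ℝ p hp 1 0 = @ite ℝ q hq 1 0 := by
  by_cases hq' : q
  · rw [if_pos hq', if_pos (h.2 hq')]
  · rw [if_neg hq', if_neg (mt h.1 hq')]

/-- The clamped time `min t K` of a time `t : Fin (K+1)` is `t` itself.
[cite: HuangSellke2025, §3.3.2 (Lemma 3.22, resampling-chain bookkeeping of the in-tree proof)] -/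
theorem cmb_minFin_eq (K : ℕ) (t : Fin (K + 1)) :
    (⟨min (t : ℕ) K, Nat.lt_succ_of_le (Nat.min_le_right _ _)⟩ : Fin (K + 1)) = t :=
  Fin.ext (min_eq_left (Nat.lt_succ_iff.1 t.2))

/-- The clamped time `min t K` of a step `t : Fin K` is `t.castSucc`.
[cite: HuangSellke2025, §3.3.2 (Lemma 3.22, resampling-chain bookkeeping of the in-tree proof)] -/
theorem cmb_minFin_eq_castSucc (K : ℕ) (t : Fin K) :
    (⟨min (t : ℕ) K, Nat.lt_succ_of_le (Nat.min_le_right _ _)⟩ : Fin (K + 1)) = t.castSucc :=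
  Fin.ext (min_eq_left (le_of_lt t.2))

/-- The clamped time `min (t + 1) K` after a step `t : Fin K` is `t.succ`.
[cite: HuangSellke2025, §3.3.2 (Lemma 3.22, resampling-chain bookkeeping of the in-tree proof)] -/
theorem cmb_minFin_succ_eq_succ (K : ℕ) (t : Fin K) :
    (⟨min ((t : ℕ) + 1) K, Nat.lt_succ_of_le (Nat.min_le_right _ _)⟩ : Fin (K + 1)) = t.succ :=
  Fin.ext (min_eq_left (Nat.succ_le_of_lt t.2))

/-- The "good at all times `≤ K`, close at all steps `< K`" event, read on the `ℕ`-indexed path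
`t ↦ y (min t K)`, is the `Fin`-indexed conjunction.
[cite: HuangSellke2025, §3.3.2 (Lemma 3.22, resampling-chain bookkeeping of the in-tree proof)] -/
theorem cmb_goodClose_iff {α : Type*} (K : ℕ) (y : Fin (K + 1) → α) (good : α → Bool)
    (close : α → α → Bool) :
    ((∀ t ≤ K, good (y ⟨min t K, Nat.lt_succ_of_le (Nat.min_le_right t K)⟩) = true) ∧
        ∀ t < K, close (y ⟨min t K, Nat.lt_succ_of_le (Nat.min_le_right t K)⟩)
          (y ⟨min (t + 1) K, Nat.lt_succ_of_le (Nat.min_le_right (t + 1) K)⟩) = true) ↔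
      ((∀ t, good (y t) = true) ∧ ∀ t : Fin K, close (y t.castSucc) (y t.succ) = true) := by
  constructor
  · rintro ⟨hg, hc⟩
    refine ⟨fun t => ?_, fun t => ?_⟩
    · have h := hg t (Nat.lt_succ_iff.1 t.2)
      rwa [cmb_minFin_eq K t] at h
    · have h := hc t t.2
      rwa [cmb_minFin_eq_castSucc K t, cmb_minFin_succ_eq_succ K t] at h
  · rintro ⟨hg, hc⟩
    refine ⟨fun t _ => hg _, fun t ht => ?_⟩
    have e1 : (⟨min t K, Nat.lt_succ_of_le (Nat.min_le_right t K)⟩ : Fin (K + 1)) =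
        Fin.castSucc ⟨t, ht⟩ := Fin.ext (min_eq_left ht.le)
    have e2 : (⟨min (t + 1) K, Nat.lt_succ_of_le (Nat.min_le_right (t + 1) K)⟩ : Fin (K + 1)) =
        Fin.succ ⟨t, ht⟩ := Fin.ext (min_eq_left (Nat.succ_le_of_lt ht))
    rw [e1, e2]
    exact hc ⟨t, ht⟩

/-- **Chain-mass bookkeeping** for the `ε`-resampling chain (`0 ≤ ε ≤ 1`): `resampleChainMass ε K`
is (1) monotone and (2) subadditive in the event (the path weights are nonnegative), and (3) on the
event "good at all times `≤ K` and close at all steps `< K`" the mass times `#(ι → Γ)` is the path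
sum `Σ_y (∏_{t<K} P_ε(y t, y (t+1))) · [∀ t, good (y t)] · [∀ t < K, close (y t) (y (t+1))]`
indexed by `Fin (K+1)` / `Fin K` (the form of the grand-correlation lemma).
[cite: HuangSellke2025, §3.3.2 (Lemma 3.22, resampling-chain bookkeeping of the in-tree proof)] -/
theorem stub_chainMassBasic {ι Γ : Type*} [Fintype ι] [DecidableEq ι] [Fintype Γ] [DecidableEq Γ]
    [Nonempty Γ] (ε : ℝ) (hε0 : 0 ≤ ε) (hε1 : ε ≤ 1) (K : ℕ) :
    (∀ E E' : (ℕ → ι → Γ) → Prop, (∀ z, E z → E' z) →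
        resampleChainMass ε K E ≤ resampleChainMass ε K E') ∧
    (∀ E E' : (ℕ → ι → Γ) → Prop,
        resampleChainMass ε K (fun z => E z ∨ E' z) ≤
          resampleChainMass ε K E + resampleChainMass ε K E') ∧
    (∀ (good : (ι → Γ) → Bool) (close : (ι → Γ) → (ι → Γ) → Bool),
        resampleChainMass ε K (fun z => (∀ t ≤ K, good (z t) = true) ∧
            ∀ t < K, close (z t) (z (t + 1)) = true) * Fintype.card (ι → Γ) =
          ∑ y : Fin (K + 1) → ι → Γ, (∏ t : Fin K, resampleKernel ε (y t.castSucc) (y t.succ)) *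
            (if (∀ t, good (y t) = true) ∧ (∀ t : Fin K, close (y t.castSucc) (y t.succ) = true)
              then (1 : ℝ) else 0)) := by
  refine ⟨fun E E' hEE' => ?_, fun E E' => ?_, fun good close => ?_⟩
  · -- (1) monotonicity
    unfold resampleChainMass
    refine div_le_div_of_nonneg_right (Finset.sum_le_sum fun y _ => ?_) (Nat.cast_nonneg _)
    exact mul_le_mul_of_nonneg_left (cmb_ite_le_ite_of_imp (hEE' _))
      (cmb_pathWeight_nonneg ε hε0 hε1 K y)
  · -- (2) subadditivity
    unfold resampleChainMass
    rw [← add_div, ← Finset.sum_add_distrib]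
    refine div_le_div_of_nonneg_right (Finset.sum_le_sum fun y _ => ?_) (Nat.cast_nonneg _)
    rw [← mul_add]
    exact mul_le_mul_of_nonneg_left cmb_ite_or_le (cmb_pathWeight_nonneg ε hε0 hε1 K y)
  · -- (3) the good/close event is the `Fin`-indexed path sum
    have hcard : (Fintype.card (ι → Γ) : ℝ) ≠ 0 := by exact_mod_cast Fintype.card_ne_zero
    unfold resampleChainMass
    rw [div_mul_cancel₀ _ hcard]
    refine Finset.sum_congr rfl fun y _ => ?_
    congr 1
    exact cmb_ite_congr (cmb_goodClose_iff K y good close)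

end Literature.Computability.Complexity.HuangSellke2025Chain

end Part2

/-!
## Part 3 — port of `Summits/PneNP/PneNP/Theorems/OverlapGapAlgebraSearchHardWindowChainMassUnion.lean` (2 declarations kept)

# Route OverlapGapAlgebra, crux `SearchHardWindow` : union bound for the chain mass

For the `ε`-resampling Markov chain on a finite product space `ι → Γ` (Huang–Sellke 2025 §3.3.2;
vocabulary `resampleKernel`, `resampleChainMass` of
`Literature/Computability/Complexity/RandomKSatEnsembleOGP.lean`) the mass of an event `E` on paths
is the finite weighted count
`resampleChainMass ε K E = (Σ_y (∏_{t<K} P_ε(y t, y (t+1))) · [E (t ↦ y (min t K))]) / #(ι → Γ)`,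
the sum ranging over `y : Fin (K+1) → ι → Γ`.

`stub_chainMassUnion` is the finite union bound `mass(∃ x, E x) ≤ Σ_x mass(E x)` over a finite index
type `X`, used by the first-moment step (the CHAOS lemma, Huang–Sellke 2025 Lemma 3.23) of line
`Sketch`: after pulling the division and the sum over `x` through (`Finset.sum_div`,
`Finset.sum_comm`, `Finset.mul_sum`) it is, for each path `y`, the indicator inequality
`[∃ x, E x z] ≤ Σ_x [E x z]` (a witness contributes a term `1` to a sum of nonnegative terms)
multiplied by the nonnegative path weight (`cmb_pathWeight_nonneg` of
`Theorems/OverlapGapAlgebraSearchHardWindowChainMassBasic.lean`, valid for `0 ≤ ε ≤ 1`).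

(Verbatim declaration-level port — the declarations listed in the Part header count — of the Summits-side module of the PneNP
tree (route OverlapGapAlgebra, crux SearchHardWindow / NoStableSection); route / stub / lead bookkeeping in the text above is historical.)
-/

section Part3

namespace Literature.Computability.Complexity.HuangSellke2025Chain

open _root_.Finset
open Literature.Computability.Complexity
open scoped _root_.Classical

/-- Indicator union bound over a finite type: `[∃ x, p x] ≤ Σ_x [p x]` (any `Decidable`
instances). If the `∃` holds with witness `x₀`, the right-hand sum of nonnegative indicators is at
least its `x₀` term `1`; otherwise the left side is `0`.
[cite: HuangSellke2025, §3.3.2 (Lemma 3.22, resampling-chain bookkeeping of the in-tree proof)] -/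
theorem cmu_ite_exists_le_sum {X : Type*} [Fintype X] {p : X → Prop} {hp : ∀ x, Decidable (p x)}
    {hex : Decidable (∃ x, p x)} :
    @ite ℝ (∃ x, p x) hex 1 0 ≤ ∑ x, @ite ℝ (p x) (hp x) 1 0 := by
  have hnn : ∀ x ∈ (Finset.univ : Finset X), (0 : ℝ) ≤ @ite ℝ (p x) (hp x) 1 0 := fun x _ => by
    split_ifs <;> norm_num
  by_cases h : ∃ x, p x
  · obtain ⟨x₀, hx₀⟩ := h
    rw [if_pos ⟨x₀, hx₀⟩]
    calc (1 : ℝ) = @ite ℝ (p x₀) (hp x₀) 1 0 := by rw [if_pos hx₀]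
      _ ≤ ∑ x, @ite ℝ (p x) (hp x) 1 0 :=
        Finset.single_le_sum (f := fun x => @ite ℝ (p x) (hp x) 1 0) hnn (Finset.mem_univ x₀)
  · rw [if_neg h]
    exact Finset.sum_nonneg hnn

/-- **Union bound for the chain mass** of the `ε`-resampling chain (`0 ≤ ε ≤ 1`): over a finite
index type `X`, `resampleChainMass ε K (∃ x, E x ·) ≤ Σ_x resampleChainMass ε K (E x)`. The path
weights `∏_{t<K} P_ε(y t, y (t+1))` are nonnegative, so the bound is the pathwise indicator
inequality `[∃ x, E x z] ≤ Σ_x [E x z]` summed against them.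
[cite: HuangSellke2025, §3.3.2 (Lemma 3.22, resampling-chain bookkeeping of the in-tree proof)] -/
theorem stub_chainMassUnion {ι Γ X : Type*} [Fintype ι] [DecidableEq ι] [Fintype Γ] [DecidableEq Γ]
    [Nonempty Γ] [Fintype X] (ε : ℝ) (hε0 : 0 ≤ ε) (hε1 : ε ≤ 1) (K : ℕ)
    (E : X → (ℕ → ι → Γ) → Prop) :
    resampleChainMass ε K (fun z => ∃ x, E x z) ≤ ∑ x, resampleChainMass ε K (E x) := by
  unfold resampleChainMass
  rw [← Finset.sum_div]
  refine div_le_div_of_nonneg_right ?_ (Nat.cast_nonneg _)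
  rw [Finset.sum_comm]
  refine Finset.sum_le_sum fun y _ => ?_
  rw [← Finset.mul_sum]
  exact mul_le_mul_of_nonneg_left cmu_ite_exists_le_sum (cmb_pathWeight_nonneg ε hε0 hε1 K y)

end Literature.Computability.Complexity.HuangSellke2025Chain

end Part3

/-!
## Part 4 — port of `Summits/PneNP/PneNP/Theorems/OverlapGapAlgebraSearchHardWindowChaosAssembly.lean` (12 declarations kept)

# Route OverlapGapAlgebra, crux `SearchHardWindow` , line `Sketch`: the chaos lemma
# (Huang–Sellke 2025, Lemma 3.23) assembled from the per-tuple first moment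

Stub `stub_chaosAssembly` of the skeleton `Summits/PneNP/PneNP/Cruxes/SearchHardWindow/Lines/Sketch.lean`
(section `Chaos`). Vocabulary (`resampleChainMass`, `overlapCondEnt`) is the tree's
`Literature/Computability/Complexity/RandomKSatEnsembleOGP.lean`; the conclusion is VERBATIM the
CHAOS clause of the named fact `HuangSellke2025KSatObstructions` there, for every `k ≥ 2` and every
`β < 5 log k / k`.

The four generic inputs are hypotheses (discharged by name in the skeleton, so that this file waits
for no build): `hMono` (monotonicity of the chain mass, `stub_chainMassBasic`.1), `hUnion` (finite
union bound, `stub_chainMassUnion`), `hTuple` (the first moment for ONE time tuple,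
`stub_chaosTupleBound`: mass `≤ (1 − (E_Δ/2)^k)^m (n+1)^{2^j} e^{nβ}`, `E_Δ = 1 − (1−ε)^Δ`) and `hAsy`
(the real-analysis bookkeeping `stub_chaosAsymptotics`:
`(k+1)(K+1)^{k+1} (n+1)^{2^k} e^{nβ} (1 − (E/2)^k)^{⌊α_k n⌋} ≤ e^{−cn}` eventually, for
`E ≥ E_b = 1 − e^{−1/(bk)}`).

The proof (Huang–Sellke 2025, arXiv:2501.06427 §3.3.2, proof of Lemma 3.23; Bresler–Huang 2021 §4.6):
at one large `n` (where `D n < n`, so `0 < ε = log(n / D n)/n ≤ 1`),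
* reindex the CHAOS event by the finitely many pairs (`j' : Fin k`, time tuple
  `τ' : Fin (k+1) → Fin (K+1)`), `j = j' + 1`, `τ ℓ = τ' (ℓ mod (k+1))` (`cas_incl`), so that
  `mass(CHAOS) ≤ Σ_{j', τ'} mass(C_{j,τ})` (`hMono`, `hUnion` twice);
* bound each reindexed event (`cas_pair_bound`): if its deterministic side conditions (monotone
  times, gap `τ j ≥ τ (j−1) + 1/(bkε)`) fail it is empty (mass `0`, `cas_mass_false`); otherwise
  `hTuple` with `s = τ (j−1)`, `Δ = τ j − s` applies, and `εΔ ≥ 1/(bk)` gives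
  `(1−ε)^Δ ≤ e^{−εΔ} ≤ e^{−1/(bk)}` (`cas_pow_le_exp`), i.e. `E_b ≤ E_Δ`, whence
  `(1 − (E_Δ/2)^k)^m ≤ (1 − (E_b/2)^k)^m` (`cas_antitone`) and `(n+1)^{2^j} ≤ (n+1)^{2^k}`;
* sum: `k (K+1)^{k+1}` pairs (`cas_core`), `≤ (k+1)(K+1)^{k+1} · Q ≤ e^{−cn}` by `hAsy` at
  `E = E_b`.

References: B. Huang, M. Sellke, *Strong low degree hardness for stable local optima in spin
glasses*, arXiv:2501.06427 (2025), §3.3.2, Lemma 3.23 [HuangSellke2025]; G. Bresler, B. Huang,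
FOCS 2021 / arXiv:2106.02129, §4.6 [BreslerHuang2022].

(Verbatim declaration-level port — the declarations listed in the Part header count — of the Summits-side module of the PneNP
tree (route OverlapGapAlgebra, crux SearchHardWindow / NoStableSection); route / stub / lead bookkeeping in the text above is historical.)
-/

section Part4

namespace Literature.Computability.Complexity.HuangSellke2025Chain

open _root_.Finset _root_.Filter _root_.Asymptotics _root_.Topology
open Literature.Computability.Complexity
open scoped _root_.Classical

/-! ## Small real-analysis helpers -/

/-- Eventually `D n < n` for `D = o(n)`.
[cite: HuangSellke2025, §3.3.2 (Lemma 3.22, resampling-chain bookkeeping of the in-tree proof)] -/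
theorem cas_eventually_lt (D : ℕ → ℕ)
    (hD : (fun n : ℕ => (D n : ℝ)) =o[atTop] (fun n : ℕ => (n : ℝ))) :
    ∀ᶠ n : ℕ in atTop, (D n : ℝ) < n := by
  have hx : Tendsto (fun n : ℕ => (D n : ℝ) / n) atTop (𝓝 0) := hD.tendsto_div_nhds_zero
  filter_upwards [(tendsto_order.1 hx).2 1 one_pos, eventually_gt_atTop 0] with n h1 hn0
  exact (div_lt_one (Nat.cast_pos.2 hn0)).1 h1

/-- The resampling rate `ε = log(n / D)/n` lies in `(0, 1]` once `1 ≤ D < n`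
(`log y > 0` for `y > 1`, and `log y ≤ y - 1 < y ≤ n` for `y = n / D`).
[cite: HuangSellke2025, §3.3.2 (Lemma 3.22, resampling-chain bookkeeping of the in-tree proof)] -/
theorem cas_eps_bounds (n D : ℕ) (hDn : (D : ℝ) < n) (hD : 1 ≤ D) :
    0 < Real.log (n / D) / n ∧ Real.log (n / D) / n ≤ 1 := by
  have hD' : (1 : ℝ) ≤ D := by exact_mod_cast hD
  have hD0 : (0 : ℝ) < D := by linarith
  have hn' : (0 : ℝ) < n := hD0.trans hDn
  refine ⟨div_pos (Real.log_pos ((one_lt_div hD0).2 hDn)) hn', ?_⟩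
  have h1 : (n : ℝ) / D ≤ n := div_le_self hn'.le hD'
  have h2 : Real.log (n / D) ≤ (n : ℝ) / D - 1 := Real.log_le_sub_one_of_pos (div_pos hn' hD0)
  rw [div_le_one hn']
  linarith

/-- `(1 − ε)^Δ ≤ e^{−r}` whenever `0 ≤ ε ≤ 1` and `r ≤ ε Δ` (`1 − ε ≤ e^{−ε}`).
[cite: HuangSellke2025, §3.3.2 (Lemma 3.22, resampling-chain bookkeeping of the in-tree proof)] -/
theorem cas_pow_le_exp (ε r : ℝ) (hε0 : 0 ≤ ε) (hε1 : ε ≤ 1) (Δ : ℕ) (h : r ≤ ε * Δ) :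
    (1 - ε) ^ Δ ≤ Real.exp (-r) := by
  have h1 : (1 - ε) ^ Δ ≤ Real.exp (-ε) ^ Δ :=
    pow_le_pow_left₀ (by linarith) (by linarith [Real.add_one_le_exp (-ε)]) Δ
  refine h1.trans ?_
  rw [← Real.exp_nat_mul, Real.exp_le_exp]
  have := hε0
  nlinarith

/-- `0 ≤ 1 − (E/2)^k` for `E ∈ [0, 1]`.
[cite: HuangSellke2025, §3.3.2 (Lemma 3.22, resampling-chain bookkeeping of the in-tree proof)] -/
theorem cas_base_nonneg (E : ℝ) (k : ℕ) (hE0 : 0 ≤ E) (hE1 : E ≤ 1) : 0 ≤ 1 - (E / 2) ^ k := by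
  have : (E / 2) ^ k ≤ 1 := pow_le_one₀ (by linarith) (by linarith)
  linarith

/-- `E ↦ (1 − (E/2)^k)^m` is antitone on `[0, 1]`.
[cite: HuangSellke2025, §3.3.2 (Lemma 3.22, resampling-chain bookkeeping of the in-tree proof)] -/
theorem cas_antitone (E E' : ℝ) (k m : ℕ) (hE0 : 0 ≤ E) (hEE' : E ≤ E') (hE'1 : E' ≤ 1) :
    (1 - (E' / 2) ^ k) ^ m ≤ (1 - (E / 2) ^ k) ^ m := by
  have h1 : (E / 2) ^ k ≤ (E' / 2) ^ k := pow_le_pow_left₀ (by linarith) (by linarith) k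
  exact pow_le_pow_left₀ (cas_base_nonneg E' k (by linarith) hE'1) (by linarith) m

/-! ## Combinatorial helpers: monotone prefixes, the empty event, the event of one pair, reindexing -/

/-- A sequence that is monotone step by step below `j` is bounded by its value at `j` there.
[cite: HuangSellke2025, §3.3.2 (Lemma 3.22, resampling-chain bookkeeping of the in-tree proof)] -/
theorem cas_mono_prefix (τ : ℕ → ℕ) :
    ∀ j : ℕ, (∀ ℓ < j, τ ℓ ≤ τ (ℓ + 1)) → ∀ ℓ ≤ j, τ ℓ ≤ τ j := by
  intro j
  induction j with
  | zero =>
    intro _ ℓ hℓ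
    rw [Nat.le_zero.1 hℓ]
  | succ j ih =>
    intro h ℓ hℓ
    rcases Nat.lt_or_eq_of_le hℓ with hlt | rfl
    · exact (ih (fun ℓ' hℓ' => h ℓ' (Nat.lt_succ_of_lt hℓ')) ℓ (Nat.lt_succ_iff.1 hlt)).trans
        (h j (Nat.lt_succ_self j))
    · exact le_rfl

/-- The empty event has chain mass `0`.
[cite: HuangSellke2025, §3.3.2 (Lemma 3.22, resampling-chain bookkeeping of the in-tree proof)] -/
theorem cas_mass_false {ι Γ : Type*} [Fintype ι] [DecidableEq ι] [Fintype Γ] [DecidableEq Γ]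
    (ε : ℝ) (K : ℕ) : resampleChainMass ε K (fun _ : ℕ → ι → Γ => False) = 0 := by
  simp [resampleChainMass]

/-- **The chaos event of ONE pair** (`j`, time map `τ`) — the deterministic side conditions
(`τ 0 ≤ ⋯ ≤ τ j`, gap `τ j ≥ τ (j−1) + 1/(bkε)`) and an assignment `x` satisfying the instance at
time `τ j` with conditional overlap entropy `≤ β` given the outputs `a` at the earlier times — holds
along `τ` as soon as its data are given along a time map `t` agreeing with `τ` on `ℓ ≤ j`.
[cite: HuangSellke2025, §3.3.2 (Lemma 3.22, resampling-chain bookkeeping of the in-tree proof)] -/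
theorem cas_event_intro (n m k : ℕ) (b ε β : ℝ)
    (a : (Fin m × Fin k → Fin n × Bool) → (Fin n → Bool)) (j : ℕ) (τ t : ℕ → ℕ)
    (hτt : ∀ ℓ ≤ j, τ ℓ = t ℓ) (z : ℕ → (Fin m × Fin k → Fin n × Bool)) (x : Fin n → Bool)
    (hmono : ∀ ℓ < j, t ℓ ≤ t (ℓ + 1)) (hgap : (t (j - 1) : ℝ) + 1 / (b * k * ε) ≤ t j)
    (hsat : ∀ i : Fin m, ∃ j' : Fin k, x (z (t j) (i, j')).1 = (z (t j) (i, j')).2)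
    (hent : overlapCondEnt (fun ℓ => if ℓ < j then a (z (t ℓ)) else x) j ≤ β) :
    (∀ ℓ < j, τ ℓ ≤ τ (ℓ + 1)) ∧ ((τ (j - 1) : ℝ) + 1 / (b * k * ε) ≤ τ j) ∧
      ∃ x : Fin n → Bool,
        (∀ i : Fin m, ∃ j' : Fin k, x (z (τ j) (i, j')).1 = (z (τ j) (i, j')).2) ∧
        overlapCondEnt (fun ℓ => if ℓ < j then a (z (τ ℓ)) else x) j ≤ β := by
  have hj : τ j = t j := hτt j le_rfl
  refine ⟨fun ℓ hℓ => ?_, ?_, x, ?_, ?_⟩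
  · rw [hτt ℓ hℓ.le, hτt (ℓ + 1) (Nat.succ_le_of_lt hℓ)]
    exact hmono ℓ hℓ
  · rw [hτt (j - 1) (Nat.sub_le j 1), hj]
    exact hgap
  · rw [hj]
    exact hsat
  · have hce : overlapCondEnt (fun ℓ => if ℓ < j then a (z (τ ℓ)) else x) j =
        overlapCondEnt (fun ℓ => if ℓ < j then a (z (t ℓ)) else x) j := by
      congr 1
      funext ℓ
      by_cases hℓ : ℓ < j
      · simp only [if_pos hℓ, hτt ℓ hℓ.le]
      · simp only [if_neg hℓ]
    exact hce.trans_le hent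

/-- **Reindexing**: a path carrying a CHAOS structure (`1 ≤ j ≤ k`, times `t 0 ≤ ⋯ ≤ t j ≤ K` with the
gap, a satisfying low-entropy `x`) carries the chaos event of the pair
`p = (j − 1 : Fin k, i ↦ t (min i j) : Fin (k+1) → Fin (K+1))`, read with `j = p.1 + 1` and the time
map `ℓ ↦ p.2 (ℓ mod (k+1))` (which is `t ℓ` for `ℓ ≤ j`).
[cite: HuangSellke2025, §3.3.2 (Lemma 3.22, resampling-chain bookkeeping of the in-tree proof)] -/
theorem cas_incl (n m k K : ℕ) (b ε β : ℝ)
    (a : (Fin m × Fin k → Fin n × Bool) → (Fin n → Bool))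
    (z : ℕ → (Fin m × Fin k → Fin n × Bool))
    (hz : ∃ (j : ℕ) (t : ℕ → ℕ) (x : Fin n → Bool), 1 ≤ j ∧ j ≤ k ∧
        (∀ ℓ < j, t ℓ ≤ t (ℓ + 1)) ∧ t j ≤ K ∧ (t (j - 1) : ℝ) + 1 / (b * k * ε) ≤ t j ∧
        (∀ i : Fin m, ∃ j' : Fin k, x (z (t j) (i, j')).1 = (z (t j) (i, j')).2) ∧
        overlapCondEnt (fun ℓ => if ℓ < j then a (z (t ℓ)) else x) j ≤ β) :
    ∃ p : Fin k × (Fin (k + 1) → Fin (K + 1)),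
      (∀ ℓ < (p.1 : ℕ) + 1,
        (p.2 (Fin.ofNat (k + 1) ℓ) : ℕ) ≤ (p.2 (Fin.ofNat (k + 1) (ℓ + 1)) : ℕ)) ∧
      (((p.2 (Fin.ofNat (k + 1) ((p.1 : ℕ) + 1 - 1)) : ℕ) : ℝ) + 1 / (b * k * ε)
        ≤ (p.2 (Fin.ofNat (k + 1) ((p.1 : ℕ) + 1)) : ℕ)) ∧
      ∃ x : Fin n → Bool,
        (∀ i : Fin m, ∃ j' : Fin k,
          x (z (p.2 (Fin.ofNat (k + 1) ((p.1 : ℕ) + 1)) : ℕ) (i, j')).1 =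
            (z (p.2 (Fin.ofNat (k + 1) ((p.1 : ℕ) + 1)) : ℕ) (i, j')).2) ∧
        overlapCondEnt
          (fun ℓ => if ℓ < (p.1 : ℕ) + 1 then a (z (p.2 (Fin.ofNat (k + 1) ℓ) : ℕ)) else x)
          ((p.1 : ℕ) + 1) ≤ β := by
  obtain ⟨j, t, x, h1j, hjk, hmono, htK, hgap, hsat, hent⟩ := hz
  obtain ⟨j', rfl⟩ : ∃ j' : ℕ, j = j' + 1 := ⟨j - 1, (Nat.sub_add_cancel h1j).symm⟩
  have hpre : ∀ ℓ ≤ j' + 1, t ℓ ≤ t (j' + 1) := cas_mono_prefix t (j' + 1) hmono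
  have hbd : ∀ ℓ : ℕ, t (min ℓ (j' + 1)) < K + 1 := fun ℓ =>
    Nat.lt_succ_of_le ((hpre _ (Nat.min_le_right ℓ (j' + 1))).trans htK)
  refine ⟨(⟨j', hjk⟩, fun i => ⟨t (min (i : ℕ) (j' + 1)), hbd i⟩), ?_⟩
  refine cas_event_intro n m k b ε β a (j' + 1) (fun ℓ => t (min (ℓ % (k + 1)) (j' + 1))) t
    (fun ℓ hℓ => ?_) z x hmono hgap hsat hent
  rw [Nat.mod_eq_of_lt (by omega), min_eq_left hℓ]

/-! ## The bound for one pair, and the sum over pairs -/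

/-- **Mass of one reindexed event** `≤ Q = (1 − (E_b/2)^k)^m (n+1)^{2^k} e^{nβ}`,
`E_b = 1 − e^{−1/(bk)}`: empty if the side conditions fail; otherwise the per-tuple first moment
`hTuple` with `s = τ (j−1)`, `Δ = τ j − s`, and `E_b ≤ E_Δ = 1 − (1−ε)^Δ` from `εΔ ≥ 1/(bk)`.
[cite: HuangSellke2025, §3.3.2 (Lemma 3.22, resampling-chain bookkeeping of the in-tree proof)] -/
theorem cas_pair_bound
    (hMono : ∀ {ι Γ : Type} [Fintype ι] [DecidableEq ι] [Fintype Γ] [DecidableEq Γ] [Nonempty Γ]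
      (ε : ℝ), 0 ≤ ε → ε ≤ 1 → ∀ (K : ℕ) (E E' : (ℕ → ι → Γ) → Prop), (∀ z, E z → E' z) →
      resampleChainMass ε K E ≤ resampleChainMass ε K E')
    (hTuple : ∀ (n m k : ℕ), 1 ≤ n → ∀ (ε : ℝ), 0 ≤ ε → ε ≤ 1 → ∀ (K j s Δ : ℕ), 1 ≤ j →
      s + Δ ≤ K → ∀ (τ : ℕ → ℕ), (∀ ℓ < j, τ ℓ ≤ s) →
      ∀ (a : (Fin m × Fin k → Fin n × Bool) → (Fin n → Bool)) (β : ℝ),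
      resampleChainMass ε K (fun z : ℕ → (Fin m × Fin k → Fin n × Bool) =>
          ∃ x : Fin n → Bool,
            (∀ i : Fin m, ∃ j' : Fin k, x (z (s + Δ) (i, j')).1 = (z (s + Δ) (i, j')).2) ∧
            overlapCondEnt (fun ℓ => if ℓ < j then a (z (τ ℓ)) else x) j ≤ β)
        ≤ (1 - ((1 - (1 - ε) ^ Δ) / 2) ^ k) ^ m * (((n : ℝ) + 1) ^ (2 ^ j) * Real.exp (n * β)))
    (n m k K : ℕ) (hn : 1 ≤ n) (hk : 1 ≤ k) (ε b β : ℝ) (hε0 : 0 < ε) (hε1 : ε ≤ 1) (hb : 0 < b)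
    (a : (Fin m × Fin k → Fin n × Bool) → (Fin n → Bool)) (j : ℕ) (hj : 1 ≤ j) (hjk : j ≤ k)
    (τ : ℕ → ℕ) (hτK : ∀ ℓ, τ ℓ ≤ K) :
    resampleChainMass ε K (fun z : ℕ → (Fin m × Fin k → Fin n × Bool) =>
        (∀ ℓ < j, τ ℓ ≤ τ (ℓ + 1)) ∧ ((τ (j - 1) : ℝ) + 1 / (b * k * ε) ≤ τ j) ∧
          ∃ x : Fin n → Bool,
            (∀ i : Fin m, ∃ j' : Fin k, x (z (τ j) (i, j')).1 = (z (τ j) (i, j')).2) ∧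
            overlapCondEnt (fun ℓ => if ℓ < j then a (z (τ ℓ)) else x) j ≤ β) ≤
      (1 - ((1 - Real.exp (-(1 / (b * k)))) / 2) ^ k) ^ m *
        (((n : ℝ) + 1) ^ (2 ^ k) * Real.exp (n * β)) := by
  haveI : Nonempty (Fin n × Bool) := ⟨(⟨0, hn⟩, true)⟩
  have hk0 : (0 : ℝ) < k := Nat.cast_pos.2 hk
  have hEb0 : 0 ≤ 1 - Real.exp (-(1 / (b * k))) := by
    have h' : Real.exp (-(1 / (b * k))) ≤ 1 :=
      Real.exp_le_one_iff.2 (neg_nonpos.2 (by positivity))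
    linarith
  have hEb1 : 1 - Real.exp (-(1 / (b * k))) ≤ 1 := by
    linarith [Real.exp_pos (-(1 / (b * k)))]
  have hX : 0 ≤ (1 - ((1 - Real.exp (-(1 / (b * k)))) / 2) ^ k) ^ m :=
    pow_nonneg (cas_base_nonneg _ k hEb0 hEb1) m
  have hQ0 : 0 ≤ (1 - ((1 - Real.exp (-(1 / (b * k)))) / 2) ^ k) ^ m *
      (((n : ℝ) + 1) ^ (2 ^ k) * Real.exp (n * β)) := mul_nonneg hX (by positivity)
  by_cases hside : (∀ ℓ < j, τ ℓ ≤ τ (ℓ + 1)) ∧ ((τ (j - 1) : ℝ) + 1 / (b * k * ε) ≤ τ j)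
  · obtain ⟨hmn, hgap⟩ := hside
    have hle : τ (j - 1) ≤ τ j := by
      have h := hmn (j - 1) (by omega)
      rwa [Nat.sub_add_cancel hj] at h
    have hsΔ : τ (j - 1) + (τ j - τ (j - 1)) = τ j := by omega
    have hsK : τ (j - 1) + (τ j - τ (j - 1)) ≤ K := by
      have h := hτK j
      omega
    have hpre : ∀ ℓ < j, τ ℓ ≤ τ (j - 1) := fun ℓ hℓ =>
      cas_mono_prefix τ (j - 1) (fun ℓ' hℓ' => hmn ℓ' (by omega)) ℓ (by omega)
    -- the per-tuple first moment with `s = τ (j-1)`, `Δ = τ j - τ (j-1)`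
    have h1 := hTuple n m k hn ε hε0.le hε1 K j (τ (j - 1)) (τ j - τ (j - 1)) hj hsK τ hpre a β
    refine le_trans (hMono ε hε0.le hε1 K _ _ fun z hz => ?_) (h1.trans ?_)
    · -- drop the side conditions; the candidate time `s + Δ` is `τ j`
      obtain ⟨-, -, x, hsat, hent⟩ := hz
      refine ⟨x, ?_, hent⟩
      rw [hsΔ]
      exact hsat
    · -- `E_b ≤ E_Δ` from the gap, and `2 ^ j ≤ 2 ^ k`
      have hΔ : 1 / (b * k) ≤ ε * ((τ j - τ (j - 1) : ℕ) : ℝ) := by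
        rw [Nat.cast_sub hle]
        have hbkε : 0 < b * k * ε := by positivity
        have hg : 1 / (b * k * ε) ≤ (τ j : ℝ) - τ (j - 1) := by linarith
        calc 1 / (b * k) = ε * (1 / (b * k * ε)) := by field_simp
          _ ≤ ε * ((τ j : ℝ) - τ (j - 1)) := by gcongr
      have hEΔ : 1 - Real.exp (-(1 / (b * k))) ≤ 1 - (1 - ε) ^ (τ j - τ (j - 1)) := by
        linarith [cas_pow_le_exp ε (1 / (b * k)) hε0.le hε1 (τ j - τ (j - 1)) hΔ]
      have hEΔ1 : 1 - (1 - ε) ^ (τ j - τ (j - 1)) ≤ 1 := by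
        linarith [pow_nonneg (sub_nonneg.2 hε1) (τ j - τ (j - 1))]
      have hA := cas_antitone _ _ k m hEb0 hEΔ hEΔ1
      have hB : ((n : ℝ) + 1) ^ (2 ^ j) * Real.exp (n * β) ≤
          ((n : ℝ) + 1) ^ (2 ^ k) * Real.exp (n * β) :=
        mul_le_mul_of_nonneg_right
          (pow_le_pow_right₀ (by linarith [(Nat.cast_nonneg n : (0 : ℝ) ≤ n)])
            (pow_le_pow_right₀ (by norm_num) hjk))
          (Real.exp_pos _).le
      exact mul_le_mul hA hB (by positivity) hX
  · -- the side conditions fail: the event is empty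
    refine le_trans (hMono ε hε0.le hε1 K _
      (fun _ : ℕ → (Fin m × Fin k → Fin n × Bool) => False) fun z hz => ?_) ?_
    · obtain ⟨h1, h2, -⟩ := hz
      exact hside ⟨h1, h2⟩
    · rw [cas_mass_false]
      exact hQ0

/-- **The chaos first moment at one instance size**: `mass(CHAOS) ≤ k (K+1)^{k+1} · Q` — reindex by
the pairs (`cas_incl`, `hMono`), union bound (`hUnion`, twice), bound each pair (`cas_pair_bound`)
and count the `k (K+1)^{k+1}` pairs.
[cite: HuangSellke2025, §3.3.2 (Lemma 3.22, resampling-chain bookkeeping of the in-tree proof)] -/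
theorem cas_core
    (hMono : ∀ {ι Γ : Type} [Fintype ι] [DecidableEq ι] [Fintype Γ] [DecidableEq Γ] [Nonempty Γ]
      (ε : ℝ), 0 ≤ ε → ε ≤ 1 → ∀ (K : ℕ) (E E' : (ℕ → ι → Γ) → Prop), (∀ z, E z → E' z) →
      resampleChainMass ε K E ≤ resampleChainMass ε K E')
    (hUnion : ∀ {ι Γ X : Type} [Fintype ι] [DecidableEq ι] [Fintype Γ] [DecidableEq Γ] [Nonempty Γ]
      [Fintype X] (ε : ℝ), 0 ≤ ε → ε ≤ 1 → ∀ (K : ℕ) (E : X → (ℕ → ι → Γ) → Prop),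
      resampleChainMass ε K (fun z => ∃ x, E x z) ≤ ∑ x, resampleChainMass ε K (E x))
    (hTuple : ∀ (n m k : ℕ), 1 ≤ n → ∀ (ε : ℝ), 0 ≤ ε → ε ≤ 1 → ∀ (K j s Δ : ℕ), 1 ≤ j →
      s + Δ ≤ K → ∀ (τ : ℕ → ℕ), (∀ ℓ < j, τ ℓ ≤ s) →
      ∀ (a : (Fin m × Fin k → Fin n × Bool) → (Fin n → Bool)) (β : ℝ),
      resampleChainMass ε K (fun z : ℕ → (Fin m × Fin k → Fin n × Bool) =>
          ∃ x : Fin n → Bool,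
            (∀ i : Fin m, ∃ j' : Fin k, x (z (s + Δ) (i, j')).1 = (z (s + Δ) (i, j')).2) ∧
            overlapCondEnt (fun ℓ => if ℓ < j then a (z (τ ℓ)) else x) j ≤ β)
        ≤ (1 - ((1 - (1 - ε) ^ Δ) / 2) ^ k) ^ m * (((n : ℝ) + 1) ^ (2 ^ j) * Real.exp (n * β)))
    (n m k K : ℕ) (hn : 1 ≤ n) (hk : 1 ≤ k) (ε b β : ℝ) (hε0 : 0 < ε) (hε1 : ε ≤ 1) (hb : 0 < b)
    (a : (Fin m × Fin k → Fin n × Bool) → (Fin n → Bool)) :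
    resampleChainMass ε K (fun y : ℕ → (Fin m × Fin k → Fin n × Bool) =>
        ∃ (j : ℕ) (t : ℕ → ℕ) (x : Fin n → Bool), 1 ≤ j ∧ j ≤ k ∧
          (∀ ℓ < j, t ℓ ≤ t (ℓ + 1)) ∧ t j ≤ K ∧ (t (j - 1) : ℝ) + 1 / (b * k * ε) ≤ t j ∧
          (∀ i : Fin m, ∃ j' : Fin k, x (y (t j) (i, j')).1 = (y (t j) (i, j')).2) ∧
          overlapCondEnt (fun ℓ => if ℓ < j then a (y (t ℓ)) else x) j ≤ β)
      ≤ (k : ℝ) * ((K : ℝ) + 1) ^ (k + 1) *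
        ((1 - ((1 - Real.exp (-(1 / (b * k)))) / 2) ^ k) ^ m *
          (((n : ℝ) + 1) ^ (2 ^ k) * Real.exp (n * β))) := by
  haveI : Nonempty (Fin n × Bool) := ⟨(⟨0, hn⟩, true)⟩
  -- the bound for every pair `p = (j - 1, time tuple)`, time map `ℓ ↦ p.2 (ℓ mod (k+1))`
  have h3 := fun p : Fin k × (Fin (k + 1) → Fin (K + 1)) =>
    cas_pair_bound hMono hTuple n m k K hn hk ε b β hε0 hε1 hb a ((p.1 : ℕ) + 1)
      (Nat.le_add_left 1 _) p.1.isLt (fun ℓ => (p.2 (Fin.ofNat (k + 1) ℓ) : ℕ))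
      (fun ℓ => Nat.le_of_lt_succ (p.2 (Fin.ofNat (k + 1) ℓ)).isLt)
  -- union bound over the pairs, then the per-pair bound
  have h23 := (hUnion ε hε0.le hε1 K _).trans (Finset.sum_le_sum fun p _ => h3 p)
  -- reindexing, and the count of the pairs
  refine (hMono ε hε0.le hε1 K _ _ fun z hz => cas_incl n m k K b ε β a z hz).trans
    (h23.trans (le_of_eq ?_))
  simp only [Finset.sum_const, Finset.card_univ, Fintype.card_prod, Fintype.card_fun,
    Fintype.card_fin, nsmul_eq_mul]
  push_cast
  ring

/-! ## The stub -/

/-- **The chaos lemma (Huang–Sellke 2025, Lemma 3.23) as a THEOREM** (stub `stub_chaosAssembly` of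
line `Sketch`), for every `k ≥ 2` and `β < 5 log k / k`: with `b₁` and, for `0 < b ≤ b₁` and every
exponent `A`, the rate `c` of the asymptotics `hAsy`, eventually in `n` — `m = ⌊5·2^k log k/k · n⌋`,
`ε = log(n / D n)/n ∈ (0, 1]` (as `1 ≤ D n < n` eventually, `D = o(n)`), every chain length
`K ≤ n^A` — the CHAOS event has mass `≤ k (K+1)^{k+1} (1 − (E_b/2)^k)^m (n+1)^{2^k} e^{nβ}`
(`cas_core`: reindexing, `hMono`, `hUnion`, `hTuple`) `≤ e^{−cn}` (`hAsy` at `E = E_b`).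
[cite: HuangSellke2025, §3.3.2 (Lemma 3.22, resampling-chain bookkeeping of the in-tree proof)] -/
theorem stub_chaosAssembly
    (hMono : ∀ {ι Γ : Type} [Fintype ι] [DecidableEq ι] [Fintype Γ] [DecidableEq Γ] [Nonempty Γ]
      (ε : ℝ), 0 ≤ ε → ε ≤ 1 → ∀ (K : ℕ) (E E' : (ℕ → ι → Γ) → Prop), (∀ z, E z → E' z) →
      resampleChainMass ε K E ≤ resampleChainMass ε K E')
    (hUnion : ∀ {ι Γ X : Type} [Fintype ι] [DecidableEq ι] [Fintype Γ] [DecidableEq Γ] [Nonempty Γ]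
      [Fintype X] (ε : ℝ), 0 ≤ ε → ε ≤ 1 → ∀ (K : ℕ) (E : X → (ℕ → ι → Γ) → Prop),
      resampleChainMass ε K (fun z => ∃ x, E x z) ≤ ∑ x, resampleChainMass ε K (E x))
    (hTuple : ∀ (n m k : ℕ), 1 ≤ n → ∀ (ε : ℝ), 0 ≤ ε → ε ≤ 1 → ∀ (K j s Δ : ℕ), 1 ≤ j →
      s + Δ ≤ K → ∀ (τ : ℕ → ℕ), (∀ ℓ < j, τ ℓ ≤ s) →
      ∀ (a : (Fin m × Fin k → Fin n × Bool) → (Fin n → Bool)) (β : ℝ),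
      resampleChainMass ε K (fun z : ℕ → (Fin m × Fin k → Fin n × Bool) =>
          ∃ x : Fin n → Bool,
            (∀ i : Fin m, ∃ j' : Fin k, x (z (s + Δ) (i, j')).1 = (z (s + Δ) (i, j')).2) ∧
            overlapCondEnt (fun ℓ => if ℓ < j then a (z (τ ℓ)) else x) j ≤ β)
        ≤ (1 - ((1 - (1 - ε) ^ Δ) / 2) ^ k) ^ m * (((n : ℝ) + 1) ^ (2 ^ j) * Real.exp (n * β)))
    (hAsy : ∀ (k : ℕ), 2 ≤ k → ∀ (β : ℝ), β < 5 * Real.log k / k →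
      ∃ b₁ : ℝ, 0 < b₁ ∧ ∀ b : ℝ, 0 < b → b ≤ b₁ → ∀ A : ℕ, ∃ c : ℝ, 0 < c ∧
        ∀ᶠ n : ℕ in atTop, ∀ K : ℕ, K ≤ n ^ A → ∀ E : ℝ, 1 - Real.exp (-(1 / (b * k))) ≤ E →
          E ≤ 1 →
          ((k : ℝ) + 1) * ((K : ℝ) + 1) ^ (k + 1) *
              ((((n : ℝ) + 1) ^ (2 ^ k)) * Real.exp (n * β)) *
              (1 - (E / 2) ^ k) ^ ⌊5 * 2 ^ k * Real.log k / k * n⌋₊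
            ≤ Real.exp (-(c * n))) :
    ∀ k : ℕ, 2 ≤ k → ∀ β : ℝ, β < 5 * Real.log k / k →
    ∃ b₁ : ℝ, 0 < b₁ ∧ ∀ b : ℝ, 0 < b → b ≤ b₁ → ∀ D : ℕ → ℕ,
      (fun n : ℕ => (D n : ℝ)) =o[atTop] (fun n : ℕ => (n : ℝ)) → (∀ n, 1 ≤ D n) →
      ∀ (a : (n m : ℕ) → (Fin m × Fin k → Fin n × Bool) → (Fin n → Bool)) (A : ℕ),
      ∃ c : ℝ, 0 < c ∧ ∀ᶠ n : ℕ in atTop, ∀ m : ℕ, m = ⌊5 * 2 ^ k * Real.log k / k * n⌋₊ →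
        ∀ ε : ℝ, ε = Real.log (n / D n) / n → ∀ K : ℕ, K ≤ n ^ A →
        resampleChainMass ε K (fun y : ℕ → (Fin m × Fin k → Fin n × Bool) =>
            ∃ (j : ℕ) (t : ℕ → ℕ) (x : Fin n → Bool), 1 ≤ j ∧ j ≤ k ∧
              (∀ ℓ < j, t ℓ ≤ t (ℓ + 1)) ∧ t j ≤ K ∧ (t (j - 1) : ℝ) + 1 / (b * k * ε) ≤ t j ∧
              (∀ i : Fin m, ∃ j' : Fin k, x (y (t j) (i, j')).1 = (y (t j) (i, j')).2) ∧
              overlapCondEnt (fun ℓ => if ℓ < j then a n m (y (t ℓ)) else x) j ≤ β)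
          ≤ Real.exp (-(c * n)) := by
  intro k hk β hβ
  obtain ⟨b₁, hb₁, hasy⟩ := hAsy k hk β hβ
  refine ⟨b₁, hb₁, fun b hb hbb₁ D hD hD1 a A => ?_⟩
  obtain ⟨c, hc, hev⟩ := hasy b hb hbb₁ A
  refine ⟨c, hc, ?_⟩
  filter_upwards [hev, cas_eventually_lt D hD, eventually_ge_atTop 1] with n hevn hDn hn1
  intro m hm ε hε K hK
  have hk1 : 1 ≤ k := le_trans one_le_two hk
  have hk0 : (0 : ℝ) < k := Nat.cast_pos.2 hk1
  obtain ⟨hεpos, hε1⟩ : 0 < ε ∧ ε ≤ 1 := by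
    rw [hε]
    exact cas_eps_bounds n (D n) hDn (hD1 n)
  have hEb0 : 0 ≤ 1 - Real.exp (-(1 / (b * k))) := by
    have h' : Real.exp (-(1 / (b * k))) ≤ 1 :=
      Real.exp_le_one_iff.2 (neg_nonpos.2 (by positivity))
    linarith
  have hEb1 : 1 - Real.exp (-(1 / (b * k))) ≤ 1 := by
    linarith [Real.exp_pos (-(1 / (b * k)))]
  have hfin := hevn K hK (1 - Real.exp (-(1 / (b * k)))) le_rfl hEb1
  rw [← hm] at hfin
  refine (cas_core hMono hUnion hTuple n m k K hn1 hk1 ε b β hεpos hε1 hb (a n m)).trans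
    (le_trans ?_ hfin)
  have hP : (0 : ℝ) ≤ ((K : ℝ) + 1) ^ (k + 1) := by positivity
  have hX : 0 ≤ (1 - ((1 - Real.exp (-(1 / (b * k)))) / 2) ^ k) ^ m :=
    pow_nonneg (cas_base_nonneg _ k hEb0 hEb1) m
  have hY : (0 : ℝ) ≤ ((n : ℝ) + 1) ^ (2 ^ k) * Real.exp (n * β) := by positivity
  nlinarith [mul_nonneg (mul_nonneg hP hY) hX]

end Literature.Computability.Complexity.HuangSellke2025Chain

end Part4

/-!
## Part 5 — port of `Summits/PneNP/PneNP/Theorems/OverlapGapAlgebraSearchHardWindowResampleKernelBasic.lean` (3 declarations kept)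

# Route OverlapGapAlgebra, crux `SearchHardWindow` : basic properties of the
# `ε`-resampling kernel

On a finite product space `ι → Γ` the `ε`-resampling ("noise") Markov kernel keeps each coordinate
with probability `1 − ε` and resamples it uniformly from `Γ` with probability `ε`, independently over
the coordinates (O'Donnell 2014, Def. 8.26; Huang–Sellke 2025 §3.3, "`p`-correlated copy,
`p = 1 − ε`"). Its transition weights are the explicit product
`P_ε(y, y') = ∏_i ((1 − ε)·[y i = y' i] + ε/|Γ|)`.

`stub_resampleKernelBasic` records, for `0 ≤ ε ≤ 1`, that this kernel is
(a) nonnegative (each factor is `(1 − ε)·{0,1} + ε/|Γ| ≥ 0`, `Finset.prod_nonneg`),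
(b) symmetric (`y i = y' i ↔ y' i = y i` factorwise), and
(c) stochastic: `∑_{y'} P_ε(y, y') = ∏_i ∑_{c : Γ} ((1 − ε)·[y i = c] + ε/|Γ|) = ∏_i 1 = 1`
(`Fintype.prod_sum` read right to left, then `(1 − ε)·1 + |Γ|·(ε/|Γ|) = 1` in each coordinate).
These three facts feed the abstract grand-correlation inequality of line `Sketch`.

(Verbatim declaration-level port — the declarations listed in the Part header count — of the Summits-side module of the PneNP
tree (route OverlapGapAlgebra, crux SearchHardWindow / NoStableSection); route / stub / lead bookkeeping in the text above is historical.)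
-/

section Part5

namespace Literature.Computability.Complexity.HuangSellke2025Chain

open _root_.Finset

/-- One coordinate of the resampling kernel is a probability vector:
`∑_{c : Γ} ((1 − ε)·[a = c] + ε/|Γ|) = 1`.
[cite: HuangSellke2025, §3.3.2 (Lemma 3.22, resampling-chain bookkeeping of the in-tree proof)] -/
theorem rsk_coord_sum_eq_one {Γ : Type*} [Fintype Γ] [DecidableEq Γ] [Nonempty Γ] (ε : ℝ)
    (a : Γ) : ∑ c : Γ, ((1 - ε) * (if a = c then (1 : ℝ) else 0) + ε / Fintype.card Γ) = 1 := by
  have hcard : (Fintype.card Γ : ℝ) ≠ 0 := by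
    exact_mod_cast (Fintype.card_pos (α := Γ)).ne'
  rw [Finset.sum_add_distrib, ← Finset.mul_sum, Finset.sum_ite_eq, if_pos (Finset.mem_univ a),
    Finset.sum_const, Finset.card_univ, nsmul_eq_mul, mul_div_cancel₀ _ hcard]
  ring

/-- One factor of the resampling kernel is nonnegative for `0 ≤ ε ≤ 1`.
[cite: HuangSellke2025, §3.3.2 (Lemma 3.22, resampling-chain bookkeeping of the in-tree proof)] -/
theorem rsk_factor_nonneg {Γ : Type*} [Fintype Γ] [DecidableEq Γ] (ε : ℝ) (hε0 : 0 ≤ ε)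
    (hε1 : ε ≤ 1) (a b : Γ) :
    0 ≤ (1 - ε) * (if a = b then (1 : ℝ) else 0) + ε / Fintype.card Γ := by
  have h1 : 0 ≤ (1 - ε) * (if a = b then (1 : ℝ) else 0) :=
    mul_nonneg (sub_nonneg.mpr hε1) (by split_ifs <;> norm_num)
  have h2 : 0 ≤ ε / Fintype.card Γ := div_nonneg hε0 (Nat.cast_nonneg _)
  exact add_nonneg h1 h2

/-- **Basic properties of the `ε`-resampling kernel** on the finite product space `ι → Γ`
(O'Donnell 2014 Def. 8.26; Huang–Sellke 2025 §3.3): for `0 ≤ ε ≤ 1` the weights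
`P_ε(y, y') = ∏_i ((1 − ε)·[y i = y' i] + ε/|Γ|)` are (a) nonnegative, (b) symmetric in `(y, y')`,
and (c) stochastic, `∑_{y'} P_ε(y, y') = 1`.
[cite: HuangSellke2025, §3.3.2 (Lemma 3.22, resampling-chain bookkeeping of the in-tree proof)] -/
theorem stub_resampleKernelBasic {ι Γ : Type*} [Fintype ι] [DecidableEq ι] [Fintype Γ]
    [DecidableEq Γ] [Nonempty Γ] (ε : ℝ) (hε0 : 0 ≤ ε) (hε1 : ε ≤ 1) :
    (∀ y y' : ι → Γ,
        0 ≤ ∏ i, ((1 - ε) * (if y i = y' i then (1 : ℝ) else 0) + ε / Fintype.card Γ)) ∧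
    (∀ y y' : ι → Γ,
        (∏ i, ((1 - ε) * (if y i = y' i then (1 : ℝ) else 0) + ε / Fintype.card Γ)) =
          ∏ i, ((1 - ε) * (if y' i = y i then (1 : ℝ) else 0) + ε / Fintype.card Γ)) ∧
    (∀ y : ι → Γ,
        ∑ y' : ι → Γ, ∏ i, ((1 - ε) * (if y i = y' i then (1 : ℝ) else 0) + ε / Fintype.card Γ)
          = 1) := by
  refine ⟨fun y y' => ?_, fun y y' => ?_, fun y => ?_⟩
  · exact Finset.prod_nonneg fun i _ => rsk_factor_nonneg ε hε0 hε1 (y i) (y' i)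
  · refine Finset.prod_congr rfl fun i _ => ?_
    simp only [eq_comm]
  · rw [← Fintype.prod_sum (fun i (c : Γ) =>
      (1 - ε) * (if y i = c then (1 : ℝ) else 0) + ε / Fintype.card Γ)]
    exact Finset.prod_eq_one fun i _ => rsk_coord_sum_eq_one ε (y i)

end Literature.Computability.Complexity.HuangSellke2025Chain

end Part5

/-!
## Part 6 — port of `Summits/PneNP/PneNP/Theorems/OverlapGapAlgebraSearchHardWindowKernelSemigroup.lean` (2 declarations kept)

# Route OverlapGapAlgebra, crux `SearchHardWindow` : semigroup identity of the
# `ε`-resampling kernel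

On a finite product space `ι → Γ` (uniform measure on `Γ`) the `ε`-resampling kernel
`P_ε(y, y') = ∏_i ((1 − ε)·[y i = y' i] + ε/|Γ|)` (`resampleKernel` of
`Literature/Computability/Complexity/RandomKSatEnsembleOGP.lean`; O'Donnell 2014 Def. 8.26,
Huang–Sellke 2025 §3.3) satisfies the Chapman–Kolmogorov / semigroup identity
`Σ_{y''} P_ε(y, y'') · P_ε'(y'', y') = P_{1 − (1−ε)(1−ε')}(y, y')`
(O'Donnell 2014 §8.1: `T_ρ T_ρ' = T_{ρ ρ'}` with `ρ = 1 − ε`). The identity is purely algebraic —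
no sign or size constraint on `ε, ε'`.

Proof (`stub_kernelSemigroup`): the summand is the coordinatewise product
`∏_i f_i(y'' i)` with `f_i(c) = ((1−ε)[y i = c] + ε/q)·((1−ε')[c = y' i] + ε'/q)`, `q = |Γ|`
(`Finset.prod_mul_distrib`), so the sum over `y''` factors as `∏_i Σ_c f_i(c)`
(`Fintype.prod_sum`); and in one coordinate (`ksg_coord_sum`)
`Σ_c ((1−ε)[a = c] + ε/q)((1−ε')[c = b] + ε'/q) = (1−ε)(1−ε')[a = b] + (ε + ε' − εε')/q`,
because `Σ_c [a = c][c = b] = [a = b]`, `Σ_c [a = c] = Σ_c [c = b] = 1`, `Σ_c 1/q² = 1/q`, and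
`(1−ε)ε' + ε(1−ε') + εε' = ε + ε' − εε' = 1 − (1−ε)(1−ε')`.

(Verbatim declaration-level port — the declarations listed in the Part header count — of the Summits-side module of the PneNP
tree (route OverlapGapAlgebra, crux SearchHardWindow / NoStableSection); route / stub / lead bookkeeping in the text above is historical.)
-/

section Part6

namespace Literature.Computability.Complexity.HuangSellke2025Chain

open _root_.Finset
open Literature.Computability.Complexity
open scoped _root_.Classical

/-- One coordinate of the semigroup identity of the resampling kernel (`q = |Γ| > 0`):
`Σ_{c : Γ} ((1 − ε)·[a = c] + ε/q)·((1 − ε')·[c = b] + ε'/q)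
  = (1 − (1 − (1−ε)(1−ε')))·[a = b] + (1 − (1−ε)(1−ε'))/q`.
[cite: HuangSellke2025, §3.3.2 (Lemma 3.22, resampling-chain bookkeeping of the in-tree proof)] -/
theorem ksg_coord_sum {Γ : Type*} [Fintype Γ] [DecidableEq Γ] [Nonempty Γ] (ε ε' : ℝ)
    (a b : Γ) :
    ∑ c : Γ, ((1 - ε) * (if a = c then (1 : ℝ) else 0) + ε / Fintype.card Γ) *
        ((1 - ε') * (if c = b then (1 : ℝ) else 0) + ε' / Fintype.card Γ) =
      (1 - (1 - (1 - ε) * (1 - ε'))) * (if a = b then (1 : ℝ) else 0) +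
        (1 - (1 - ε) * (1 - ε')) / Fintype.card Γ := by
  have hcard : (Fintype.card Γ : ℝ) ≠ 0 := by
    exact_mod_cast (Fintype.card_pos (α := Γ)).ne'
  simp only [add_mul, mul_add, Finset.sum_add_distrib]
  simp only [mul_ite, mul_one, mul_zero, ite_mul, zero_mul, Finset.sum_ite_eq, Finset.sum_ite_eq',
    Finset.mem_univ, if_true, Finset.sum_const, Finset.card_univ, nsmul_eq_mul]
  split_ifs <;> field_simp <;> ring

/-- **Semigroup (Chapman–Kolmogorov) identity of the `ε`-resampling kernel** on the finite product
space `ι → Γ` (O'Donnell 2014 §8.1, `T_ρ T_ρ' = T_{ρρ'}`, `ρ = 1 − ε`; the Markov property of the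
resampling chain of Huang–Sellke 2025 §3.3.2):
`Σ_{y''} P_ε(y, y'') · P_ε'(y'', y') = P_{1 − (1−ε)(1−ε')}(y, y')`, for all real `ε, ε'`.
[cite: HuangSellke2025, §3.3.2 (Lemma 3.22, resampling-chain bookkeeping of the in-tree proof)] -/
theorem stub_kernelSemigroup {ι Γ : Type*} [Fintype ι] [DecidableEq ι] [Fintype Γ] [DecidableEq Γ]
    [Nonempty Γ] (ε ε' : ℝ) (y y' : ι → Γ) :
    ∑ y'' : ι → Γ, resampleKernel ε y y'' * resampleKernel ε' y'' y' =
      resampleKernel (1 - (1 - ε) * (1 - ε')) y y' := by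
  have hmul : ∀ y'' : ι → Γ, resampleKernel ε y y'' * resampleKernel ε' y'' y' =
      ∏ i, (((1 - ε) * (if y i = y'' i then (1 : ℝ) else 0) + ε / Fintype.card Γ) *
        ((1 - ε') * (if y'' i = y' i then (1 : ℝ) else 0) + ε' / Fintype.card Γ)) := by
    intro y''
    unfold resampleKernel
    rw [← Finset.prod_mul_distrib]
  simp_rw [hmul]
  rw [← Fintype.prod_sum (fun i (c : Γ) =>
      ((1 - ε) * (if y i = c then (1 : ℝ) else 0) + ε / Fintype.card Γ) *
        ((1 - ε') * (if c = y' i then (1 : ℝ) else 0) + ε' / Fintype.card Γ))]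
  unfold resampleKernel
  exact Finset.prod_congr rfl fun i _ => ksg_coord_sum ε ε' (y i) (y' i)

end Literature.Computability.Complexity.HuangSellke2025Chain

end Part6

/-!
## Part 7 — port of `Summits/PneNP/PneNP/Theorems/OverlapGapAlgebraSearchHardWindowKernelPowPaths.lean` (3 declarations kept)

# Route OverlapGapAlgebra, crux `SearchHardWindow` : the `Δ`-step transition
# kernel of the resampling chain

For the `ε`-resampling Markov kernel `P_ε(y, y') = ∏_i ((1 − ε)·[y i = y' i] + ε/|Γ|)` on a finite
product space `ι → Γ` (vocabulary `resampleKernel` of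
`Literature/Computability/Complexity/RandomKSatEnsembleOGP.lean`; O'Donnell 2014 Def. 8.26,
Huang–Sellke 2025 §3.3) the `Δ`-step transition weights are again a resampling kernel:
the total weight of the length-`Δ` paths `y : Fin (Δ+1) → ι → Γ` from `w` to `y'`,
`Σ_y [y 0 = w] [y Δ = y'] ∏_{t<Δ} P_ε(y t, y (t+1))`, equals `P_{1 − (1−ε)^Δ}(w, y')`
(`stub_kernelPowPaths`; in operator language `T_ρ ^ Δ = T_{ρ^Δ}`, `ρ = 1 − ε`). This closed form of
the `Δ`-step kernel is what the Markov-property bookkeeping of the chaos lemma (Huang–Sellke 2025,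
Lemma 3.23) in line `Sketch` consumes.

Proof: induction on `Δ`, given the one-step composition identity
`Σ_{y''} P_ε(y, y'') P_{ε'}(y'', y') = P_{1 − (1−ε)(1−ε')}(y, y')` as a hypothesis. At `Δ = 0` both
sides are the identity kernel `[w = y']` (`kpp_resampleKernel_zero`). For `Δ + 1`, split a path into
its first point and the remaining length-`Δ` path (`Fin.consEquiv`, `Fin.prod_univ_succ`), insert the
intermediate point `y'' = y 1` as a summation variable, apply the induction hypothesis to the paths
from `y''` to `y'`, and compose: `1 − (1 − ε)·(1 − (1 − (1−ε)^Δ)) = 1 − (1−ε)^{Δ+1}`.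

(Verbatim declaration-level port — the declarations listed in the Part header count — of the Summits-side module of the PneNP
tree (route OverlapGapAlgebra, crux SearchHardWindow / NoStableSection); route / stub / lead bookkeeping in the text above is historical.)
-/

section Part7

namespace Literature.Computability.Complexity.HuangSellke2025Chain

open _root_.Finset
open Literature.Computability.Complexity
open scoped _root_.Classical

/-- At `ε = 0` the resampling kernel is the identity kernel: `P_0(w, y') = [w = y']`.
[cite: HuangSellke2025, §3.3.2 (Lemma 3.22, resampling-chain bookkeeping of the in-tree proof)] -/
theorem kpp_resampleKernel_zero {ι Γ : Type*} [Fintype ι] [Fintype Γ] [DecidableEq Γ]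
    (w y' : ι → Γ) : resampleKernel 0 w y' = if w = y' then 1 else 0 := by
  unfold resampleKernel
  simp only [sub_zero, one_mul, zero_div, add_zero]
  rw [Fintype.prod_boole]
  exact if_congr funext_iff.symm rfl rfl

/-- Inserting the second point of a path as a summation variable:
`[x Δ = y'] · P_ε(w, x 0) · W(x) = Σ_{y''} P_ε(w, y'') · ([x 0 = y''] [x Δ = y'] · W(x))`.
[cite: HuangSellke2025, §3.3.2 (Lemma 3.22, resampling-chain bookkeeping of the in-tree proof)] -/
theorem kpp_insert_midpoint {ι Γ : Type*} [Fintype ι] [DecidableEq ι] [Fintype Γ] [DecidableEq Γ]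
    (ε : ℝ) (Δ : ℕ) (w y' : ι → Γ) (x : Fin (Δ + 1) → ι → Γ) (W : ℝ) :
    (if x (Fin.last Δ) = y' then resampleKernel ε w (x 0) * W else 0) =
      ∑ y'' : ι → Γ, resampleKernel ε w y'' *
        (if x 0 = y'' ∧ x (Fin.last Δ) = y' then W else 0) := by
  rw [Fintype.sum_eq_single (x 0) fun b hb => by rw [if_neg fun h => hb h.1.symm, mul_zero]]
  by_cases h : x (Fin.last Δ) = y'
  · rw [if_pos h, if_pos ⟨rfl, h⟩]
  · rw [if_neg h, if_neg fun h' => h h'.2, mul_zero]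

/-- **The `Δ`-step kernel of the resampling chain** (`T_ρ ^ Δ = T_{ρ^Δ}`): given the one-step
composition identity `Σ_{y''} P_ε(y, y'') P_{ε'}(y'', y') = P_{1 − (1−ε)(1−ε')}(y, y')`, the total
weight of the length-`Δ` paths of the `ε`-resampling chain from `w` to `y'` is
`P_{1 − (1−ε)^Δ}(w, y')`.
[cite: HuangSellke2025, §3.3.2 (Lemma 3.22, resampling-chain bookkeeping of the in-tree proof)] -/
theorem stub_kernelPowPaths
    (hSemi : ∀ {ι Γ : Type} [Fintype ι] [DecidableEq ι] [Fintype Γ] [DecidableEq Γ] [Nonempty Γ]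
      (ε ε' : ℝ) (y y' : ι → Γ), ∑ y'' : ι → Γ, resampleKernel ε y y'' * resampleKernel ε' y'' y' =
        resampleKernel (1 - (1 - ε) * (1 - ε')) y y')
    {ι Γ : Type} [Fintype ι] [DecidableEq ι] [Fintype Γ] [DecidableEq Γ] [Nonempty Γ]
    (ε : ℝ) (Δ : ℕ) (w y' : ι → Γ) :
    ∑ y : Fin (Δ + 1) → ι → Γ,
        (if y 0 = w ∧ y (Fin.last Δ) = y' then
          ∏ t : Fin Δ, resampleKernel ε (y t.castSucc) (y t.succ) else 0)
      = resampleKernel (1 - (1 - ε) ^ Δ) w y' := by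
  induction Δ generalizing w with
  | zero =>
    rw [← (Equiv.funUnique (Fin 1) (ι → Γ)).symm.sum_comp]
    simp only [Finset.univ_eq_empty, Finset.prod_empty, Fin.last_zero,
      Equiv.funUnique_symm_apply, uniqueElim_const, pow_zero, sub_self]
    rw [Fintype.sum_eq_single w fun a ha => if_neg fun h => ha h.1, kpp_resampleKernel_zero]
    exact if_congr ⟨fun h => h.2, fun h => ⟨rfl, h⟩⟩ rfl rfl
  | succ Δ ih =>
    rw [← (Fin.consEquiv fun _ : Fin (Δ + 1 + 1) => ι → Γ).sum_comp, Fintype.sum_prod_type]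
    simp only [Fin.consEquiv_apply, Fin.prod_univ_succ, Fin.castSucc_zero, Fin.cons_zero,
      Fin.cons_succ, Fin.castSucc_succ, ← Fin.succ_last]
    rw [Fintype.sum_eq_single w fun a ha => Fintype.sum_eq_zero _ fun x => if_neg fun h => ha h.1]
    calc ∑ x : Fin (Δ + 1) → ι → Γ,
          (if w = w ∧ x (Fin.last Δ) = y' then
            resampleKernel ε w (x 0) *
              ∏ t : Fin Δ, resampleKernel ε (x t.castSucc) (x t.succ) else 0)
        = ∑ x : Fin (Δ + 1) → ι → Γ, ∑ y'' : ι → Γ, resampleKernel ε w y'' *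
            (if x 0 = y'' ∧ x (Fin.last Δ) = y' then
              ∏ t : Fin Δ, resampleKernel ε (x t.castSucc) (x t.succ) else 0) := by
          refine Finset.sum_congr rfl fun x _ => ?_
          rw [← kpp_insert_midpoint]
          exact if_congr ⟨fun h => h.2, fun h => ⟨rfl, h⟩⟩ rfl rfl
      _ = ∑ y'' : ι → Γ, resampleKernel ε w y'' * resampleKernel (1 - (1 - ε) ^ Δ) y'' y' := by
          rw [Finset.sum_comm]
          refine Finset.sum_congr rfl fun y'' _ => ?_
          rw [← Finset.mul_sum, ih y'']
      _ = resampleKernel (1 - (1 - ε) ^ (Δ + 1)) w y' := by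
          rw [hSemi, sub_sub_cancel, pow_succ']

end Literature.Computability.Complexity.HuangSellke2025Chain

end Part7

/-!
## Part 8 — port of `Summits/PneNP/PneNP/Theorems/OverlapGapAlgebraSearchHardWindowChainTwoBlock.lean` (9 declarations kept)

# Route OverlapGapAlgebra, crux `SearchHardWindow` : the two-block Markov bound
# for the chain mass

For the `ε`-resampling Markov chain `y 0, y 1, …, y K` on a finite product space `ι → Γ`
(Huang–Sellke 2025 §3.3.2; vocabulary `resampleKernel`, `resampleChainMass` of
`Literature/Computability/Complexity/RandomKSatEnsembleOGP.lean`) the mass of an event `E` on paths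
is the finite weighted count
`resampleChainMass ε K E = (Σ_y (∏_{t<K} P_ε(y t, y (t+1))) · [E (t ↦ y (min t K))]) / #(ι → Γ)`,
the sum ranging over `y : Fin (K+1) → ι → Γ`.

`stub_chainTwoBlock` is the Markov property in the form used by the first moment of the CHAOS lemma
(Huang–Sellke 2025, Lemma 3.23) in line `Sketch`: for an event `A` that only reads the path at times
`≤ s` and a property `B` of the single instance at time `s + Δ ≤ K`,
`mass(A ∧ B@(s+Δ)) ≤ q · mass(A)` as soon as, uniformly in the starting point `w`, the length-`Δ`
segments started at `w` carry `B` at their end with total weight `≤ q`.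

The proof is path-sum surgery for an abstract nonnegative stochastic kernel `P` on a finite type `V`
(specialised at the end to `P_ε` on `ι → Γ`, nonnegative by `cmb_kernel_nonneg` and stochastic by
`stub_resampleKernelBasic` (c)). Paths are peeled at their FIRST step, `y = Fin.cons v z`
(`ctb_sum_cons`, `ctb_weight_cons`):
* `ctb_total`: `Σ_y f (y 0) · w(y) = Σ_v f v` (all steps sum out, by stochasticity);
* `ctb_truncate`: a functional reading only the first `L + 1` points may be summed over paths of
  length `L + 1` (the tail sums out) — whence the segment bound holds at every length `≥ Δ`
  (`ctb_segment_bound`);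
* `ctb_twoBlock_fin`: the bound `Σ_y w(y) F(y) G(y (s+Δ)) ≤ q Σ_y w(y) F(y)` for `F ≥ 0` reading only
  times `≤ s`, by induction on `s`: peeling the first step turns `F` into the functionals
  `z ↦ P(v, z 0) F(cons v z)` reading only times `≤ s − 1` of the shorter path, and at `s = 0` the
  functional `F(y) = f(y 0)` factors through the starting point, where the segment bound applies.
Finally `[A ∧ B] = [A] · [B]` and both sides of the claim are such path sums divided by `#(ι → Γ)`.

(Verbatim declaration-level port — the declarations listed in the Part header count — of the Summits-side module of the PneNP
tree (route OverlapGapAlgebra, crux SearchHardWindow / NoStableSection); route / stub / lead bookkeeping in the text above is historical.)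
-/

section Part8

namespace Literature.Computability.Complexity.HuangSellke2025Chain

open _root_.Finset
open Literature.Computability.Complexity
open scoped _root_.Classical

section AbstractKernel

variable {V : Type*}

/-- The path weight of `Fin.cons v z` factors as the first step `P v (z 0)` times the weight of `z`.
[cite: HuangSellke2025, §3.3.2 (Lemma 3.22, resampling-chain bookkeeping of the in-tree proof)] -/
theorem ctb_weight_cons (P : V → V → ℝ) (K : ℕ) (v : V) (z : Fin (K + 1) → V) :
    ∏ t : Fin (K + 1), P ((Fin.cons v z : Fin (K + 1 + 1) → V) t.castSucc)
        ((Fin.cons v z : Fin (K + 1 + 1) → V) t.succ) =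
      P v (z 0) * ∏ t : Fin K, P (z t.castSucc) (z t.succ) := by
  rw [Fin.prod_univ_succ]
  simp only [Fin.castSucc_zero, Fin.cons_zero, Fin.cons_succ, Fin.castSucc_succ]

/-- Restricting `Fin.cons v z` to its first `L + 2` entries is `Fin.cons v` of the restriction of `z`
to its first `L + 1` entries.
[cite: HuangSellke2025, §3.3.2 (Lemma 3.22, resampling-chain bookkeeping of the in-tree proof)] -/
theorem ctb_cons_castLE {L K : ℕ} (h : L + 1 + 1 ≤ K + 1 + 1) (v : V) (z : Fin (K + 1) → V) :
    (fun i : Fin (L + 1 + 1) => (Fin.cons v z : Fin (K + 1 + 1) → V) (Fin.castLE h i)) =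
      Fin.cons v (fun i : Fin (L + 1) => z (Fin.castLE (Nat.succ_le_succ_iff.mp h) i)) := by
  funext i
  refine Fin.cases ?_ (fun j => ?_) i
  · simp
  · simp

/-- The indicator of a conjunction is the product of the indicators (any `Decidable` instances,
conjuncts up to `↔`).
[cite: HuangSellke2025, §3.3.2 (Lemma 3.22, resampling-chain bookkeeping of the in-tree proof)] -/
theorem ctb_ite_and_eq {p p' r r' : Prop} {hpr : Decidable (p ∧ r)} {hp : Decidable p'}
    {hr : Decidable r'} (h1 : p ↔ p') (h2 : r ↔ r') :
    @ite ℝ (p ∧ r) hpr 1 0 = @ite ℝ p' hp 1 0 * @ite ℝ r' hr 1 0 := by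
  by_cases a : p
  · by_cases b : r
    · rw [if_pos ⟨a, b⟩, if_pos (h1.1 a), if_pos (h2.1 b), mul_one]
    · rw [if_neg (fun h => b h.2), if_neg (fun h => b (h2.2 h)), mul_zero]
  · rw [if_neg (fun h => a h.1), if_neg (fun h => a (h1.2 h)), zero_mul]

variable [Fintype V]

/-- Reindex a sum over paths of length `n + 1` by (first point, remaining path): `y = Fin.cons v z`.
[cite: HuangSellke2025, §3.3.2 (Lemma 3.22, resampling-chain bookkeeping of the in-tree proof)] -/
theorem ctb_sum_cons (n : ℕ) (Φ : (Fin (n + 1) → V) → ℝ) :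
    ∑ y : Fin (n + 1) → V, Φ y = ∑ v : V, ∑ z : Fin n → V, Φ (Fin.cons v z) := by
  rw [← (Fin.consEquiv fun _ : Fin (n + 1) => V).sum_comp, Fintype.sum_prod_type]
  rfl

/-- Total mass of the chain from a weighted start, for a stochastic kernel `P`:
`Σ_y f (y 0) · ∏_{t<K} P (y t) (y (t+1)) = Σ_v f v` (the `K` steps sum out one at a time).
[cite: HuangSellke2025, §3.3.2 (Lemma 3.22, resampling-chain bookkeeping of the in-tree proof)] -/
theorem ctb_total (P : V → V → ℝ) (hP1 : ∀ u, ∑ v, P u v = 1) :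
    ∀ (K : ℕ) (f : V → ℝ),
      ∑ y : Fin (K + 1) → V, f (y 0) * ∏ t : Fin K, P (y t.castSucc) (y t.succ) = ∑ v, f v
  | 0, f => by
    rw [← (Equiv.funUnique (Fin 1) V).symm.sum_comp]
    simp
  | K + 1, f => by
    rw [ctb_sum_cons (K + 1)]
    simp only [Fin.cons_zero, ctb_weight_cons]
    refine Finset.sum_congr rfl fun v _ => ?_
    have ih := ctb_total P hP1 K (fun u => f v * P v u)
    rw [← Finset.mul_sum, hP1, mul_one] at ih
    refine Eq.trans (Finset.sum_congr rfl fun z _ => ?_) ih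
    ring

/-- **Truncation (marginalising the tail of the chain).** For a stochastic kernel, a path functional
that only reads the first `L + 1` points can be summed over paths of length `L + 1` instead of
`K + 1 ≥ L + 1`: the last `K − L` steps sum out to `1`.
[cite: HuangSellke2025, §3.3.2 (Lemma 3.22, resampling-chain bookkeeping of the in-tree proof)] -/
theorem ctb_truncate (P : V → V → ℝ) (hP1 : ∀ u, ∑ v, P u v = 1) :
    ∀ (L K : ℕ) (h : L + 1 ≤ K + 1) (Φ : (Fin (L + 1) → V) → ℝ),
      ∑ y : Fin (K + 1) → V, (∏ t : Fin K, P (y t.castSucc) (y t.succ)) *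
          Φ (fun i => y (Fin.castLE h i)) =
        ∑ z : Fin (L + 1) → V, (∏ t : Fin L, P (z t.castSucc) (z t.succ)) * Φ z
  | 0, K, h, Φ => by
    have hΦ : ∀ x : Fin (0 + 1) → V, Φ x = Φ (fun _ => x 0) := fun x =>
      congrArg Φ (funext fun i => congrArg x
        (Fin.ext (by have hi := i.2; simp only [Fin.val_zero]; omega)))
    calc ∑ y : Fin (K + 1) → V, (∏ t : Fin K, P (y t.castSucc) (y t.succ)) *
          Φ (fun i => y (Fin.castLE h i))
        = ∑ y : Fin (K + 1) → V, Φ (fun _ => y 0) * ∏ t : Fin K, P (y t.castSucc) (y t.succ) :=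
          Finset.sum_congr rfl fun y _ => by
            rw [hΦ (fun i => y (Fin.castLE h i))]
            simp only [Fin.castLE_zero]
            rw [mul_comm]
      _ = ∑ v, Φ (fun _ => v) := ctb_total P hP1 K (fun v => Φ (fun _ => v))
      _ = ∑ z : Fin (0 + 1) → V, Φ (fun _ => z 0) * ∏ t : Fin 0, P (z t.castSucc) (z t.succ) :=
          (ctb_total P hP1 0 (fun v => Φ (fun _ => v))).symm
      _ = ∑ z : Fin (0 + 1) → V, (∏ t : Fin 0, P (z t.castSucc) (z t.succ)) * Φ z :=
          Finset.sum_congr rfl fun z _ => by rw [hΦ z, mul_comm]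
  | L + 1, K, h, Φ => by
    obtain ⟨K', rfl⟩ : ∃ K', K = K' + 1 := ⟨K - 1, by omega⟩
    have h' : L + 1 ≤ K' + 1 := by omega
    calc ∑ y : Fin (K' + 1 + 1) → V, (∏ t : Fin (K' + 1), P (y t.castSucc) (y t.succ)) *
          Φ (fun i => y (Fin.castLE h i))
        = ∑ v, ∑ z : Fin (K' + 1) → V, (∏ t : Fin K', P (z t.castSucc) (z t.succ)) *
            (P v ((fun i : Fin (L + 1) => z (Fin.castLE h' i)) 0) *
              Φ (Fin.cons v (fun i : Fin (L + 1) => z (Fin.castLE h' i)))) := by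
          rw [ctb_sum_cons (K' + 1)]
          simp only [ctb_weight_cons, ctb_cons_castLE, Fin.castLE_zero]
          exact Finset.sum_congr rfl fun v _ => Finset.sum_congr rfl fun z _ => by ring
      _ = ∑ v, ∑ x : Fin (L + 1) → V, (∏ t : Fin L, P (x t.castSucc) (x t.succ)) *
            (P v (x 0) * Φ (Fin.cons v x)) :=
          Finset.sum_congr rfl fun v _ =>
            ctb_truncate P hP1 L K' h' (fun x => P v (x 0) * Φ (Fin.cons v x))
      _ = ∑ y : Fin (L + 1 + 1) → V, (∏ t : Fin (L + 1), P (y t.castSucc) (y t.succ)) * Φ y := by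
          rw [ctb_sum_cons (L + 1)]
          simp only [ctb_weight_cons]
          exact Finset.sum_congr rfl fun v _ => Finset.sum_congr rfl fun z _ => by ring

variable [DecidableEq V]

/-- **The segment bound transfers to every length.** If every length-`Δ` segment started at `w`
carries `G` at its end with total weight `≤ q`, then on paths of any length `K ≥ Δ` started at `w`
the weight of `G` read at time `Δ` is `≤ q` (the steps after time `Δ` sum out, `ctb_truncate`).
[cite: HuangSellke2025, §3.3.2 (Lemma 3.22, resampling-chain bookkeeping of the in-tree proof)] -/
theorem ctb_segment_bound (P : V → V → ℝ) (hP1 : ∀ u, ∑ v, P u v = 1) (Δ : ℕ) (G : V → ℝ)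
    (q : ℝ)
    (hq : ∀ w : V, ∑ x : Fin (Δ + 1) → V,
        (if x 0 = w then (∏ t : Fin Δ, P (x t.castSucc) (x t.succ)) * G (x (Fin.last Δ)) else 0)
          ≤ q)
    (K : ℕ) (m : Fin (K + 1)) (hm : (m : ℕ) = Δ) (w : V) :
    ∑ y : Fin (K + 1) → V,
        (if y 0 = w then (∏ t : Fin K, P (y t.castSucc) (y t.succ)) * G (y m) else 0) ≤ q := by
  have h : Δ + 1 ≤ K + 1 := by have := m.2; omega
  have key := ctb_truncate P hP1 Δ K h (fun x => if x 0 = w then G (x (Fin.last Δ)) else 0)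
  have e1 : Fin.castLE h (Fin.last Δ) = m := Fin.ext (by simp [hm])
  simp only [Fin.castLE_zero, e1, mul_ite, mul_zero] at key
  rw [key]
  exact hq w

/-- **Two-block Markov bound, `Fin`-indexed form.** For a nonnegative stochastic kernel `P`, a
nonnegative path functional `F` reading only times `≤ s`, a function `G` of the point at time
`m = s + Δ ≤ K`, and a uniform segment bound `q` for `G` (at every length, as produced by
`ctb_segment_bound`): `Σ_y w(y) F(y) G(y m) ≤ q · Σ_y w(y) F(y)`. Induction on `s`, peeling the
first step of the path.
[cite: HuangSellke2025, §3.3.2 (Lemma 3.22, resampling-chain bookkeeping of the in-tree proof)] -/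
theorem ctb_twoBlock_fin (P : V → V → ℝ) (hP0 : ∀ u v, 0 ≤ P u v) (hP1 : ∀ u, ∑ v, P u v = 1)
    (Δ : ℕ) (G : V → ℝ) (q : ℝ)
    (hq : ∀ (K : ℕ) (m : Fin (K + 1)), (m : ℕ) = Δ → ∀ w : V, ∑ y : Fin (K + 1) → V,
        (if y 0 = w then (∏ t : Fin K, P (y t.castSucc) (y t.succ)) * G (y m) else 0) ≤ q) :
    ∀ (s K : ℕ) (m : Fin (K + 1)), (m : ℕ) = s + Δ → ∀ (F : (Fin (K + 1) → V) → ℝ),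
      (∀ y, 0 ≤ F y) → (∀ y y', (∀ i : Fin (K + 1), (i : ℕ) ≤ s → y i = y' i) → F y = F y') →
      ∑ y : Fin (K + 1) → V, (∏ t : Fin K, P (y t.castSucc) (y t.succ)) * (F y * G (y m)) ≤
        q * ∑ y : Fin (K + 1) → V, (∏ t : Fin K, P (y t.castSucc) (y t.succ)) * F y
  | 0, K, m, hm, F, hF0, hF => by
    -- `F` only reads the starting point `y 0`
    have hFy : ∀ y : Fin (K + 1) → V, F y = F (fun _ => y 0) := fun y =>
      hF y (fun _ => y 0) fun i hi => by
        have hi0 : i = 0 := Fin.ext (by simp only [Fin.val_zero]; omega)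
        rw [hi0]
    have hsumF : ∑ y : Fin (K + 1) → V, (∏ t : Fin K, P (y t.castSucc) (y t.succ)) * F y =
        ∑ v, F (fun _ => v) := by
      calc ∑ y : Fin (K + 1) → V, (∏ t : Fin K, P (y t.castSucc) (y t.succ)) * F y
          = ∑ y : Fin (K + 1) → V, F (fun _ => y 0) * ∏ t : Fin K, P (y t.castSucc) (y t.succ) :=
            Finset.sum_congr rfl fun y _ => by rw [hFy y, mul_comm]
        _ = ∑ v, F (fun _ => v) := ctb_total P hP1 K (fun v => F (fun _ => v))
    calc ∑ y : Fin (K + 1) → V, (∏ t : Fin K, P (y t.castSucc) (y t.succ)) * (F y * G (y m))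
        = ∑ y : Fin (K + 1) → V, ∑ v, (if y 0 = v then
            F (fun _ => v) * ((∏ t : Fin K, P (y t.castSucc) (y t.succ)) * G (y m)) else 0) := by
          refine Finset.sum_congr rfl fun y _ => ?_
          rw [Fintype.sum_ite_eq (y 0) (fun v =>
            F (fun _ => v) * ((∏ t : Fin K, P (y t.castSucc) (y t.succ)) * G (y m))), hFy y]
          ring
      _ = ∑ v, F (fun _ => v) * ∑ y : Fin (K + 1) → V, (if y 0 = v then
            (∏ t : Fin K, P (y t.castSucc) (y t.succ)) * G (y m) else 0) := by
          rw [Finset.sum_comm]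
          refine Finset.sum_congr rfl fun v _ => ?_
          rw [Finset.mul_sum]
          refine Finset.sum_congr rfl fun y _ => ?_
          rw [mul_ite, mul_zero]
      _ ≤ ∑ v, F (fun _ => v) * q :=
          Finset.sum_le_sum fun v _ => mul_le_mul_of_nonneg_left (hq K m (by omega) v) (hF0 _)
      _ = q * ∑ y : Fin (K + 1) → V, (∏ t : Fin K, P (y t.castSucc) (y t.succ)) * F y := by
          rw [hsumF, ← Finset.sum_mul, mul_comm]
  | s + 1, K, m, hm, F, hF0, hF => by
    obtain ⟨K', rfl⟩ : ∃ K', K = K' + 1 := ⟨K - 1, by have := m.2; omega⟩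
    obtain ⟨m', rfl, hm'⟩ : ∃ m' : Fin (K' + 1), m = m'.succ ∧ (m' : ℕ) = s + Δ :=
      ⟨⟨s + Δ, by have := m.2; omega⟩, Fin.ext (by simp only [Fin.val_succ]; omega), rfl⟩
    -- peel the first step, `y = Fin.cons v z`: the new functionals `z ↦ P v (z 0) · F (cons v z)`
    have hF0' : ∀ (v : V) (z : Fin (K' + 1) → V), 0 ≤ P v (z 0) * F (Fin.cons v z) :=
      fun v z => mul_nonneg (hP0 _ _) (hF0 _)
    have hF' : ∀ (v : V) (z z' : Fin (K' + 1) → V),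
        (∀ i : Fin (K' + 1), (i : ℕ) ≤ s → z i = z' i) →
        P v (z 0) * F (Fin.cons v z) = P v (z' 0) * F (Fin.cons v z') := by
      intro v z z' hzz'
      rw [hzz' 0 (by simp only [Fin.val_zero]; omega)]
      congr 1
      refine hF _ _ fun i hi => ?_
      cases i using Fin.cases with
      | zero => simp only [Fin.cons_zero]
      | succ j =>
        simp only [Fin.cons_succ]
        exact hzz' j (by simp only [Fin.val_succ] at hi; omega)
    calc ∑ y : Fin (K' + 1 + 1) → V, (∏ t : Fin (K' + 1), P (y t.castSucc) (y t.succ)) *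
          (F y * G (y m'.succ))
        = ∑ v, ∑ z : Fin (K' + 1) → V, (∏ t : Fin K', P (z t.castSucc) (z t.succ)) *
            ((P v (z 0) * F (Fin.cons v z)) * G (z m')) := by
          rw [ctb_sum_cons (K' + 1)]
          simp only [ctb_weight_cons]
          simp only [Fin.cons_succ]
          exact Finset.sum_congr rfl fun v _ => Finset.sum_congr rfl fun z _ => by ring
      _ ≤ ∑ v, q * ∑ z : Fin (K' + 1) → V, (∏ t : Fin K', P (z t.castSucc) (z t.succ)) *
            (P v (z 0) * F (Fin.cons v z)) :=
          Finset.sum_le_sum fun v _ =>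
            ctb_twoBlock_fin P hP0 hP1 Δ G q hq s K' m' hm'
              (fun z => P v (z 0) * F (Fin.cons v z)) (hF0' v) (hF' v)
      _ = q * ∑ y : Fin (K' + 1 + 1) → V,
            (∏ t : Fin (K' + 1), P (y t.castSucc) (y t.succ)) * F y := by
          rw [← Finset.mul_sum]
          congr 1
          rw [ctb_sum_cons (K' + 1)]
          simp only [ctb_weight_cons]
          exact Finset.sum_congr rfl fun v _ => Finset.sum_congr rfl fun z _ => by ring

end AbstractKernel

/-- **Two-block Markov bound for the chain mass** of the `ε`-resampling chain (`0 ≤ ε ≤ 1`;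
Huang–Sellke 2025 §3.3.2, the Markov property behind the first moment of Lemma 3.23): if the event
`A` only reads the path at times `≤ s` and `B` is a property of the instance at time `s + Δ ≤ K`,
then `mass(A ∧ B(z (s+Δ))) ≤ q · mass(A)` whenever every length-`Δ` segment of the chain, started
at any point `w`, carries `B` at its end with total weight `≤ q`.
[cite: HuangSellke2025, §3.3.2 (Lemma 3.22, resampling-chain bookkeeping of the in-tree proof)] -/
theorem stub_chainTwoBlock {ι Γ : Type*} [Fintype ι] [DecidableEq ι] [Fintype Γ] [DecidableEq Γ]
    [Nonempty Γ] (ε : ℝ) (hε0 : 0 ≤ ε) (hε1 : ε ≤ 1) (K s Δ : ℕ) (hsΔ : s + Δ ≤ K)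
    (A : (ℕ → ι → Γ) → Prop) (hA : ∀ z z' : ℕ → ι → Γ, (∀ t ≤ s, z t = z' t) → (A z ↔ A z'))
    (B : (ι → Γ) → Prop) (q : ℝ)
    (hq : ∀ w : ι → Γ, ∑ y : Fin (Δ + 1) → ι → Γ,
        (if y 0 = w then (∏ t : Fin Δ, resampleKernel ε (y t.castSucc) (y t.succ)) *
          (if B (y (Fin.last Δ)) then (1 : ℝ) else 0) else 0) ≤ q) :
    resampleChainMass ε K (fun z => A z ∧ B (z (s + Δ))) ≤ q * resampleChainMass ε K A := by
  have hP0 : ∀ u v : ι → Γ, 0 ≤ resampleKernel ε u v := cmb_kernel_nonneg ε hε0 hε1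
  have hP1 : ∀ u : ι → Γ, ∑ v, resampleKernel ε u v = 1 :=
    (stub_resampleKernelBasic ε hε0 hε1).2.2
  -- the segment bound at every length `≥ Δ`
  have hq' := ctb_segment_bound (resampleKernel ε) hP1 Δ (fun v => if B v then (1 : ℝ) else 0) q hq
  -- `[A]` is nonnegative and only reads times `≤ s`
  have hF0 : ∀ y : Fin (K + 1) → ι → Γ,
      0 ≤ (if A (fun t => y ⟨min t K, Nat.lt_succ_of_le (Nat.min_le_right t K)⟩) then (1 : ℝ)
        else 0) :=
    fun y => by split_ifs <;> norm_num
  have hF : ∀ y y' : Fin (K + 1) → ι → Γ, (∀ i : Fin (K + 1), (i : ℕ) ≤ s → y i = y' i) →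
      (if A (fun t => y ⟨min t K, Nat.lt_succ_of_le (Nat.min_le_right t K)⟩) then (1 : ℝ)
        else 0) =
      (if A (fun t => y' ⟨min t K, Nat.lt_succ_of_le (Nat.min_le_right t K)⟩) then (1 : ℝ)
        else 0) :=
    fun y y' hyy' => cmb_ite_congr (hA _ _ fun t ht => hyy' _ (le_trans (Nat.min_le_left t K) ht))
  have key := ctb_twoBlock_fin (resampleKernel ε) hP0 hP1 Δ (fun v => if B v then (1 : ℝ) else 0)
    q hq' s K ⟨s + Δ, Nat.lt_succ_of_le hsΔ⟩ rfl
    (fun y => if A (fun t => y ⟨min t K, Nat.lt_succ_of_le (Nat.min_le_right t K)⟩) then (1 : ℝ)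
      else 0) hF0 hF
  unfold resampleChainMass
  rw [← mul_div_assoc]
  refine div_le_div_of_nonneg_right
    ((Finset.sum_congr rfl fun y _ => ?_).trans_le key) (Nat.cast_nonneg _)
  -- pathwise, `[A ∧ B (z (s + Δ))] = [A] · [B (y (s + Δ))]`
  have e : y ⟨min (s + Δ) K, Nat.lt_succ_of_le (Nat.min_le_right (s + Δ) K)⟩ =
      y ⟨s + Δ, Nat.lt_succ_of_le hsΔ⟩ := congrArg y (Fin.ext (min_eq_left hsΔ))
  exact congrArg _ (ctb_ite_and_eq Iff.rfl (Iff.of_eq (congrArg B e)))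

end Literature.Computability.Complexity.HuangSellke2025Chain

end Part8

/-!
## Part 9 — port of `Summits/PneNP/PneNP/Theorems/OverlapGapAlgebraSearchHardWindowMultiTimeMarginal.lean` (9 declarations kept)

# Route OverlapGapAlgebra, crux `SearchHardWindow` : finite-dimensional marginals
# of the resampling chain

For the `ε`-resampling Markov chain `y 0, y 1, …, y K` on a finite product space `ι → Γ` started
uniformly (Huang–Sellke 2025 §3.3.2; vocabulary `resampleKernel`, `resampleChainMass` of
`Literature/Computability/Complexity/RandomKSatEnsembleOGP.lean`), `stub_multiTimeMarginal` computes
the mass of an event that reads the path only at monotone times `τ 0 ≤ τ 1 ≤ ⋯ ≤ τ L ≤ K`: it is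
(bounded by, in fact equal to) the explicit `(L+1)`-fold sum
`(Σ_x ∏_{ℓ<L} P_{1−(1−ε)^{τ(ℓ+1)−τ ℓ}}(x ℓ, x (ℓ+1)) · [E x]) / #(ι → Γ)`,
the gap kernels being the closed-form `Δ`-step kernels `P_{1−(1−ε)^Δ}` of the chain.

The proof is path-sum surgery for an abstract kernel `P` on a finite type `V` together with a family
`Q Δ` of "`Δ`-step kernels" characterised by `Q 0 = [u = v]` and `Q (Δ+1) = P ∘ Q Δ`
(for `P = P_ε` these are `Q Δ = P_{1−(1−ε)^Δ}`, by `kpp_resampleKernel_zero` and the semigroup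
identity `stub_kernelSemigroup`). The Markov identity `mtm_marginal_abs`,
`Σ_y w(y) Φ (y 0) (ℓ ↦ y (τ ℓ))
  = Σ_v Σ_x Q (τ 0) v (x 0) · ∏_{ℓ<L} Q (τ(ℓ+1) − τ ℓ) (x ℓ) (x (ℓ+1)) · Φ v x`
(`w(y) = ∏_{t<K} P (y t) (y (t+1))`), is proved by peeling the FIRST step of the path
(`ctb_sum_cons`, `ctb_weight_cons` of the two-block file), by induction on `L` and then on `τ 0`:
* `mtm_base` (`L = 0`, `τ 0 = 0`): the functional reads only `y 0`, all steps sum out (`ctb_total`,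
  row-stochasticity);
* `mtm_collapse` (`τ 0 = 0`, `L + 1` observations): the observation vector is `Fin.cons (y 0)` of
  the observations at `τ ∘ succ`, and on the other side `Q 0 = [· = ·]` collapses the first
  summation;
* `mtm_shift` (`τ 0 = s + 1`): peel `y = Fin.cons v z`; the observations of `y` at `τ` are those of
  `z` at `τ − 1`, the factor `P v (z 0)` is absorbed into the functional, and on the other side
  `Σ_u P v u · Q s u = Q (s+1) v`.
Finally the uniform start is summed out by the column sums `Σ_v Q Δ v u = 1` (`mtm_colsum`, from the
column-stochasticity of `P`, i.e. symmetry + stochasticity of `P_ε`,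
`stub_resampleKernelBasic`), and `min (τ ℓ) K = τ ℓ` identifies the `ℕ`-indexed event of
`resampleChainMass` with the `Fin`-indexed one.

(Verbatim declaration-level port — the declarations listed in the Part header count — of the Summits-side module of the PneNP
tree (route OverlapGapAlgebra, crux SearchHardWindow / NoStableSection); route / stub / lead bookkeeping in the text above is historical.)
-/

section Part9

namespace Literature.Computability.Complexity.HuangSellke2025Chain

open _root_.Finset
open Literature.Computability.Complexity
open scoped _root_.Classical

section AbstractKernel

variable {V : Type*}

/-- When `τ 0 = 0`, the vector of observations of a path `y` at the times `τ` is `Fin.cons (y 0)` of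
the observations at the times `τ ∘ Fin.succ`.
[cite: HuangSellke2025, §3.3.2 (Lemma 3.22, resampling-chain bookkeeping of the in-tree proof)] -/
theorem mtm_obs_cons {K L : ℕ} (τ : Fin (L + 1 + 1) → ℕ) (h0 : τ 0 = 0) (hK : ∀ ℓ, τ ℓ < K + 1)
    (y : Fin (K + 1) → V) :
    (fun ℓ => y ⟨τ ℓ, hK ℓ⟩) =
      Fin.cons (y 0) (fun ℓ : Fin (L + 1) => y ⟨τ ℓ.succ, hK ℓ.succ⟩) := by
  funext ℓ
  refine Fin.cases ?_ (fun j => ?_) ℓ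
  · simp only [Fin.cons_zero]
    exact congrArg y (Fin.ext (by simp only [Fin.val_zero, h0]))
  · simp only [Fin.cons_succ]

/-- When all times `τ ℓ ≥ 1`, the observations of the path `Fin.cons v z` at the times `τ` are the
observations of `z` at the times `τ − 1`.
[cite: HuangSellke2025, §3.3.2 (Lemma 3.22, resampling-chain bookkeeping of the in-tree proof)] -/
theorem mtm_obs_shift {K L : ℕ} (τ : Fin (L + 1) → ℕ) (h1 : ∀ ℓ, 1 ≤ τ ℓ)
    (hK : ∀ ℓ, τ ℓ < K + 1 + 1) (hK' : ∀ ℓ, τ ℓ - 1 < K + 1) (v : V) (z : Fin (K + 1) → V) :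
    (fun ℓ => (Fin.cons v z : Fin (K + 1 + 1) → V) ⟨τ ℓ, hK ℓ⟩) = fun ℓ => z ⟨τ ℓ - 1, hK' ℓ⟩ := by
  funext ℓ
  have e : (⟨τ ℓ, hK ℓ⟩ : Fin (K + 1 + 1)) = Fin.succ ⟨τ ℓ - 1, hK' ℓ⟩ :=
    Fin.ext (by have := h1 ℓ; simp only [Fin.val_succ]; omega)
  rw [e, Fin.cons_succ]

/-- Splitting off the first factor of a gap-kernel product along `Fin.cons u x`:
`∏_{ℓ<L+1} Q (τ(ℓ+1) − τ ℓ) ((u, x) ℓ) ((u, x) (ℓ+1))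
  = Q (τ 1 − τ 0) u (x 0) · ∏_{ℓ<L} Q (τ(ℓ+2) − τ(ℓ+1)) (x ℓ) (x (ℓ+1))`.
[cite: HuangSellke2025, §3.3.2 (Lemma 3.22, resampling-chain bookkeeping of the in-tree proof)] -/
theorem mtm_gapProd_cons (Q : ℕ → V → V → ℝ) (L : ℕ) (τ : Fin (L + 1 + 1) → ℕ) (u : V)
    (x : Fin (L + 1) → V) :
    ∏ ℓ : Fin (L + 1), Q (τ ℓ.succ - τ ℓ.castSucc)
        ((Fin.cons u x : Fin (L + 1 + 1) → V) ℓ.castSucc)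
        ((Fin.cons u x : Fin (L + 1 + 1) → V) ℓ.succ) =
      Q (τ (Fin.succ 0) - τ 0) u (x 0) *
        ∏ ℓ : Fin L, Q (τ ℓ.succ.succ - τ ℓ.castSucc.succ) (x ℓ.castSucc) (x ℓ.succ) := by
  rw [Fin.prod_univ_succ]
  simp only [Fin.castSucc_zero, Fin.cons_zero, Fin.cons_succ, Fin.castSucc_succ]

variable [Fintype V] [DecidableEq V]

/-- Column sums of the multi-step kernels: if `P` is column-stochastic, `Q 0 = [· = ·]` and
`Q (Δ+1) u v = Σ_w P u w · Q Δ w v`, then `Σ_u Q Δ u v = 1` for every `Δ`.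
[cite: HuangSellke2025, §3.3.2 (Lemma 3.22, resampling-chain bookkeeping of the in-tree proof)] -/
theorem mtm_colsum (P : V → V → ℝ) (hP2 : ∀ v, ∑ u, P u v = 1) (Q : ℕ → V → V → ℝ)
    (hQ0 : ∀ u v, Q 0 u v = if u = v then 1 else 0)
    (hQs : ∀ Δ u v, Q (Δ + 1) u v = ∑ w, P u w * Q Δ w v) :
    ∀ (Δ : ℕ) (v : V), ∑ u, Q Δ u v = 1
  | 0, v => by simp [hQ0]
  | Δ + 1, v => by
    simp only [hQs]
    rw [Finset.sum_comm]
    simp only [← Finset.sum_mul, hP2, one_mul]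
    exact mtm_colsum P hP2 Q hQ0 hQs Δ v

/-- Base case of the marginal identity (`L = 0`, `τ 0 = 0`): the functional reads only the starting
point, and all `K` steps sum out (`ctb_total`).
[cite: HuangSellke2025, §3.3.2 (Lemma 3.22, resampling-chain bookkeeping of the in-tree proof)] -/
theorem mtm_base (P : V → V → ℝ) (hP1 : ∀ u, ∑ v, P u v = 1) (Q : ℕ → V → V → ℝ)
    (hQ0 : ∀ u v, Q 0 u v = if u = v then 1 else 0) (K : ℕ) (τ : Fin (0 + 1) → ℕ)
    (h0 : τ 0 = 0) (hK : ∀ ℓ, τ ℓ < K + 1) (Φ : V → (Fin (0 + 1) → V) → ℝ) :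
    ∑ y : Fin (K + 1) → V, (∏ t : Fin K, P (y t.castSucc) (y t.succ)) *
        Φ (y 0) (fun ℓ => y ⟨τ ℓ, hK ℓ⟩) =
      ∑ v, ∑ x : Fin (0 + 1) → V, Q 0 v (x 0) *
        (∏ ℓ : Fin 0, Q (τ ℓ.succ - τ ℓ.castSucc) (x ℓ.castSucc) (x ℓ.succ)) * Φ v x := by
  have hℓ0 : ∀ ℓ : Fin (0 + 1), ℓ = 0 := fun ℓ =>
    Fin.ext (by have := ℓ.2; simp only [Fin.val_zero]; omega)
  have hobs : ∀ y : Fin (K + 1) → V, (fun ℓ => y ⟨τ ℓ, hK ℓ⟩) = fun _ => y 0 := fun y => by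
    funext ℓ
    obtain rfl : ℓ = 0 := hℓ0 ℓ
    exact congrArg y (Fin.ext (by simp only [Fin.val_zero, h0]))
  have hcst : ∀ x : Fin (0 + 1) → V, (fun _ => x 0) = x := fun x =>
    funext fun ℓ => congrArg x (hℓ0 ℓ).symm
  calc ∑ y : Fin (K + 1) → V, (∏ t : Fin K, P (y t.castSucc) (y t.succ)) *
        Φ (y 0) (fun ℓ => y ⟨τ ℓ, hK ℓ⟩)
      = ∑ y : Fin (K + 1) → V, Φ (y 0) (fun _ => y 0) *
          ∏ t : Fin K, P (y t.castSucc) (y t.succ) :=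
        Finset.sum_congr rfl fun y _ => by rw [hobs y, mul_comm]
    _ = ∑ v, Φ v (fun _ => v) := ctb_total P hP1 K (fun v => Φ v (fun _ => v))
    _ = ∑ x : Fin (0 + 1) → V, Φ (x 0) (fun _ => x 0) *
          ∏ t : Fin 0, P (x t.castSucc) (x t.succ) :=
        (ctb_total P hP1 0 (fun v => Φ v (fun _ => v))).symm
    _ = _ := by
        rw [Finset.sum_comm]
        refine Finset.sum_congr rfl fun x _ => ?_
        rw [Fintype.sum_eq_single (x 0)]
        · rw [hQ0, if_pos rfl, hcst x]
          simp
        · intro v hv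
          rw [hQ0, if_neg hv, zero_mul, zero_mul]

/-- Collapse step of the marginal identity (`τ 0 = 0`, `L + 1 + 1` observations): the observation
vector is `Fin.cons (y 0)` of the observations at `τ ∘ succ` (to which the identity with `L + 1`
observations applies), and on the other side the first kernel `Q 0 = [· = ·]` collapses the sum over
the first coordinate.
[cite: HuangSellke2025, §3.3.2 (Lemma 3.22, resampling-chain bookkeeping of the in-tree proof)] -/
theorem mtm_collapse (P : V → V → ℝ) (Q : ℕ → V → V → ℝ)
    (hQ0 : ∀ u v, Q 0 u v = if u = v then 1 else 0) (L : ℕ)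
    (ih : ∀ (s K : ℕ) (τ : Fin (L + 1) → ℕ), Monotone τ → τ 0 = s → ∀ (hK : ∀ ℓ, τ ℓ < K + 1)
      (Φ : V → (Fin (L + 1) → V) → ℝ),
      ∑ y : Fin (K + 1) → V, (∏ t : Fin K, P (y t.castSucc) (y t.succ)) *
          Φ (y 0) (fun ℓ => y ⟨τ ℓ, hK ℓ⟩) =
        ∑ v, ∑ x : Fin (L + 1) → V, Q s v (x 0) *
          (∏ ℓ : Fin L, Q (τ ℓ.succ - τ ℓ.castSucc) (x ℓ.castSucc) (x ℓ.succ)) * Φ v x)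
    (K : ℕ) (τ : Fin (L + 1 + 1) → ℕ) (hτ : Monotone τ) (h0 : τ 0 = 0)
    (hK : ∀ ℓ, τ ℓ < K + 1) (Φ : V → (Fin (L + 1 + 1) → V) → ℝ) :
    ∑ y : Fin (K + 1) → V, (∏ t : Fin K, P (y t.castSucc) (y t.succ)) *
        Φ (y 0) (fun ℓ => y ⟨τ ℓ, hK ℓ⟩) =
      ∑ v, ∑ x : Fin (L + 1 + 1) → V, Q 0 v (x 0) *
        (∏ ℓ : Fin (L + 1), Q (τ ℓ.succ - τ ℓ.castSucc) (x ℓ.castSucc) (x ℓ.succ)) * Φ v x := by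
  have hτ' : Monotone (fun ℓ : Fin (L + 1) => τ ℓ.succ) := fun a b hab =>
    hτ (Fin.succ_le_succ_iff.mpr hab)
  calc ∑ y : Fin (K + 1) → V, (∏ t : Fin K, P (y t.castSucc) (y t.succ)) *
        Φ (y 0) (fun ℓ => y ⟨τ ℓ, hK ℓ⟩)
      = ∑ y : Fin (K + 1) → V, (∏ t : Fin K, P (y t.castSucc) (y t.succ)) *
          Φ (y 0) (Fin.cons (y 0) (fun ℓ : Fin (L + 1) => y ⟨τ ℓ.succ, hK ℓ.succ⟩)) :=
        Finset.sum_congr rfl fun y _ => by rw [mtm_obs_cons τ h0 hK y]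
    _ = ∑ v, ∑ x : Fin (L + 1) → V, Q (τ (Fin.succ 0)) v (x 0) *
          (∏ ℓ : Fin L, Q (τ ℓ.succ.succ - τ ℓ.castSucc.succ) (x ℓ.castSucc) (x ℓ.succ)) *
            Φ v (Fin.cons v x) :=
        ih (τ (Fin.succ 0)) K (fun ℓ => τ ℓ.succ) hτ' rfl (fun ℓ => hK ℓ.succ)
          (fun v x => Φ v (Fin.cons v x))
    _ = _ := by
        refine Finset.sum_congr rfl fun v _ => ?_
        symm
        rw [ctb_sum_cons (L + 1), Fintype.sum_eq_single v]
        · refine Finset.sum_congr rfl fun x _ => ?_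
          rw [Fin.cons_zero, hQ0, if_pos rfl, one_mul, mtm_gapProd_cons Q L τ v x, h0,
            Nat.sub_zero]
        · intro u hu
          exact Finset.sum_eq_zero fun x _ => by
            rw [Fin.cons_zero, hQ0, if_neg (Ne.symm hu), zero_mul, zero_mul]

omit [DecidableEq V] in
/-- Shift step of the marginal identity (`τ 0 = s + 1`): peel the first step of the path,
`y = Fin.cons v z` (`ctb_sum_cons`, `ctb_weight_cons`); the observations of `y` at `τ` are those of
`z` at `τ − 1`, the factor `P v (z 0)` is absorbed into the functional, the identity with `τ 0 = s`
applies, and `Σ_u P v u · Q s u (x 0) = Q (s+1) v (x 0)` reassembles the first kernel.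
[cite: HuangSellke2025, §3.3.2 (Lemma 3.22, resampling-chain bookkeeping of the in-tree proof)] -/
theorem mtm_shift (P : V → V → ℝ) (Q : ℕ → V → V → ℝ)
    (hQs : ∀ Δ u v, Q (Δ + 1) u v = ∑ w, P u w * Q Δ w v) (L s : ℕ)
    (ih : ∀ (K : ℕ) (τ : Fin (L + 1) → ℕ), Monotone τ → τ 0 = s → ∀ (hK : ∀ ℓ, τ ℓ < K + 1)
      (Φ : V → (Fin (L + 1) → V) → ℝ),
      ∑ y : Fin (K + 1) → V, (∏ t : Fin K, P (y t.castSucc) (y t.succ)) *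
          Φ (y 0) (fun ℓ => y ⟨τ ℓ, hK ℓ⟩) =
        ∑ v, ∑ x : Fin (L + 1) → V, Q s v (x 0) *
          (∏ ℓ : Fin L, Q (τ ℓ.succ - τ ℓ.castSucc) (x ℓ.castSucc) (x ℓ.succ)) * Φ v x)
    (K : ℕ) (τ : Fin (L + 1) → ℕ) (hτ : Monotone τ) (h0 : τ 0 = s + 1)
    (hK : ∀ ℓ, τ ℓ < K + 1) (Φ : V → (Fin (L + 1) → V) → ℝ) :
    ∑ y : Fin (K + 1) → V, (∏ t : Fin K, P (y t.castSucc) (y t.succ)) *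
        Φ (y 0) (fun ℓ => y ⟨τ ℓ, hK ℓ⟩) =
      ∑ v, ∑ x : Fin (L + 1) → V, Q (s + 1) v (x 0) *
        (∏ ℓ : Fin L, Q (τ ℓ.succ - τ ℓ.castSucc) (x ℓ.castSucc) (x ℓ.succ)) * Φ v x := by
  have h1 : ∀ ℓ, 1 ≤ τ ℓ := fun ℓ => le_trans (by omega) (hτ (Fin.zero_le ℓ))
  obtain ⟨K', rfl⟩ : ∃ K', K = K' + 1 := ⟨K - 1, by have := hK 0; omega⟩
  have hK' : ∀ ℓ, τ ℓ - 1 < K' + 1 := fun ℓ => by have := hK ℓ; omega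
  have hτ' : Monotone (fun ℓ => τ ℓ - 1) := fun a b hab => Nat.sub_le_sub_right (hτ hab) 1
  have h0' : τ 0 - 1 = s := by omega
  have hgap : ∀ ℓ : Fin L, τ ℓ.succ - 1 - (τ ℓ.castSucc - 1) = τ ℓ.succ - τ ℓ.castSucc :=
    fun ℓ => by have := h1 ℓ.castSucc; omega
  calc ∑ y : Fin (K' + 1 + 1) → V, (∏ t : Fin (K' + 1), P (y t.castSucc) (y t.succ)) *
        Φ (y 0) (fun ℓ => y ⟨τ ℓ, hK ℓ⟩)
      = ∑ v, ∑ z : Fin (K' + 1) → V, (∏ t : Fin K', P (z t.castSucc) (z t.succ)) *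
          (P v (z 0) * Φ v (fun ℓ => z ⟨τ ℓ - 1, hK' ℓ⟩)) := by
        rw [ctb_sum_cons (K' + 1)]
        simp only [ctb_weight_cons, Fin.cons_zero]
        refine Finset.sum_congr rfl fun v _ => Finset.sum_congr rfl fun z _ => ?_
        rw [mtm_obs_shift τ h1 hK hK' v z]
        ring
    _ = ∑ v, ∑ u, ∑ x : Fin (L + 1) → V, Q s u (x 0) *
          (∏ ℓ : Fin L, Q (τ ℓ.succ - 1 - (τ ℓ.castSucc - 1)) (x ℓ.castSucc) (x ℓ.succ)) *
            (P v u * Φ v x) :=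
        Finset.sum_congr rfl fun v _ =>
          ih K' (fun ℓ => τ ℓ - 1) hτ' h0' hK' (fun u x => P v u * Φ v x)
    _ = _ := by
        refine Finset.sum_congr rfl fun v _ => ?_
        rw [Finset.sum_comm]
        refine Finset.sum_congr rfl fun x _ => ?_
        rw [hQs, Finset.sum_mul, Finset.sum_mul]
        refine Finset.sum_congr rfl fun u _ => ?_
        simp only [hgap]
        ring

/-- **The abstract multi-time marginal identity** (Markov property of the path sums). For a
row-stochastic kernel `P` and multi-step kernels `Q` with `Q 0 = [· = ·]`,
`Q (Δ+1) u v = Σ_w P u w · Q Δ w v`: for monotone times `τ 0 ≤ ⋯ ≤ τ L ≤ K` and any functional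
`Φ` of the starting point and of the observations at the times `τ`,
`Σ_y (∏_{t<K} P (y t) (y (t+1))) · Φ (y 0) (ℓ ↦ y (τ ℓ))
  = Σ_v Σ_x Q (τ 0) v (x 0) · (∏_{ℓ<L} Q (τ(ℓ+1) − τ ℓ) (x ℓ) (x (ℓ+1))) · Φ v x`.
Induction on `L`, then on `s = τ 0` (`mtm_base`, `mtm_collapse`, `mtm_shift`).
[cite: HuangSellke2025, §3.3.2 (Lemma 3.22, resampling-chain bookkeeping of the in-tree proof)] -/
theorem mtm_marginal_abs (P : V → V → ℝ) (hP1 : ∀ u, ∑ v, P u v = 1) (Q : ℕ → V → V → ℝ)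
    (hQ0 : ∀ u v, Q 0 u v = if u = v then 1 else 0)
    (hQs : ∀ Δ u v, Q (Δ + 1) u v = ∑ w, P u w * Q Δ w v) :
    ∀ (L s K : ℕ) (τ : Fin (L + 1) → ℕ), Monotone τ → τ 0 = s → ∀ (hK : ∀ ℓ, τ ℓ < K + 1)
      (Φ : V → (Fin (L + 1) → V) → ℝ),
      ∑ y : Fin (K + 1) → V, (∏ t : Fin K, P (y t.castSucc) (y t.succ)) *
          Φ (y 0) (fun ℓ => y ⟨τ ℓ, hK ℓ⟩) =
        ∑ v, ∑ x : Fin (L + 1) → V, Q s v (x 0) *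
          (∏ ℓ : Fin L, Q (τ ℓ.succ - τ ℓ.castSucc) (x ℓ.castSucc) (x ℓ.succ)) * Φ v x := by
  intro L
  induction L with
  | zero =>
    intro s
    induction s with
    | zero => exact fun K τ _ h0 hK Φ => mtm_base P hP1 Q hQ0 K τ h0 hK Φ
    | succ s ih => exact mtm_shift P Q hQs 0 s ih
  | succ L ihL =>
    intro s
    induction s with
    | zero => exact fun K τ hτ h0 hK Φ => mtm_collapse P Q hQ0 L ihL K τ hτ h0 hK Φ
    | succ s ih => exact mtm_shift P Q hQs (L + 1) s ih

end AbstractKernel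

/-- **Finite-dimensional marginals of the resampling chain** (Markov property + the closed-form
`Δ`-step kernel `P_{1−(1−ε)^Δ}` + stationarity of the uniform start; the bookkeeping behind the
first moment of Huang–Sellke 2025, Lemma 3.22): for `0 ≤ ε ≤ 1` and times
`τ 0 ≤ τ 1 ≤ ⋯ ≤ τ L ≤ K`, the
mass of an event reading the path only at the times `τ ℓ` is at most (in fact equals) the explicit
`(L+1)`-fold sum `(Σ_x ∏_{ℓ<L} P_{1−(1−ε)^{τ(ℓ+1)−τ ℓ}}(x ℓ, x (ℓ+1)) · [E x]) / #(ι → Γ)`.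
[cite: HuangSellke2025, §3.3.2 (Lemma 3.22, resampling-chain bookkeeping of the in-tree proof)] -/
theorem stub_multiTimeMarginal {ι Γ : Type} [Fintype ι] [DecidableEq ι] [Fintype Γ] [DecidableEq Γ]
    [Nonempty Γ] (ε : ℝ) (hε0 : 0 ≤ ε) (hε1 : ε ≤ 1) (K L : ℕ) (τ : Fin (L + 1) → ℕ)
    (hτ : Monotone τ) (hτK : τ (Fin.last L) ≤ K) (E : (Fin (L + 1) → ι → Γ) → Prop) :
    resampleChainMass ε K (fun z => E (fun ℓ => z (τ ℓ))) ≤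
      (∑ x : Fin (L + 1) → ι → Γ,
        (∏ ℓ : Fin L, resampleKernel (1 - (1 - ε) ^ (τ ℓ.succ - τ ℓ.castSucc))
            (x ℓ.castSucc) (x ℓ.succ)) * (if E x then (1 : ℝ) else 0)) / Fintype.card (ι → Γ) := by
  have hB := stub_resampleKernelBasic (ι := ι) (Γ := Γ) ε hε0 hε1
  have hP1 : ∀ u : ι → Γ, ∑ v, resampleKernel ε u v = 1 := hB.2.2
  have hP2 : ∀ v : ι → Γ, ∑ u, resampleKernel ε u v = 1 := fun v =>
    calc ∑ u, resampleKernel ε u v = ∑ u, resampleKernel ε v u :=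
          Finset.sum_congr rfl fun u _ => hB.2.1 u v
      _ = 1 := hB.2.2 v
  have hQ0 : ∀ u v : ι → Γ, resampleKernel (1 - (1 - ε) ^ 0) u v = if u = v then 1 else 0 :=
    fun u v => by rw [pow_zero, sub_self, kpp_resampleKernel_zero]
  have hQs : ∀ (Δ : ℕ) (u v : ι → Γ), resampleKernel (1 - (1 - ε) ^ (Δ + 1)) u v =
      ∑ w, resampleKernel ε u w * resampleKernel (1 - (1 - ε) ^ Δ) w v := fun Δ u v => by
    rw [stub_kernelSemigroup, sub_sub_cancel, pow_succ']
  have hτℓ : ∀ ℓ, τ ℓ ≤ K := fun ℓ => (hτ (Fin.le_last ℓ)).trans hτK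
  have hKℓ : ∀ ℓ, τ ℓ < K + 1 := fun ℓ => Nat.lt_succ_of_le (hτℓ ℓ)
  have hcol : ∀ u : ι → Γ, ∑ v, resampleKernel (1 - (1 - ε) ^ τ 0) v u = 1 :=
    mtm_colsum (resampleKernel ε) hP2 (fun Δ => resampleKernel (1 - (1 - ε) ^ Δ)) hQ0 hQs (τ 0)
  have key := mtm_marginal_abs (resampleKernel ε) hP1 (fun Δ => resampleKernel (1 - (1 - ε) ^ Δ))
    hQ0 hQs L (τ 0) K τ hτ rfl hKℓ (fun _ x => if E x then (1 : ℝ) else 0)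
  unfold resampleChainMass
  refine div_le_div_of_nonneg_right (le_of_eq ?_) (Nat.cast_nonneg _)
  calc ∑ y : Fin (K + 1) → ι → Γ, (∏ t : Fin K, resampleKernel ε (y t.castSucc) (y t.succ)) *
        (if E (fun ℓ => y ⟨min (τ ℓ) K, Nat.lt_succ_of_le (Nat.min_le_right (τ ℓ) K)⟩)
          then (1 : ℝ) else 0)
      = ∑ y : Fin (K + 1) → ι → Γ, (∏ t : Fin K, resampleKernel ε (y t.castSucc) (y t.succ)) *
          (if E (fun ℓ => y ⟨τ ℓ, hKℓ ℓ⟩) then (1 : ℝ) else 0) :=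
        Finset.sum_congr rfl fun y _ => congrArg _ (cmb_ite_congr (Iff.of_eq (congrArg E
          (funext fun ℓ => congrArg y (Fin.ext (min_eq_left (hτℓ ℓ)))))))
    _ = ∑ v, ∑ x : Fin (L + 1) → ι → Γ, resampleKernel (1 - (1 - ε) ^ τ 0) v (x 0) *
          (∏ ℓ : Fin L, resampleKernel (1 - (1 - ε) ^ (τ ℓ.succ - τ ℓ.castSucc))
            (x ℓ.castSucc) (x ℓ.succ)) * (if E x then (1 : ℝ) else 0) := key
    _ = ∑ x : Fin (L + 1) → ι → Γ,
          (∏ ℓ : Fin L, resampleKernel (1 - (1 - ε) ^ (τ ℓ.succ - τ ℓ.castSucc))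
            (x ℓ.castSucc) (x ℓ.succ)) * (if E x then (1 : ℝ) else 0) := by
        rw [Finset.sum_comm]
        refine Finset.sum_congr rfl fun x _ => ?_
        rw [← Finset.sum_mul, ← Finset.sum_mul, hcol (x 0), one_mul]

end Literature.Computability.Complexity.HuangSellke2025Chain

end Part9

/-!
## Part 10 — port of `Summits/PneNP/PneNP/Theorems/OverlapGapAlgebraSearchHardWindowSlotFactorization.lean` (4 declarations kept)

# Route OverlapGapAlgebra, crux `SearchHardWindow` : slot factorization of the
# multi-time weight of the resampling chain

Step F of the first moment for the ensemble OGP (Huang–Sellke 2025, Lemma 3.22) in line `Sketch`.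
After the finite-dimensional marginal, the survival weight of a tuple is an explicit `(L+1)`-fold sum
over arrays `x : Fin (L+1) → A × B → Γ` (clause slots `A` × positions `B`, alphabet `Γ`), weighted
by `∏_ℓ P_{δ ℓ}(x ℓ, x (ℓ+1))` (`resampleKernel` of
`Literature/Computability/Complexity/RandomKSatEnsembleOGP.lean`), of the indicator of a CONJUNCTION
over the slots `a : A` of per-slot events `E a` reading only the slot `fun ℓ b => x ℓ (a, b)`.
`stub_slotFactorization`: this weighted count is the PRODUCT over the slots of the per-slot weighted
counts. Pure finite algebra:
* `sfz_kernel_slot`: the kernel on `A × B → Γ` is a product of one factor per coordinate, hence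
  (`Fintype.prod_prod_type`) the product over `a` of the kernels of the slots `fun b => y (a, b)`;
* `sfz_weight_slot`: so is the path weight (`Finset.prod_comm`);
* `sfz_ite_forall_eq_prod`: the indicator of `∀ a, p a` is `∏ a, [p a]`;
* the summand is therefore `∏ a, G a (slot a of x)`; reindexing the sum along the equivalence
  `(Fin (L+1) → A × B → Γ) ≃ (A → Fin (L+1) → B → Γ)` (`Fintype.sum_equiv`) and
  `∏ a, ∑ w, G a w = ∑ y, ∏ a, G a (y a)` (`Fintype.prod_sum`) finish.

(Verbatim declaration-level port — the declarations listed in the Part header count — of the Summits-side module of the PneNP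
tree (route OverlapGapAlgebra, crux SearchHardWindow / NoStableSection); route / stub / lead bookkeeping in the text above is historical.)
-/

section Part10

namespace Literature.Computability.Complexity.HuangSellke2025Chain

open _root_.Finset
open Literature.Computability.Complexity
open scoped _root_.Classical

/-- The `ε`-resampling kernel on the product index set `A × B` factors over the slots `a : A` into
the kernels of the rows `fun b => y (a, b)`.
[cite: HuangSellke2025, §3.3.2 (Lemma 3.22, resampling-chain bookkeeping of the in-tree proof)] -/
theorem sfz_kernel_slot {A B Γ : Type} [Fintype A] [Fintype B] [Fintype Γ] [DecidableEq Γ]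
    (ε : ℝ) (y y' : A × B → Γ) :
    resampleKernel ε y y' =
      ∏ a : A, resampleKernel ε (fun b => y (a, b)) (fun b => y' (a, b)) := by
  unfold resampleKernel
  exact Fintype.prod_prod_type _

/-- The weight of a path of arrays indexed by `A × B` is the product over the slots `a : A` of the
weights of its rows.
[cite: HuangSellke2025, §3.3.2 (Lemma 3.22, resampling-chain bookkeeping of the in-tree proof)] -/
theorem sfz_weight_slot {A B Γ : Type} [Fintype A] [Fintype B] [Fintype Γ] [DecidableEq Γ]
    (L : ℕ) (δ : Fin L → ℝ) (x : Fin (L + 1) → A × B → Γ) :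
    ∏ ℓ : Fin L, resampleKernel (δ ℓ) (x ℓ.castSucc) (x ℓ.succ) =
      ∏ a : A, ∏ ℓ : Fin L,
        resampleKernel (δ ℓ) (fun b => x ℓ.castSucc (a, b)) (fun b => x ℓ.succ (a, b)) := by
  rw [Finset.prod_comm]
  exact Finset.prod_congr rfl fun ℓ _ => sfz_kernel_slot (δ ℓ) (x ℓ.castSucc) (x ℓ.succ)

/-- The indicator of a finite conjunction is the product of the indicators (any `Decidable`
instances). [cite: HuangSellke2025, §3.3.2 (Lemma 3.22, resampling-chain bookkeeping of the in-tree proof)] -/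
theorem sfz_ite_forall_eq_prod {A : Type} [Fintype A] (p : A → Prop) {hp : DecidablePred p}
    {hq : Decidable (∀ a, p a)} :
    (if ∀ a, p a then (1 : ℝ) else 0) = ∏ a, if p a then (1 : ℝ) else 0 := by
  by_cases h : ∀ a, p a
  · rw [if_pos h]
    exact (Finset.prod_eq_one fun a _ => if_pos (h a)).symm
  · rw [if_neg h]
    push Not at h
    obtain ⟨a, ha⟩ := h
    exact (Finset.prod_eq_zero (Finset.mem_univ a) (if_neg ha)).symm

/-- STUB F — **slot factorization**: the weighted count, over paths `x : Fin (L+1) → A × B → Γ` of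
the resampling chain with step parameters `δ ℓ`, of the conjunction over the slots `a : A` of events
`E a` reading only the slot `fun ℓ b => x ℓ (a, b)`, equals the product over `a` of the per-slot
weighted counts. [cite: HuangSellke2025, §3.3.2 (Lemma 3.22, resampling-chain bookkeeping of the in-tree proof)] -/
theorem stub_slotFactorization {A B Γ : Type} [Fintype A] [DecidableEq A] [Fintype B] [DecidableEq B]
    [Fintype Γ] [DecidableEq Γ] (L : ℕ) (δ : Fin L → ℝ) (E : A → (Fin (L + 1) → B → Γ) → Prop) :
    (∑ x : Fin (L + 1) → A × B → Γ,
        (∏ ℓ : Fin L, resampleKernel (δ ℓ) (x ℓ.castSucc) (x ℓ.succ)) *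
          (if ∀ a, E a (fun ℓ b => x ℓ (a, b)) then (1 : ℝ) else 0)) =
      ∏ a : A, ∑ w : Fin (L + 1) → B → Γ,
        (∏ ℓ : Fin L, resampleKernel (δ ℓ) (w ℓ.castSucc) (w ℓ.succ)) *
          (if E a w then (1 : ℝ) else 0) := by
  rw [Fintype.prod_sum]
  refine Fintype.sum_equiv
    ⟨fun x a ℓ b => x ℓ (a, b), fun y ℓ p => y p.1 ℓ p.2, fun x => rfl, fun y => rfl⟩ _ _
    (fun x => ?_)
  simp only [Equiv.coe_fn_mk]
  rw [Finset.prod_mul_distrib, sfz_weight_slot L δ x]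
  congr 1
  exact sfz_ite_forall_eq_prod _

end Literature.Computability.Complexity.HuangSellke2025Chain

end Part10

/-!
## Part 11 — port of `Summits/PneNP/PneNP/Theorems/OverlapGapAlgebraSearchHardWindowBlockExpansion.lean` (14 declarations kept)

# Route OverlapGapAlgebra, crux `SearchHardWindow` : refresh expansion / block
# structure of one slot of the resampling chain

For one clause slot (positions `B`, alphabet `Γ`, times `Fin (L+1)`) of the `ε`-resampling chain of
literal arrays (Huang–Sellke 2025 §3.3.2) the multi-time weight of a version array
`w : Fin (L+1) → B → Γ` is `∏_ℓ P_{δ ℓ}(w ℓ, w (ℓ+1))` with the resampling kernel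
`P_δ(y, y') = ∏_b ((1 − δ)·[y b = y' b] + δ/|Γ|)` (`resampleKernel` of
`Literature/Computability/Complexity/RandomKSatEnsembleOGP.lean`); it is not normalised (the
time-`0` value is free, total weight `#(B → Γ)`).

`stub_blockExpansion`: for `g ≥ 0`, the weighted sum `Σ_w weight(w) · g w` is at most `M · #(B → Γ)`
as soon as for EVERY admissible block-root map `ρ : B → Fin (L+1) → Fin (L+1)` (`ρ b ℓ ≤ ℓ`, and
`ρ b` constant on `[ρ b ℓ, ℓ]`) the plain sum of `g` over the expanded free arrays
`fun ℓ b => u (ρ b ℓ) b`, `u : Fin (L+1) → B → Γ`, is at most `M · #(Fin (L+1) → B → Γ)`.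

Proof: induction on `L`, peeling the LAST step `w = Fin.snoc w' v` (`bex_sum_snoc`,
`bex_weight_snoc`). The last kernel is a mixture: writing each coordinate factor as
`(1 − ε)[y b = v b] + ε/|Γ| = |Γ|⁻¹ Σ_{x : Γ} Σ_{β : Bool} q β · [v b = (β ? y b : x)]` with
`q true = 1 − ε`, `q false = ε` (`bex_coord_mixture`) and distributing (`Fintype.prod_sum` twice),
`P_ε(y, v) = |Γ|^{-|B|} Σ_{v'} Σ_{s : B → Bool} p_s [v = mix_s y v']`, `p_s = ∏_b q (s b)`,
`mix_s y v' b = (s b ? y b : v' b)` (`bex_kernel_pointwise`), whence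
`Σ_v P_ε(y, v) h v = Σ_s p_s · |Γ|^{-|B|} Σ_{v'} h (mix_s y v')` (`bex_kernel_mixture`) and
`Σ_s p_s = 1` (`bex_pattern_sum`). So the weighted sum at length `L + 1` is the `p_s`-average of the
weighted sums at length `L` of the functionals
`g_s w' = |Γ|^{-|B|} Σ_{v'} g (snoc w' (mix_s (w' L) v'))`, and the induction hypothesis (with the
same `M`) applies to each `g_s`: for an admissible `ρ'` on `Fin (L+1)` the map `ρ` extending it by
`ρ b (L+1) = (s b ? ρ' b L : L+1)` is admissible (`bex_extend_admissible`) and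
`expand_ρ (snoc u' v') = snoc (expand_{ρ'} u') (mix_s (expand_{ρ'} u' L) v')` (`bex_extend_expand`),
so `Σ_{u'} g_s (expand_{ρ'} u') = |Γ|^{-|B|} Σ_u g (expand_ρ u) ≤ |Γ|^{-|B|} M #(Fin (L+2) → B → Γ)`
by the hypothesis at length `L + 1`, and finally `Σ_s p_s · M #(B → Γ) = M #(B → Γ)`.

(Verbatim declaration-level port — the declarations listed in the Part header count — of the Summits-side module of the PneNP
tree (route OverlapGapAlgebra, crux SearchHardWindow / NoStableSection); route / stub / lead bookkeeping in the text above is historical.)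
-/

section Part11

namespace Literature.Computability.Complexity.HuangSellke2025Chain

open _root_.Finset
open Literature.Computability.Complexity
open scoped _root_.Classical

section General

variable {X : Type*} [Fintype X]

/-- Reindex a sum over paths of length `n + 1` by (initial path, last point):
`w = Fin.snoc w' v`.
[cite: HuangSellke2025, §3.3.2 (Lemma 3.22, resampling-chain bookkeeping of the in-tree proof)] -/
theorem bex_sum_snoc (n : ℕ) (Φ : (Fin (n + 1) → X) → ℝ) :
    ∑ w : Fin (n + 1) → X, Φ w = ∑ w' : Fin n → X, ∑ v : X, Φ (Fin.snoc w' v) := by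
  rw [← (Fin.snocEquiv fun _ : Fin (n + 1) => X).sum_comp, Fintype.sum_prod_type, Finset.sum_comm]
  rfl

/-- Pushforward of a mixture of point masses: if `K v = Σ_a Σ_s c a s · [v = φ a s]` then
`Σ_v K v · h v = Σ_a Σ_s c a s · h (φ a s)`.
[cite: HuangSellke2025, §3.3.2 (Lemma 3.22, resampling-chain bookkeeping of the in-tree proof)] -/
theorem bex_pushforward {V A S : Type*} [Fintype V] [DecidableEq V] [Fintype A] [Fintype S]
    (K : V → ℝ) (c : A → S → ℝ) (φ : A → S → V)
    (hK : ∀ v, K v = ∑ a, ∑ s, c a s * (if v = φ a s then (1 : ℝ) else 0)) (h : V → ℝ) :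
    ∑ v, K v * h v = ∑ a, ∑ s, c a s * h (φ a s) := by
  have step : ∀ a s, ∑ v, (c a s * (if v = φ a s then (1 : ℝ) else 0)) * h v =
      c a s * h (φ a s) := by
    intro a s
    rw [Finset.sum_eq_single (φ a s)]
    · simp
    · intro v _ hv
      simp [hv]
    · intro h'
      exact absurd (Finset.mem_univ _) h'
  calc ∑ v, K v * h v
      = ∑ v, ∑ a, ∑ s, (c a s * (if v = φ a s then (1 : ℝ) else 0)) * h v := by
        refine Finset.sum_congr rfl fun v _ => ?_
        rw [hK v, Finset.sum_mul]
        exact Finset.sum_congr rfl fun a _ => Finset.sum_mul _ _ _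
    _ = ∑ a, ∑ v, ∑ s, (c a s * (if v = φ a s then (1 : ℝ) else 0)) * h v := Finset.sum_comm
    _ = ∑ a, ∑ s, ∑ v, (c a s * (if v = φ a s then (1 : ℝ) else 0)) * h v :=
        Finset.sum_congr rfl fun a _ => Finset.sum_comm
    _ = ∑ a, ∑ s, c a s * h (φ a s) :=
        Finset.sum_congr rfl fun a _ => Finset.sum_congr rfl fun s _ => step a s

/-- Rearrangement `Σ_w a w · Σ_s p s · F s w = Σ_s p s · Σ_w a w · F s w`.
[cite: HuangSellke2025, §3.3.2 (Lemma 3.22, resampling-chain bookkeeping of the in-tree proof)] -/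
theorem bex_rearrange {W S : Type*} [Fintype W] [Fintype S] (a : W → ℝ) (p : S → ℝ)
    (F : S → W → ℝ) :
    ∑ w, a w * ∑ s, p s * F s w = ∑ s, p s * ∑ w, a w * F s w := by
  simp_rw [Finset.mul_sum]
  rw [Finset.sum_comm]
  exact Finset.sum_congr rfl fun s _ => Finset.sum_congr rfl fun w _ => by ring

end General

section Slot

variable {B Γ : Type*} [Fintype B] [Fintype Γ]

/-- The path weight of `Fin.snoc w' v` factors as the weight of `w'` times the last step.
[cite: HuangSellke2025, §3.3.2 (Lemma 3.22, resampling-chain bookkeeping of the in-tree proof)] -/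
theorem bex_weight_snoc [DecidableEq Γ] {L : ℕ} (δ : Fin (L + 1) → ℝ) (w' : Fin (L + 1) → B → Γ)
    (v : B → Γ) :
    ∏ ℓ : Fin (L + 1), resampleKernel (δ ℓ)
        ((Fin.snoc w' v : Fin (L + 1 + 1) → B → Γ) ℓ.castSucc)
        ((Fin.snoc w' v : Fin (L + 1 + 1) → B → Γ) ℓ.succ) =
      (∏ ℓ : Fin L, resampleKernel (δ ℓ.castSucc) (w' ℓ.castSucc) (w' ℓ.succ)) *
        resampleKernel (δ (Fin.last L)) (w' (Fin.last L)) v := by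
  rw [Fin.prod_univ_castSucc]
  simp only [Fin.snoc_castSucc, Fin.succ_castSucc, Fin.succ_last, Fin.snoc_last]

/-- Number of arrays one step longer: `#(Fin (n+1) → B → Γ) = #(Fin n → B → Γ) · |Γ|^|B|`.
[cite: HuangSellke2025, §3.3.2 (Lemma 3.22, resampling-chain bookkeeping of the in-tree proof)] -/
theorem bex_card_succ [DecidableEq B] (n : ℕ) :
    (Fintype.card (Fin (n + 1) → B → Γ) : ℝ) =
      Fintype.card (Fin n → B → Γ) * (Fintype.card Γ : ℝ) ^ Fintype.card B := by
  simp only [Fintype.card_fun, Fintype.card_fin, pow_succ, Nat.cast_mul, Nat.cast_pow]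

variable [DecidableEq B] [DecidableEq Γ] [Nonempty Γ]

/-- One coordinate of the resampling kernel as a uniform mixture over (fresh letter, keep bit):
`(1 − ε)[a = c] + ε/|Γ| = |Γ|⁻¹ Σ_x Σ_β q β · [c = (β ? a : x)]`.
[cite: HuangSellke2025, §3.3.2 (Lemma 3.22, resampling-chain bookkeeping of the in-tree proof)] -/
theorem bex_coord_mixture (ε : ℝ) (a c : Γ) :
    (1 - ε) * (if a = c then (1 : ℝ) else 0) + ε / Fintype.card Γ =
      (Fintype.card Γ : ℝ)⁻¹ * ∑ x : Γ, ∑ β : Bool,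
        (if β then 1 - ε else ε) * (if c = (if β then a else x) then (1 : ℝ) else 0) := by
  have hcard : (Fintype.card Γ : ℝ) ≠ 0 := Nat.cast_ne_zero.mpr Fintype.card_ne_zero
  have hsum : ∑ x : Γ, ∑ β : Bool,
      (if β then 1 - ε else ε) * (if c = (if β then a else x) then (1 : ℝ) else 0) =
      ∑ x : Γ, ((1 - ε) * (if a = c then (1 : ℝ) else 0) + ε * (if c = x then (1 : ℝ) else 0)) := by
    refine Finset.sum_congr rfl fun x _ => ?_
    rw [Fintype.sum_bool]
    simp only [Bool.false_eq_true, if_true, if_false, eq_comm]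
  rw [hsum, Finset.sum_add_distrib, Finset.sum_const, Finset.card_univ, nsmul_eq_mul,
    ← Finset.mul_sum, Finset.sum_ite_eq, if_pos (Finset.mem_univ _)]
  field_simp

/-- The resampling kernel as a mixture of point masses:
`P_ε(y, v) = |Γ|^{-|B|} Σ_{v'} Σ_{s : B → Bool} p_s · [v = mix_s y v']`.
[cite: HuangSellke2025, §3.3.2 (Lemma 3.22, resampling-chain bookkeeping of the in-tree proof)] -/
theorem bex_kernel_pointwise (ε : ℝ) (y v : B → Γ) :
    resampleKernel ε y v = ((Fintype.card Γ : ℝ) ^ Fintype.card B)⁻¹ *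
      ∑ v' : B → Γ, ∑ s : B → Bool, (∏ b, (if s b then 1 - ε else ε)) *
        (if v = (fun b => if s b then y b else v' b) then (1 : ℝ) else 0) := by
  unfold resampleKernel
  rw [Finset.prod_congr rfl fun b _ => bex_coord_mixture ε (y b) (v b), Finset.prod_mul_distrib,
    Finset.prod_const, Finset.card_univ, inv_pow]
  congr 1
  rw [Fintype.prod_sum]
  refine Finset.sum_congr rfl fun v' _ => ?_
  rw [Fintype.prod_sum]
  refine Finset.sum_congr rfl fun s _ => ?_
  rw [Finset.prod_mul_distrib, Fintype.prod_boole]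
  congr 1
  exact if_congr funext_iff.symm rfl rfl

/-- The last step as a mixture: `Σ_v P_ε(y, v) h v = Σ_s p_s · |Γ|^{-|B|} Σ_{v'} h (mix_s y v')`.
[cite: HuangSellke2025, §3.3.2 (Lemma 3.22, resampling-chain bookkeeping of the in-tree proof)] -/
theorem bex_kernel_mixture (ε : ℝ) (y : B → Γ) (h : (B → Γ) → ℝ) :
    ∑ v : B → Γ, resampleKernel ε y v * h v =
      ∑ s : B → Bool, (∏ b, (if s b then 1 - ε else ε)) *
        (((Fintype.card Γ : ℝ) ^ Fintype.card B)⁻¹ *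
          ∑ v' : B → Γ, h (fun b => if s b then y b else v' b)) := by
  have hK : ∀ v : B → Γ, resampleKernel ε y v = ∑ v' : B → Γ, ∑ s : B → Bool,
      (((Fintype.card Γ : ℝ) ^ Fintype.card B)⁻¹ * ∏ b, (if s b then 1 - ε else ε)) *
        (if v = (fun b => if s b then y b else v' b) then (1 : ℝ) else 0) := by
    intro v
    rw [bex_kernel_pointwise, Finset.mul_sum]
    refine Finset.sum_congr rfl fun v' _ => ?_
    rw [Finset.mul_sum]
    exact Finset.sum_congr rfl fun s _ => by ring
  rw [bex_pushforward (resampleKernel ε y)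
    (fun (_ : B → Γ) (s : B → Bool) =>
      ((Fintype.card Γ : ℝ) ^ Fintype.card B)⁻¹ * ∏ b, (if s b then 1 - ε else ε))
    (fun v' s => fun b => if s b then y b else v' b) hK h, Finset.sum_comm]
  refine Finset.sum_congr rfl fun s _ => ?_
  rw [Finset.mul_sum, Finset.mul_sum]
  exact Finset.sum_congr rfl fun v' _ => by ring

/-- The mixture weights sum to one: `Σ_{s : B → Bool} ∏_b q (s b) = ∏_b ((1 − ε) + ε) = 1`.
[cite: HuangSellke2025, §3.3.2 (Lemma 3.22, resampling-chain bookkeeping of the in-tree proof)] -/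
theorem bex_pattern_sum (ε : ℝ) : ∑ s : B → Bool, ∏ b, (if s b then 1 - ε else ε) = 1 := by
  rw [← Fintype.prod_sum fun (_ : B) (β : Bool) => if β then 1 - ε else ε]
  simp

end Slot

section Roots

variable {B Γ : Type*} {L : ℕ}

/-- The extension `ρ` of an admissible root map `ρ'` on `Fin (L+1)` by a last step with keep set
`s` (`ρ b (L+1) = ρ' b L` if `s b`, else `L+1`) is admissible.
[cite: HuangSellke2025, §3.3.2 (Lemma 3.22, resampling-chain bookkeeping of the in-tree proof)] -/
theorem bex_extend_admissible (s : B → Bool) (ρ' : B → Fin (L + 1) → Fin (L + 1))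
    (h1 : ∀ b ℓ, ρ' b ℓ ≤ ℓ) (h2 : ∀ b ℓ ℓ', ρ' b ℓ ≤ ℓ' → ℓ' ≤ ℓ → ρ' b ℓ' = ρ' b ℓ)
    (ρ : B → Fin (L + 1 + 1) → Fin (L + 1 + 1))
    (hc : ∀ b (ℓ : Fin (L + 1)), ρ b ℓ.castSucc = (ρ' b ℓ).castSucc)
    (hl : ∀ b, ρ b (Fin.last (L + 1)) =
      if s b then (ρ' b (Fin.last L)).castSucc else Fin.last (L + 1)) :
    (∀ b ℓ, ρ b ℓ ≤ ℓ) ∧ (∀ b ℓ ℓ', ρ b ℓ ≤ ℓ' → ℓ' ≤ ℓ → ρ b ℓ' = ρ b ℓ) := by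
  refine ⟨fun b ℓ => ?_, fun b ℓ ℓ' hℓ' hℓ => ?_⟩
  · obtain ⟨m, rfl⟩ | rfl := ℓ.eq_castSucc_or_eq_last
    · rw [hc]
      exact Fin.castSucc_le_castSucc_iff.mpr (h1 b m)
    · exact Fin.le_last _
  · obtain ⟨m, rfl⟩ | rfl := ℓ.eq_castSucc_or_eq_last
    · obtain ⟨m', rfl⟩ | rfl := ℓ'.eq_castSucc_or_eq_last
      · rw [hc] at hℓ' ⊢
        rw [hc, h2 b m m' (Fin.castSucc_le_castSucc_iff.mp hℓ')
          (Fin.castSucc_le_castSucc_iff.mp hℓ)]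
      · exact absurd hℓ (not_le.mpr (Fin.castSucc_lt_last m))
    · obtain ⟨m', rfl⟩ | rfl := ℓ'.eq_castSucc_or_eq_last
      · rw [hl] at hℓ' ⊢
        by_cases hb : s b
        · rw [if_pos hb] at hℓ' ⊢
          rw [hc, h2 b (Fin.last L) m' (Fin.castSucc_le_castSucc_iff.mp hℓ') (Fin.le_last _)]
        · rw [if_neg hb] at hℓ'
          exact absurd hℓ' (not_le.mpr (Fin.castSucc_lt_last m'))
      · rfl

/-- Expanding a free array `Fin.snoc u' v'` along the extended root map `ρ` gives the expansion of
`u'` along `ρ'`, followed by the last step "keep on `s`, refresh from `v'` off `s`".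
[cite: HuangSellke2025, §3.3.2 (Lemma 3.22, resampling-chain bookkeeping of the in-tree proof)] -/
theorem bex_extend_expand (s : B → Bool) (ρ' : B → Fin (L + 1) → Fin (L + 1))
    (ρ : B → Fin (L + 1 + 1) → Fin (L + 1 + 1))
    (hc : ∀ b (ℓ : Fin (L + 1)), ρ b ℓ.castSucc = (ρ' b ℓ).castSucc)
    (hl : ∀ b, ρ b (Fin.last (L + 1)) =
      if s b then (ρ' b (Fin.last L)).castSucc else Fin.last (L + 1))
    (u' : Fin (L + 1) → B → Γ) (v' : B → Γ) :
    (fun ℓ b => (Fin.snoc u' v' : Fin (L + 1 + 1) → B → Γ) (ρ b ℓ) b) =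
      Fin.snoc (fun ℓ b => u' (ρ' b ℓ) b)
        (fun b => if s b then u' (ρ' b (Fin.last L)) b else v' b) := by
  funext ℓ b
  obtain ⟨m, rfl⟩ | rfl := ℓ.eq_castSucc_or_eq_last
  · rw [hc, Fin.snoc_castSucc, Fin.snoc_castSucc]
  · rw [hl, Fin.snoc_last]
    by_cases hb : s b
    · rw [if_pos hb, if_pos hb, Fin.snoc_castSucc]
    · rw [if_neg hb, if_neg hb, Fin.snoc_last]

end Roots

section Main

variable {B Γ : Type} [Fintype B] [DecidableEq B] [Fintype Γ] [DecidableEq Γ]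

/-- Base case `L = 0`: the weight is `1` and `ρ b ℓ = ℓ` is admissible.
[cite: HuangSellke2025, §3.3.2 (Lemma 3.22, resampling-chain bookkeeping of the in-tree proof)] -/
theorem bex_base (δ : Fin 0 → ℝ) (g : (Fin (0 + 1) → B → Γ) → ℝ) (M : ℝ)
    (hM : ∀ ρ : B → Fin (0 + 1) → Fin (0 + 1), (∀ b ℓ, ρ b ℓ ≤ ℓ) →
      (∀ b ℓ ℓ', ρ b ℓ ≤ ℓ' → ℓ' ≤ ℓ → ρ b ℓ' = ρ b ℓ) →
      ∑ u : Fin (0 + 1) → B → Γ, g (fun ℓ b => u (ρ b ℓ) b) ≤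
        M * Fintype.card (Fin (0 + 1) → B → Γ)) :
    ∑ w : Fin (0 + 1) → B → Γ,
        (∏ ℓ : Fin 0, resampleKernel (δ ℓ) (w ℓ.castSucc) (w ℓ.succ)) * g w ≤
      M * Fintype.card (B → Γ) := by
  have key := hM (fun _ ℓ => ℓ) (fun _ _ => le_rfl) (fun _ _ _ h h' => le_antisymm h' h)
  have hcard : (Fintype.card (Fin (0 + 1) → B → Γ) : ℝ) = Fintype.card (B → Γ) := by
    rw [bex_card_succ 0]
    simp
  rw [hcard] at key
  simpa using key

variable [Nonempty Γ]

/-- Induction step `L → L + 1` (see the module docstring).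
[cite: HuangSellke2025, §3.3.2 (Lemma 3.22, resampling-chain bookkeeping of the in-tree proof)] -/
theorem bex_step {L : ℕ} (M : ℝ)
    (ih : ∀ (δ : Fin L → ℝ), (∀ ℓ, 0 ≤ δ ℓ) → (∀ ℓ, δ ℓ ≤ 1) →
      ∀ (g : (Fin (L + 1) → B → Γ) → ℝ), (∀ w, 0 ≤ g w) →
      (∀ ρ : B → Fin (L + 1) → Fin (L + 1), (∀ b ℓ, ρ b ℓ ≤ ℓ) →
        (∀ b ℓ ℓ', ρ b ℓ ≤ ℓ' → ℓ' ≤ ℓ → ρ b ℓ' = ρ b ℓ) →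
        ∑ u : Fin (L + 1) → B → Γ, g (fun ℓ b => u (ρ b ℓ) b) ≤
          M * Fintype.card (Fin (L + 1) → B → Γ)) →
      ∑ w : Fin (L + 1) → B → Γ,
          (∏ ℓ : Fin L, resampleKernel (δ ℓ) (w ℓ.castSucc) (w ℓ.succ)) * g w ≤
        M * Fintype.card (B → Γ))
    (δ : Fin (L + 1) → ℝ) (hδ0 : ∀ ℓ, 0 ≤ δ ℓ) (hδ1 : ∀ ℓ, δ ℓ ≤ 1)
    (g : (Fin (L + 1 + 1) → B → Γ) → ℝ) (hg : ∀ w, 0 ≤ g w)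
    (hM : ∀ ρ : B → Fin (L + 1 + 1) → Fin (L + 1 + 1), (∀ b ℓ, ρ b ℓ ≤ ℓ) →
      (∀ b ℓ ℓ', ρ b ℓ ≤ ℓ' → ℓ' ≤ ℓ → ρ b ℓ' = ρ b ℓ) →
      ∑ u : Fin (L + 1 + 1) → B → Γ, g (fun ℓ b => u (ρ b ℓ) b) ≤
        M * Fintype.card (Fin (L + 1 + 1) → B → Γ)) :
    ∑ w : Fin (L + 1 + 1) → B → Γ,
        (∏ ℓ : Fin (L + 1), resampleKernel (δ ℓ) (w ℓ.castSucc) (w ℓ.succ)) * g w ≤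
      M * Fintype.card (B → Γ) := by
  set ε : ℝ := δ (Fin.last L) with hε
  set C : ℝ := ((Fintype.card Γ : ℝ) ^ Fintype.card B)⁻¹ with hC
  have hP : (Fintype.card Γ : ℝ) ^ Fintype.card B ≠ 0 :=
    pow_ne_zero _ (Nat.cast_ne_zero.mpr Fintype.card_ne_zero)
  have hC0 : 0 ≤ C := inv_nonneg.mpr (pow_nonneg (Nat.cast_nonneg _) _)
  -- Step 1: the weighted sum at length `L + 1` as a `p_s`-mixture of weighted sums at length `L`.
  have hLHS : ∑ w : Fin (L + 1 + 1) → B → Γ,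
        (∏ ℓ : Fin (L + 1), resampleKernel (δ ℓ) (w ℓ.castSucc) (w ℓ.succ)) * g w =
      ∑ s : B → Bool, (∏ b, (if s b then 1 - ε else ε)) *
        ∑ w' : Fin (L + 1) → B → Γ,
          (∏ ℓ : Fin L, resampleKernel (δ ℓ.castSucc) (w' ℓ.castSucc) (w' ℓ.succ)) *
            (C * ∑ v' : B → Γ,
              g (Fin.snoc w' (fun b => if s b then w' (Fin.last L) b else v' b))) := by
    rw [bex_sum_snoc, ← bex_rearrange]
    refine Finset.sum_congr rfl fun w' _ => ?_
    simp_rw [bex_weight_snoc δ w', mul_assoc]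
    rw [← Finset.mul_sum, bex_kernel_mixture]
  -- Step 2: the induction hypothesis for each keep set `s`.
  have hIH : ∀ s : B → Bool,
      ∑ w' : Fin (L + 1) → B → Γ,
          (∏ ℓ : Fin L, resampleKernel (δ ℓ.castSucc) (w' ℓ.castSucc) (w' ℓ.succ)) *
            (C * ∑ v' : B → Γ,
              g (Fin.snoc w' (fun b => if s b then w' (Fin.last L) b else v' b))) ≤
        M * Fintype.card (B → Γ) := by
    intro s
    refine ih (fun ℓ => δ ℓ.castSucc) (fun ℓ => hδ0 _) (fun ℓ => hδ1 _)
      (fun w' => C * ∑ v' : B → Γ,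
        g (Fin.snoc w' (fun b => if s b then w' (Fin.last L) b else v' b)))
      (fun w' => mul_nonneg hC0 (Finset.sum_nonneg fun v' _ => hg _)) ?_
    intro ρ' hρ'1 hρ'2
    dsimp only
    -- the extended root map
    let ρ : B → Fin (L + 1 + 1) → Fin (L + 1 + 1) := fun b =>
      Fin.snoc (fun ℓ => (ρ' b ℓ).castSucc)
        (if s b then (ρ' b (Fin.last L)).castSucc else Fin.last (L + 1))
    have hc : ∀ b (ℓ : Fin (L + 1)), ρ b ℓ.castSucc = (ρ' b ℓ).castSucc := fun b ℓ => by
      simp only [ρ, Fin.snoc_castSucc]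
    have hl : ∀ b, ρ b (Fin.last (L + 1)) =
        if s b then (ρ' b (Fin.last L)).castSucc else Fin.last (L + 1) := fun b => by
      simp only [ρ, Fin.snoc_last]
    obtain ⟨hρ1, hρ2⟩ := bex_extend_admissible s ρ' hρ'1 hρ'2 ρ hc hl
    have key : ∑ u' : Fin (L + 1) → B → Γ, ∑ v' : B → Γ,
        g (Fin.snoc (fun ℓ b => u' (ρ' b ℓ) b)
          (fun b => if s b then u' (ρ' b (Fin.last L)) b else v' b)) ≤
        M * Fintype.card (Fin (L + 1 + 1) → B → Γ) := by
      refine le_of_eq_of_le ?_ (hM ρ hρ1 hρ2)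
      rw [bex_sum_snoc (L + 1)]
      refine Finset.sum_congr rfl fun u' _ => Finset.sum_congr rfl fun v' _ => congrArg g ?_
      exact (bex_extend_expand s ρ' ρ hc hl u' v').symm
    rw [← Finset.mul_sum]
    refine le_trans (mul_le_mul_of_nonneg_left key hC0) (le_of_eq ?_)
    rw [bex_card_succ (L + 1), hC]
    field_simp
  -- Step 3: average the bounds.
  have hp0 : ∀ s : B → Bool, 0 ≤ ∏ b, (if s b then 1 - ε else ε) := fun s =>
    Finset.prod_nonneg fun b _ => by
      by_cases hb : s b
      · rw [if_pos hb]; exact sub_nonneg.mpr (hδ1 _)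
      · rw [if_neg hb]; exact hδ0 _
  rw [hLHS]
  calc ∑ s : B → Bool, (∏ b, (if s b then 1 - ε else ε)) *
        ∑ w' : Fin (L + 1) → B → Γ,
          (∏ ℓ : Fin L, resampleKernel (δ ℓ.castSucc) (w' ℓ.castSucc) (w' ℓ.succ)) *
            (C * ∑ v' : B → Γ,
              g (Fin.snoc w' (fun b => if s b then w' (Fin.last L) b else v' b)))
      ≤ ∑ s : B → Bool, (∏ b, (if s b then 1 - ε else ε)) * (M * Fintype.card (B → Γ)) :=
        Finset.sum_le_sum fun s _ => mul_le_mul_of_nonneg_left (hIH s) (hp0 s)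
    _ = M * Fintype.card (B → Γ) := by rw [← Finset.sum_mul, bex_pattern_sum, one_mul]

end Main

/-- **Refresh expansion / block structure of one slot** (the `R` step of line `Sketch`,
Huang–Sellke 2025 Lemma 3.22): the multi-time weighted sum of a nonnegative `g` over the version
arrays `w : Fin (L+1) → B → Γ` of one slot, with weight `∏_ℓ P_{δ ℓ}(w ℓ, w (ℓ+1))`, is at most
`M · #(B → Γ)` as soon as for every ADMISSIBLE block-root map `ρ` (`ρ b ℓ ≤ ℓ`, `ρ b` constant on
`[ρ b ℓ, ℓ]`) the plain sum of `g` over the expanded free arrays `fun ℓ b => u (ρ b ℓ) b` is at most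
`M · #(Fin (L+1) → B → Γ)`.
[cite: HuangSellke2025, §3.3.2 (Lemma 3.22, resampling-chain bookkeeping of the in-tree proof)] -/
theorem stub_blockExpansion {B Γ : Type} [Fintype B] [DecidableEq B] [Fintype Γ] [DecidableEq Γ]
    [Nonempty Γ] (L : ℕ) (δ : Fin L → ℝ) (hδ0 : ∀ ℓ, 0 ≤ δ ℓ) (hδ1 : ∀ ℓ, δ ℓ ≤ 1)
    (g : (Fin (L + 1) → B → Γ) → ℝ) (hg : ∀ w, 0 ≤ g w) (M : ℝ)
    (hM : ∀ ρ : B → Fin (L + 1) → Fin (L + 1), (∀ b ℓ, ρ b ℓ ≤ ℓ) →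
      (∀ b ℓ ℓ', ρ b ℓ ≤ ℓ' → ℓ' ≤ ℓ → ρ b ℓ' = ρ b ℓ) →
      ∑ u : Fin (L + 1) → B → Γ, g (fun ℓ b => u (ρ b ℓ) b) ≤
        M * Fintype.card (Fin (L + 1) → B → Γ)) :
    ∑ w : Fin (L + 1) → B → Γ,
        (∏ ℓ : Fin L, resampleKernel (δ ℓ) (w ℓ.castSucc) (w ℓ.succ)) * g w ≤
      M * Fintype.card (B → Γ) := by
  induction L with
  | zero => exact bex_base δ g M hM
  | succ L ih => exact bex_step M ih δ hδ0 hδ1 g hg hM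

end Literature.Computability.Complexity.HuangSellke2025Chain

end Part11

/-!
## Part 12 — port of `Summits/PneNP/PneNP/Theorems/OverlapGapAlgebraSearchHardWindowSlotBound.lean` (7 declarations kept)

# Route OverlapGapAlgebra, crux `SearchHardWindow` : the literal-level slot bound
# `stub_slotBound` 

Replicas `ℓ : Fin (k+1)` with assignments `Y ℓ : Fin n → Bool`, an ADMISSIBLE block-root map `ρ`
(`ρ b ℓ ≤ ℓ`, `ρ b` constant on `[ρ b ℓ, ℓ]`) and a free array of literals
`u : Fin (k+1) → Fin k → Fin n × Bool`: replica `ℓ` sees at position `b` the literal `u (ρ b ℓ) b`,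
and `(v, c)` is true under `Y ℓ` iff `Y ℓ v = c`.  `stub_slotBound`: the arrays on which EVERY
replica sees a true literal number at most `(1 − 2^{−k} (FA / n^s − k(k+1)/2 · 2^{−F})) · #arrays`,
`FA = Σ_ℓ ν_ℓ`, `ν_ℓ = #{I : Fin s → Fin n | (Y ℓ (I r))_r ≠ (Y ℓ' (I r))_r ∀ ℓ' < ℓ}`, `s + F ≤ k`.

Proof (`V ℓ` = "all `k` literals of replica `ℓ` are false under `Y ℓ`"): the complement of the
counted set is `⋃_ℓ V ℓ ⊇ ⨆_ℓ W ℓ`, `W ℓ = V ℓ ∖ ⋃_{ℓ' < ℓ} V ℓ'`, and (`slb_perReplica`)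
`#W ℓ ≥ 2^{−k} #arrays · ν_ℓ / n^s − ℓ · 2^{−k−F} #arrays`: by admissibility the earlier replicas
`ℓ'` differing from `ℓ` in `< F` block roots share with `ℓ` a common set of `≥ s` positions, inside
which we fix `s` darts (`slb_exists_darts`); if `ℓ` is violated and the pattern of `Y ℓ` at the
variables of `ℓ`'s literals on the darts differs from that of every earlier `Y ℓ'` ("newness"), each
such recent `ℓ'` reads, at a dart where the patterns differ, the same literal as `ℓ`, false under
`Y ℓ` hence true under `Y ℓ'`.  So `W ℓ ⊇ (V ℓ ∩ New ℓ) ∖ ⋃_{ℓ' non-recent} (V ℓ ∩ V ℓ')`, where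
`#(V ℓ ∩ New ℓ) · 2^k = #New ℓ` (newness only reads variables; **Counting Lemma 1**
`slb_card_constraints`: prescribing the signs at a set `Q` of coordinates as functions of the
variables cuts out a `2^{-#Q}` fraction, the two halves of one constraint being exchanged by a sign
flip), `#New ℓ · n^s = #arrays · ν_ℓ` (**Counting Lemma 2** `slb_card_proj`: the fibres of the
projection to the variables at `s` distinct coordinates are exchanged by transpositions of values),
and for each of the `≤ ℓ` non-recent `ℓ' < ℓ` the event `V ℓ ∩ V ℓ'` prescribes `≥ k + F` signs.
Summing over `ℓ` (`Σ_ℓ ℓ = k(k+1)/2`) and dividing out concludes.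

(Verbatim declaration-level port — the declarations listed in the Part header count — of the Summits-side module of the PneNP
tree (route OverlapGapAlgebra, crux SearchHardWindow / NoStableSection); route / stub / lead bookkeeping in the text above is historical.)
-/

section Part12

namespace Literature.Computability.Complexity.HuangSellke2025Chain

open _root_.Finset
open scoped _root_.Classical

variable {ι κ α : Type*}

/-- The sign flip at one coordinate `a` of a free array: an involution fixing all variables and all
other coordinates and negating the sign at `a`.
[cite: HuangSellke2025, §3.3.2 (Lemma 3.22, resampling-chain bookkeeping of the in-tree proof)] -/
theorem slb_exists_flip (a : ι × κ) :
    ∃ f : (ι → κ → α × Bool) → (ι → κ → α × Bool),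
      (∀ u, f (f u) = u) ∧ (∀ u i b, (f u i b).1 = (u i b).1) ∧
      (∀ u i b, (i, b) ≠ a → f u i b = u i b) ∧ (∀ u, (f u a.1 a.2).2 = !(u a.1 a.2).2) := by
  refine ⟨fun u i b => if (i, b) = a then ((u i b).1, !(u i b).2) else u i b, fun u => ?_,
    fun u i b => ?_, fun u i b h => by simp [h], fun u => by simp⟩
  · funext i b
    by_cases h : (i, b) = a <;> simp [h]
  · by_cases h : (i, b) = a <;> simp [h]

/-- **Counting Lemma 1 (sign constraints halve).** If membership in `A` only depends on the
variables and on the signs at coordinates outside `Q`, then the members of `A` whose sign at each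
coordinate `q ∈ Q` is a prescribed function `φ q` of the variable at `q` form exactly a
`2^{-#Q}` fraction of `A` (induction on `Q`: a new constraint at `a` splits the set into two halves
exchanged by the sign flip at `a`).
[cite: HuangSellke2025, §3.3.2 (Lemma 3.22, resampling-chain bookkeeping of the in-tree proof)] -/
theorem slb_card_constraints (Q : Finset (ι × κ)) (φ : ι × κ → α → Bool)
    (A B : Finset (ι → κ → α × Bool))
    (hA : ∀ u v : ι → κ → α × Bool, (∀ i b, (u i b).1 = (v i b).1) →
      (∀ i b, (i, b) ∉ Q → (u i b).2 = (v i b).2) → (u ∈ A ↔ v ∈ A))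
    (hB : ∀ u, u ∈ B ↔ u ∈ A ∧ ∀ q ∈ Q, (u q.1 q.2).2 = φ q (u q.1 q.2).1) :
    #B * 2 ^ #Q = #A := by
  induction Q using Finset.induction_on generalizing A B with
  | empty =>
    have : B = A := by
      ext u
      simp [hB]
    simp [this]
  | insert a Q haQ ih =>
    obtain ⟨f, hf1, hf2, hf3, hf4⟩ := slb_exists_flip (α := α) a
    obtain ⟨M, hM⟩ : ∃ M : Finset (ι → κ → α × Bool),
        M = A.filter fun u => ∀ q ∈ Q, (u q.1 q.2).2 = φ q (u q.1 q.2).1 := ⟨_, rfl⟩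
    have hfA : ∀ u, f u ∈ A ↔ u ∈ A := fun u =>
      hA (f u) u (hf2 u) fun i b hib => by rw [hf3 u i b fun h => hib (h ▸ mem_insert_self a Q)]
    have hfM : ∀ u, f u ∈ M ↔ u ∈ M := by
      intro u
      simp only [hM, mem_filter, hfA]
      refine and_congr_right fun _ => forall₂_congr fun q hq => ?_
      rw [hf3 u q.1 q.2 fun h => haQ (h ▸ hq)]
    -- the new constraint halves `M`: the two halves are exchanged by `f`
    have h1 : #(M.filter fun u => (u a.1 a.2).2 = φ a (u a.1 a.2).1) = #B := by
      congr 1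
      ext u
      rw [mem_filter, hB, hM, mem_filter, forall_mem_insert, and_assoc, and_comm (a := _ = φ a _)]
    have h2 : #(M.filter fun u => ¬ (u a.1 a.2).2 = φ a (u a.1 a.2).1) = #B := by
      rw [← h1]
      refine card_bijective f (Function.Involutive.bijective hf1) fun u => ?_
      rw [mem_filter, mem_filter, hfM, hf2, hf4, Bool.not_eq]
    have h3 : #M * 2 ^ #Q = #A :=
      ih A M (fun u v h1 h2 => hA u v h1 fun i b hib => h2 i b fun h => hib (mem_insert_of_mem h))
        fun u => by rw [hM, mem_filter]
    rw [card_insert_of_notMem haQ, pow_succ, ← h3, ← card_filter_add_card_filter_not (s := M)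
      (fun u => (u a.1 a.2).2 = φ a (u a.1 a.2).1), h1, h2]
    ring

/-- Transposing the variables at the (distinct) coordinates `c r` between `I r` and `I' r`: an
involution of the free arrays exchanging the fibres of the projection above `I` and `I'`.
[cite: HuangSellke2025, §3.3.2 (Lemma 3.22, resampling-chain bookkeeping of the in-tree proof)] -/
theorem slb_exists_swap {σ : Type*} [DecidableEq α] (c : σ → ι × κ) (hc : Function.Injective c)
    (I I' : σ → α) :
    ∃ Φ : (ι → κ → α × Bool) → (ι → κ → α × Bool), (∀ u, Φ (Φ u) = u) ∧
      ∀ u r, (Φ u (c r).1 (c r).2).1 = Equiv.swap (I r) (I' r) (u (c r).1 (c r).2).1 := by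
  refine ⟨fun u i b => (if h : ∃ r, c r = (i, b) then
      Equiv.swap (I h.choose) (I' h.choose) (u i b).1 else (u i b).1, (u i b).2), ?_, ?_⟩
  · intro u
    funext i b
    by_cases h : ∃ r, c r = (i, b)
    · simp only [dif_pos h, Equiv.swap_apply_self, Prod.mk.eta]
    · simp only [dif_neg h, Prod.mk.eta]
  · intro u r
    have h : ∃ r', c r' = ((c r).1, (c r).2) := ⟨r, rfl⟩
    have hr : h.choose = r := hc h.choose_spec
    simp only [dif_pos h, hr]

/-- **Counting Lemma 2 (the variables at distinct coordinates are independent and uniform).** For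
an injective family `c` of coordinates, the arrays whose tuple of variables at `c` lies in `B`
number `#B · #arrays / #tuples` (all fibres of the projection have the same size).
[cite: HuangSellke2025, §3.3.2 (Lemma 3.22, resampling-chain bookkeeping of the in-tree proof)] -/
theorem slb_card_proj {σ : Type*} [Fintype σ] [DecidableEq σ] [Fintype ι] [DecidableEq ι]
    [Fintype κ] [DecidableEq κ] [Fintype α] [DecidableEq α]
    (c : σ → ι × κ) (hc : Function.Injective c) (A : Finset (ι → κ → α × Bool))
    (B : Finset (σ → α)) (hAB : ∀ u, u ∈ A ↔ (fun r => (u (c r).1 (c r).2).1) ∈ B) :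
    #A * Fintype.card (σ → α) = Fintype.card (ι → κ → α × Bool) * #B := by
  obtain ⟨pr, hpr⟩ : ∃ pr : (ι → κ → α × Bool) → σ → α,
      ∀ u, pr u = fun r => (u (c r).1 (c r).2).1 := ⟨_, fun u => rfl⟩
  simp only [← hpr] at hAB
  have hfib : ∀ I I', #(univ.filter fun u => pr u = I) = #(univ.filter fun u => pr u = I') := by
    intro I I'
    obtain ⟨Φ, hΦ1, hΦ2⟩ := slb_exists_swap c hc I I'
    refine card_bijective Φ (Function.Involutive.bijective hΦ1) fun u => ?_
    simp only [mem_filter, mem_univ, true_and, hpr, funext_iff, hΦ2]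
    refine forall_congr' fun r => ?_
    rw [Equiv.apply_eq_iff_eq_symm_apply, Equiv.symm_swap, Equiv.swap_apply_right]
  have hsum : ∀ I, #(univ.filter fun u => pr u = I) * Fintype.card (σ → α) =
      Fintype.card (ι → κ → α × Bool) := by
    intro I
    have h := card_eq_sum_card_fiberwise (f := pr) (s := univ) (t := univ) fun u _ => mem_univ _
    rw [sum_congr rfl fun I' _ => hfib I' I, sum_const, smul_eq_mul, card_univ, card_univ] at h
    rw [h, mul_comm]
  rw [card_eq_sum_card_fiberwise (f := pr) (s := A) (t := B) fun u hu => (hAB u).1 hu, sum_mul]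
  have hfibA : ∀ I ∈ B, #(A.filter fun u => pr u = I) * Fintype.card (σ → α) =
      Fintype.card (ι → κ → α × Bool) := by
    intro I hI
    rw [← hsum I]
    congr 2
    ext u
    simp only [mem_filter, mem_univ, true_and, and_iff_right_iff_imp]
    exact fun h => (hAB u).2 (h ▸ hI)
  rw [sum_congr rfl hfibA, sum_const, smul_eq_mul, mul_comm]

/-- **The key set of an admissible block-root map.** For `ρ` admissible (`ρ b ℓ ≤ ℓ`, and `ρ b`
constant on `[ρ b ℓ, ℓ]`) and `s + F ≤ k`, every replica `ℓ` admits `s` distinct positions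
`t r : Fin k` at which EVERY earlier replica `ℓ' < ℓ` differing from `ℓ` in fewer than `F` block
roots has the same block root as `ℓ` (these recent earlier replicas form an interval `[ℓ₀, ℓ)`, and
the `≥ k − F + 1 > s` positions where `ℓ₀` agrees with `ℓ` work for all of them).
[cite: HuangSellke2025, §3.3.2 (Lemma 3.22, resampling-chain bookkeeping of the in-tree proof)] -/
theorem slb_exists_darts (k s F : ℕ) (hsF : s + F ≤ k) (ρ : Fin k → Fin (k + 1) → Fin (k + 1))
    (hρ1 : ∀ b ℓ, ρ b ℓ ≤ ℓ) (hρ2 : ∀ b ℓ ℓ', ρ b ℓ ≤ ℓ' → ℓ' ≤ ℓ → ρ b ℓ' = ρ b ℓ)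
    (ℓ : Fin (k + 1)) :
    ∃ t : Fin s → Fin k, Function.Injective t ∧ ∀ r (ℓ' : Fin (k + 1)), ℓ' < ℓ →
      #(univ.filter fun b => ρ b ℓ' ≠ ρ b ℓ) < F → ρ (t r) ℓ' = ρ (t r) ℓ := by
  -- the recent earlier replicas `Rc` and the key set `C`, of cardinality `≥ s`
  obtain ⟨Rc, hRc⟩ : ∃ Rc : Finset (Fin (k + 1)),
      ∀ ℓ', ℓ' ∈ Rc ↔ ℓ' < ℓ ∧ #(univ.filter fun b => ρ b ℓ' ≠ ρ b ℓ) < F :=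
    ⟨univ.filter _, fun ℓ' => mem_filter.trans (and_iff_right (mem_univ _))⟩
  obtain ⟨C, hC⟩ : ∃ C : Finset (Fin k), ∀ b, b ∈ C ↔ ∀ ℓ' ∈ Rc, ρ b ℓ' = ρ b ℓ :=
    ⟨univ.filter _, fun b => mem_filter.trans (and_iff_right (mem_univ _))⟩
  have hsC : s ≤ #C := by
    rcases Rc.eq_empty_or_nonempty with h | h
    · rw [show C = univ from eq_univ_of_forall fun b => (hC b).2 (by simp [h]), card_univ,
        Fintype.card_fin]
      omega
    · have h0 := ((hRc _).1 (min'_mem Rc h)).2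
      have hsub : (univ.filter fun b => ρ b (Rc.min' h) = ρ b ℓ) ⊆ C := by
        refine fun b hb => (hC b).2 fun ℓ' hℓ' => hρ2 b ℓ ℓ' ?_ ((hRc _).1 hℓ').1.le
        exact (mem_filter.1 hb).2 ▸ (hρ1 b _).trans (min'_le Rc ℓ' hℓ')
      have hcard := card_filter_add_card_filter_not (s := (univ : Finset (Fin k)))
        (fun b => ρ b (Rc.min' h) = ρ b ℓ)
      rw [card_univ, Fintype.card_fin] at hcard
      have := card_le_card hsub
      simp only [ne_eq] at h0
      omega
  -- choose `s` darts inside `C`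
  refine ⟨fun r => (C.equivFin.symm (Fin.castLE hsC r)).1, fun r r' h =>
    Fin.castLE_injective hsC (C.equivFin.symm.injective (Subtype.val_injective h)),
    fun r ℓ' hlt hF => ?_⟩
  exact (hC _).1 (C.equivFin.symm (Fin.castLE hsC r)).2 ℓ' ((hRc _).2 ⟨hlt, hF⟩)

/-- **Per-replica bound.** For each replica `ℓ`, in cleared-denominator natural-number form:
`#arrays · ν_ℓ · 2^F ≤ (#W ℓ · 2^{k+F} + ℓ · #arrays) · n^s`, where
`W ℓ = {u | ℓ violated, no earlier replica violated}`.
[cite: HuangSellke2025, §3.3.2 (Lemma 3.22, resampling-chain bookkeeping of the in-tree proof)] -/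
theorem slb_perReplica (n k s F : ℕ) (hsF : s + F ≤ k) (Y : Fin (k + 1) → Fin n → Bool)
    (ρ : Fin k → Fin (k + 1) → Fin (k + 1)) (hρ1 : ∀ b ℓ, ρ b ℓ ≤ ℓ)
    (hρ2 : ∀ b ℓ ℓ', ρ b ℓ ≤ ℓ' → ℓ' ≤ ℓ → ρ b ℓ' = ρ b ℓ) (ℓ : Fin (k + 1)) :
    Fintype.card (Fin (k + 1) → Fin k → Fin n × Bool) *
          #(univ.filter fun I : Fin s → Fin n =>
            ∀ ℓ' : Fin (k + 1), ℓ' < ℓ → ¬ ∀ r, Y ℓ (I r) = Y ℓ' (I r)) * 2 ^ F ≤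
      (#(univ.filter fun u : Fin (k + 1) → Fin k → Fin n × Bool =>
            (∀ b, Y ℓ (u (ρ b ℓ) b).1 ≠ (u (ρ b ℓ) b).2) ∧
              ∀ ℓ' : Fin (k + 1), ℓ' < ℓ → ¬ ∀ b, Y ℓ' (u (ρ b ℓ') b).1 ≠ (u (ρ b ℓ') b).2) *
          2 ^ (k + F) +
        (ℓ : ℕ) * Fintype.card (Fin (k + 1) → Fin k → Fin n × Bool)) * n ^ s := by
  obtain ⟨t, ht, hkey⟩ := slb_exists_darts k s F hsF ρ hρ1 hρ2 ℓ
  set N := Fintype.card (Fin (k + 1) → Fin k → Fin n × Bool)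
  set W := univ.filter fun u : Fin (k + 1) → Fin k → Fin n × Bool =>
      (∀ b, Y ℓ (u (ρ b ℓ) b).1 ≠ (u (ρ b ℓ) b).2) ∧
        ∀ ℓ' : Fin (k + 1), ℓ' < ℓ → ¬ ∀ b, Y ℓ' (u (ρ b ℓ') b).1 ≠ (u (ρ b ℓ') b).2
  set Bν := univ.filter fun I : Fin s → Fin n =>
      ∀ ℓ' : Fin (k + 1), ℓ' < ℓ → ¬ ∀ r, Y ℓ (I r) = Y ℓ' (I r) with hBνdef
  -- newness (patterns read at the variables of `ℓ`'s literals on the darts), violation ∧ newness,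
  -- the non-recent earlier replicas, joint violations
  obtain ⟨NewS, hNewS⟩ : ∃ NewS : Finset (Fin (k + 1) → Fin k → Fin n × Bool), ∀ u, u ∈ NewS ↔
      ∀ ℓ' : Fin (k + 1), ℓ' < ℓ →
        ¬ ∀ r, Y ℓ (u (ρ (t r) ℓ) (t r)).1 = Y ℓ' (u (ρ (t r) ℓ) (t r)).1 :=
    ⟨univ.filter _, fun u => mem_filter.trans (and_iff_right (mem_univ _))⟩
  obtain ⟨VN, hVN⟩ : ∃ VN : Finset (Fin (k + 1) → Fin k → Fin n × Bool), ∀ u, u ∈ VN ↔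
      u ∈ NewS ∧ ∀ b, Y ℓ (u (ρ b ℓ) b).1 ≠ (u (ρ b ℓ) b).2 :=
    ⟨NewS.filter _, fun u => mem_filter⟩
  obtain ⟨NR, hNR⟩ : ∃ NR : Finset (Fin (k + 1)), ∀ ℓ', ℓ' ∈ NR ↔
      ℓ' < ℓ ∧ F ≤ #(univ.filter fun b => ρ b ℓ' ≠ ρ b ℓ) :=
    ⟨univ.filter _, fun ℓ' => mem_filter.trans (and_iff_right (mem_univ _))⟩
  obtain ⟨VV, hVV⟩ : ∃ VV : Fin (k + 1) → Finset (Fin (k + 1) → Fin k → Fin n × Bool), ∀ ℓ' u,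
      u ∈ VV ℓ' ↔ (∀ b, Y ℓ (u (ρ b ℓ) b).1 ≠ (u (ρ b ℓ) b).2) ∧
        ∀ b, Y ℓ' (u (ρ b ℓ') b).1 ≠ (u (ρ b ℓ') b).2 :=
    ⟨fun ℓ' => univ.filter _, fun ℓ' u => mem_filter.trans (and_iff_right (mem_univ _))⟩
  -- (3) Claim A: violation + newness ⇒ no recent earlier replica is violated
  have h3 : #VN ≤ #W + ∑ ℓ' ∈ NR, #(VV ℓ') := by
    refine (card_le_card fun u hu => ?_).trans
      ((card_union_le _ _).trans (Nat.add_le_add_left card_biUnion_le _))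
    obtain ⟨hNew, hV⟩ := (hVN u).1 hu
    rw [hNewS] at hNew
    rw [mem_union, mem_biUnion]
    by_cases hnr : ∃ ℓ' ∈ NR, ∀ b, Y ℓ' (u (ρ b ℓ') b).1 ≠ (u (ρ b ℓ') b).2
    · obtain ⟨ℓ', hℓ', hV'⟩ := hnr
      exact Or.inr ⟨ℓ', hℓ', (hVV ℓ' u).2 ⟨hV, hV'⟩⟩
    · push Not at hnr
      refine Or.inl (mem_filter.2 ⟨mem_univ _, hV, fun ℓ' hlt hV' => ?_⟩)
      by_cases hFle : F ≤ #(univ.filter fun b => ρ b ℓ' ≠ ρ b ℓ)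
      · obtain ⟨b, hb⟩ := hnr ℓ' ((hNR ℓ').2 ⟨hlt, hFle⟩)
        exact hV' b hb
      · obtain ⟨r, hr⟩ := not_forall.1 (hNew ℓ' hlt)
        have h2 := hV' (t r)
        rw [hkey r ℓ' hlt (not_le.1 hFle)] at h2
        exact hr ((Bool.eq_not_iff.2 (hV (t r))).trans (Bool.eq_not_iff.2 h2).symm)
  -- (4) joint violation with a non-recent replica prescribes `≥ k + F` signs
  have h4 : ∀ ℓ' ∈ NR, #(VV ℓ') * 2 ^ (k + F) ≤ N := by
    intro ℓ' hℓ'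
    obtain ⟨-, hF⟩ := (hNR ℓ').1 hℓ'
    set D := univ.filter fun b => ρ b ℓ' ≠ ρ b ℓ
    have hD : ∀ b, b ∈ D ↔ ρ b ℓ' ≠ ρ b ℓ := fun b => mem_filter.trans (and_iff_right (mem_univ _))
    have hdisj : Disjoint (univ.image fun b => (ρ b ℓ, b)) (D.image fun b => (ρ b ℓ', b)) := by
      refine disjoint_left.2 fun q hq hq' => ?_
      obtain ⟨b, -, rfl⟩ := mem_image.1 hq
      obtain ⟨b', hb', he⟩ := mem_image.1 hq'
      obtain ⟨h1, rfl⟩ := Prod.mk.inj he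
      exact (hD _).1 hb' h1
    obtain ⟨Q, hQdef⟩ : ∃ Q : Finset (Fin (k + 1) × Fin k),
        Q = univ.image (fun b => (ρ b ℓ, b)) ∪ D.image (fun b => (ρ b ℓ', b)) := ⟨_, rfl⟩
    have hcardQ : k + F ≤ #Q := by
      rw [hQdef, card_union_of_disjoint hdisj,
        card_image_of_injective _ (fun b b' h => congrArg Prod.snd h),
        card_image_of_injective _ (fun b b' h => congrArg Prod.snd h), card_univ, Fintype.card_fin]
      omega
    obtain ⟨φ, hφ⟩ : ∃ φ : Fin (k + 1) × Fin k → Fin n → Bool,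
        ∀ q v, φ q v = if q.1 = ρ q.2 ℓ then !(Y ℓ v) else !(Y ℓ' v) := ⟨_, fun q v => rfl⟩
    obtain ⟨Bc, hBc⟩ : ∃ Bc : Finset (Fin (k + 1) → Fin k → Fin n × Bool), ∀ u, u ∈ Bc ↔
        ∀ q ∈ Q, (u q.1 q.2).2 = φ q (u q.1 q.2).1 :=
      ⟨univ.filter _, fun u => mem_filter.trans (and_iff_right (mem_univ _))⟩
    have hcount : #Bc * 2 ^ #Q = N :=
      (slb_card_constraints Q φ univ Bc (fun u v _ _ => iff_of_true (mem_univ u) (mem_univ v))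
        fun u => by rw [hBc u, and_iff_right (mem_univ u)]).trans card_univ
    have hsub : VV ℓ' ⊆ Bc := by
      intro u hu
      obtain ⟨hV, hV'⟩ := (hVV ℓ' u).1 hu
      refine (hBc u).2 fun q hq => ?_
      rcases mem_union.1 (hQdef ▸ hq) with hq | hq
      · obtain ⟨b, -, rfl⟩ := mem_image.1 hq
        rw [hφ, if_pos rfl]
        exact Bool.eq_not_iff.2 (hV b).symm
      · obtain ⟨b, hb, rfl⟩ := mem_image.1 hq
        rw [hφ, if_neg ((hD b).1 hb)]
        exact Bool.eq_not_iff.2 (hV' b).symm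
    calc #(VV ℓ') * 2 ^ (k + F) ≤ #Bc * 2 ^ #Q :=
          Nat.mul_le_mul (card_le_card hsub) (Nat.pow_le_pow_right (by norm_num) hcardQ)
      _ = N := hcount
  -- (5) violation of `ℓ` prescribes `k` signs, newness only reads variables
  have h5 : #VN * 2 ^ k = #NewS := by
    obtain ⟨Q₀, hQ₀def⟩ : ∃ Q₀ : Finset (Fin (k + 1) × Fin k),
        Q₀ = univ.image fun b => (ρ b ℓ, b) := ⟨_, rfl⟩
    have hcardQ₀ : #Q₀ = k := by
      rw [hQ₀def, card_image_of_injective _ (fun b b' h => congrArg Prod.snd h), card_univ,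
        Fintype.card_fin]
    have h := slb_card_constraints Q₀ (fun _ v => !(Y ℓ v)) NewS VN
      (fun u v h1 _ => by rw [hNewS, hNewS]; simp only [h1]) fun u => by
      rw [hVN, hQ₀def, forall_mem_image]
      refine and_congr_right fun _ => ?_
      simp only [mem_univ, true_implies]
      exact forall_congr' fun b => ne_comm.trans Bool.eq_not_iff.symm
    rwa [hcardQ₀] at h
  -- (6) the variables on the darts are uniform
  have h6 : #NewS * n ^ s = N * #Bν := by
    have h := slb_card_proj (fun r => (ρ (t r) ℓ, t r)) (fun r r' h => ht (congrArg Prod.snd h))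
      NewS Bν fun u => by rw [hNewS, hBνdef, mem_filter, and_iff_right (mem_univ _)]
    have hns : Fintype.card (Fin s → Fin n) = n ^ s := by simp
    rwa [hns] at h
  -- (7) at most `ℓ` non-recent earlier replicas; assemble
  have h7 : #NR ≤ ℓ :=
    (card_le_card fun x hx => mem_Iio.2 ((hNR x).1 hx).1).trans (Fin.card_Iio ℓ).le
  have h47 : (∑ ℓ' ∈ NR, #(VV ℓ')) * 2 ^ (k + F) ≤ ℓ * N :=
    calc (∑ ℓ' ∈ NR, #(VV ℓ')) * 2 ^ (k + F) = ∑ ℓ' ∈ NR, #(VV ℓ') * 2 ^ (k + F) := sum_mul ..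
      _ ≤ ∑ ℓ' ∈ NR, N := sum_le_sum h4
      _ ≤ ℓ * N := by rw [sum_const, smul_eq_mul]; exact Nat.mul_le_mul_right _ h7
  calc N * #Bν * 2 ^ F = #VN * 2 ^ (k + F) * n ^ s := by rw [← h6, ← h5, pow_add]; ring
    _ ≤ (#W + ∑ ℓ' ∈ NR, #(VV ℓ')) * 2 ^ (k + F) * n ^ s := by gcongr
    _ = (#W * 2 ^ (k + F) + (∑ ℓ' ∈ NR, #(VV ℓ')) * 2 ^ (k + F)) * n ^ s := by ring
    _ ≤ (#W * 2 ^ (k + F) + ℓ * N) * n ^ s := by gcongr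

/-- **STUB G — the literal-level slot bound.** For an admissible block-root map `ρ` and
assignments `Y 0, …, Y k`, among all free arrays `u : Fin (k+1) → Fin k → Fin n × Bool` (literal of
position `b` seen by replica `ℓ` = `u (ρ b ℓ) b`, `(v, c)` true under `Y ℓ` iff `Y ℓ v = c`) the
number on which EVERY replica sees a true literal is at most
`(1 − 2^{−k} (FA_s(Y)/n^s − k(k+1)/2 · 2^{−F})) · #arrays`, `s + F ≤ k`.
[cite: HuangSellke2025, §3.3.2 (Lemma 3.22, resampling-chain bookkeeping of the in-tree proof)] -/
theorem stub_slotBound (n k s F : ℕ) (hn : 1 ≤ n) (hsF : s + F ≤ k)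
    (Y : Fin (k + 1) → Fin n → Bool) (ρ : Fin k → Fin (k + 1) → Fin (k + 1))
    (hρ1 : ∀ b ℓ, ρ b ℓ ≤ ℓ) (hρ2 : ∀ b ℓ ℓ', ρ b ℓ ≤ ℓ' → ℓ' ≤ ℓ → ρ b ℓ' = ρ b ℓ) :
    ((univ.filter fun u : Fin (k + 1) → Fin k → Fin n × Bool =>
        ∀ ℓ : Fin (k + 1), ∃ b : Fin k, Y ℓ (u (ρ b ℓ) b).1 = (u (ρ b ℓ) b).2).card : ℝ) ≤
      (1 - (1 / 2 : ℝ) ^ k *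
          ((∑ ℓ : Fin (k + 1), ((univ.filter fun I : Fin s → Fin n =>
              ∀ ℓ' : Fin (k + 1), ℓ' < ℓ → ¬ ∀ r, Y ℓ (I r) = Y ℓ' (I r)).card : ℝ)) / (n : ℝ) ^ s -
            (k : ℝ) * (k + 1) / 2 * (1 / 2 : ℝ) ^ F)) *
        Fintype.card (Fin (k + 1) → Fin k → Fin n × Bool) := by
  -- the per-replica bounds, summed
  have h3 := sum_le_sum fun ℓ (_ : ℓ ∈ (univ : Finset (Fin (k + 1)))) =>
    slb_perReplica n k s F hsF Y ρ hρ1 hρ2 ℓ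
  rw [← sum_mul, ← mul_sum, ← sum_mul, sum_add_distrib, ← sum_mul, ← sum_mul] at h3
  rw [← Nat.cast_sum]
  set N := Fintype.card (Fin (k + 1) → Fin k → Fin n × Bool)
  set S := #(univ.filter fun u : Fin (k + 1) → Fin k → Fin n × Bool =>
      ∀ ℓ : Fin (k + 1), ∃ b : Fin k, Y ℓ (u (ρ b ℓ) b).1 = (u (ρ b ℓ) b).2) with hS
  set FA := ∑ ℓ : Fin (k + 1), #(univ.filter fun I : Fin s → Fin n =>
      ∀ ℓ' : Fin (k + 1), ℓ' < ℓ → ¬ ∀ r, Y ℓ (I r) = Y ℓ' (I r))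
  -- `Bad` = some replica is violated (the complement of the counted set) contains the pairwise
  -- disjoint sets `W ℓ` (greedy disjointification)
  set Bad := univ.filter fun u : Fin (k + 1) → Fin k → Fin n × Bool =>
      ¬ ∀ ℓ : Fin (k + 1), ∃ b : Fin k, Y ℓ (u (ρ b ℓ) b).1 = (u (ρ b ℓ) b).2
  have h2 : S + #Bad = N := by
    rw [hS, card_filter_add_card_filter_not, card_univ]
  have h1 : ∑ ℓ : Fin (k + 1), #(univ.filter fun u : Fin (k + 1) → Fin k → Fin n × Bool =>
      (∀ b, Y ℓ (u (ρ b ℓ) b).1 ≠ (u (ρ b ℓ) b).2) ∧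
        ∀ ℓ' : Fin (k + 1), ℓ' < ℓ → ¬ ∀ b, Y ℓ' (u (ρ b ℓ') b).1 ≠ (u (ρ b ℓ') b).2) ≤ #Bad := by
    rw [← card_biUnion]
    · refine card_le_card fun u hu => ?_
      obtain ⟨ℓ, -, hℓ⟩ := mem_biUnion.1 hu
      refine mem_filter.2 ⟨mem_univ _, fun hall => ?_⟩
      obtain ⟨b, hb⟩ := hall ℓ
      exact (mem_filter.1 hℓ).2.1 b hb
    · intro ℓ _ ℓ' _ hne
      simp only [Function.onFun, disjoint_left]
      intro u hu hu'
      rcases lt_or_gt_of_ne hne with h | h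
      · exact (mem_filter.1 hu').2.2 ℓ h (mem_filter.1 hu).2.1
      · exact (mem_filter.1 hu).2.2 ℓ' h (mem_filter.1 hu').2.1
  -- the cleared-denominator inequality; divide out
  have hgauss : (∑ ℓ : Fin (k + 1), (ℓ : ℕ)) * 2 = k * (k + 1) := by
    rw [Fin.sum_univ_eq_sum_range (fun i => i) (k + 1), sum_range_id_mul_two]
    simp [mul_comm]
  have hnat : 2 * N * FA * 2 ^ F + 2 * S * 2 ^ (k + F) * n ^ s ≤
      2 * N * 2 ^ (k + F) * n ^ s + k * (k + 1) * N * n ^ s := by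
    have e1 := congrArg (· * (2 ^ (k + F) * n ^ s)) h2
    have e2 := congrArg (· * (N * n ^ s)) hgauss
    nlinarith [h3, h1, e1, e2, Nat.zero_le (2 ^ (k + F) * n ^ s)]
  have key : (2 : ℝ) * N * FA * 2 ^ F + 2 * S * 2 ^ (k + F) * (n : ℝ) ^ s ≤
      2 * N * 2 ^ (k + F) * (n : ℝ) ^ s + k * (k + 1) * N * (n : ℝ) ^ s := by exact_mod_cast hnat
  have hz : (0 : ℝ) < (n : ℝ) ^ s := by positivity
  rw [← sub_nonneg, show (1 - (1 / 2 : ℝ) ^ k * (FA / (n : ℝ) ^ s - (k : ℝ) * (k + 1) / 2 *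
      (1 / 2 : ℝ) ^ F)) * N - S = (1 / 2 : ℝ) ^ k * (1 / 2) ^ F / (2 * (n : ℝ) ^ s) *
      (2 * N * 2 ^ (k + F) * (n : ℝ) ^ s + k * (k + 1) * N * (n : ℝ) ^ s -
        (2 * N * FA * 2 ^ F + 2 * S * 2 ^ (k + F) * (n : ℝ) ^ s)) by
    simp only [one_div, inv_pow]; field_simp; ring]
  exact mul_nonneg (by positivity) (by linarith)

end Literature.Computability.Complexity.HuangSellke2025Chain

end Part12

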